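import Literature.Analysis.FluidPDE.PineauVicolPressureDuality
import Literature.Analysis.FluidPDE.PineauVicolLerayPressure
import Literature.Analysis.FluidPDE.PineauVicolPressureDecayClass
import Literature.Analysis.FluidPDE.TypeIAncientMildDecay
import Literature.Analysis.FluidPDE.JiaSverak2014BootstrapTools
import Literature.Analysis.FunctionSpaces.SmoothParametricIntegralDominated
import HarnessLib

/-!
# Pointwise decay of ALL the derivatives of the Calderón–Zygmund pressure on the Type I decay class (Pineau–Vicol 2026, (8.3) for the pressure, every order `k`, `σ = 0`), and of its polar form `Qˢ[v,w]` with product constants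

Analysis/FluidPDE support file (all results proved; definitions with bodies for the polar form of the
pressure; **no named facts**), sequel of
`PineauVicolPressurePointwiseDecay` (the orders `k = 0, 1` of the same estimate) in the programme
around B. Pineau, V. Vicol, *On rotated backwards self-similar solutions of the incompressible 3D
Navier–Stokes equations*, arXiv:2607.09619 (2026). HONEST FRAMING: a transcription, with proof, of
one printed estimate for a class of hypothetical objects (profiles of the Type I decay class);
nothing here bears on Navier–Stokes regularity.

## The source, as printed

Lemma 8.1, proof (p. 28): "The starting point of the proof is the same as Lemma 7.1. By the same
argument, one can deduce the bounds
`|∇ᵏ_y U(y,s)| ≤ C_{U,k}(1+|y|)^{−(k+1)}`, `|∇ᵏ_y P(y,s)| ≤ C_{P,k}(1+|y|)^{−(2−σ+k)}`, `k ≥ 0`, (8.3)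
for all `(y,s) ∈ ℝ³ × [0,S]`, uniformly in `α`." Here `P = RᵢRⱼ(UᵢUⱼ)` "(as in the proof of
Lemma 2.1)" (Lemma 8.2, p. 28), and Lemma 2.1 (p. 9) is the case `k = 0`: under (1.9)
`|U(y)| ≤ C_{U,0}/(1+|y|)` and (2.1) `|∇ᵏU(y)| ≤ C_{U,k}/(1+|y|^{k+1})`, `k ∈ {1,2}`, the pressure obeys
(2.2) `|P(y)| ≤ C_{P,0}/(1+|y|^{2−σ})`, proved (p. 10) by splitting `RᵢRⱼ(UᵢUⱼ)(y)` at scale `|y|`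
into a near piece (two derivatives on `U ⊗ U`) and a far piece (the kernel's decay against
`|U|² ≲ |z|⁻²`).

## What is proved (all `σ = 0`; `Dᵏ = iteratedFDeriv ℝ k`; `Q[v]` = the tree's `pressurePotential v`)

* `PineauVicol2026.exists_bound_norm_iteratedFDeriv_pressurePotential_decay` — **(8.3) for the
  pressure at every order `k`**: an absolute `A_k` with `‖DᵏQ[v](x)‖ ≤ A_k C² (1+|x|)^{−(k+2)}` for all
  `x`, for every `v ∈ C^∞(ℝ³; ℝ³)` with `(1+|y|)^{j+1}‖Dʲv(y)‖ ≤ C`, `j ≤ k+2`. The argument is that of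
  Lemma 2.1 at order `k` (the file `PineauVicolPressurePointwiseDecay` runs it for `k = 0, 1`): the
  Navier–Stokes dilation `Q[v](x') = λ⁻²Q[λv(λ·)](x'/λ)` with `λ = |x| ≥ 1` gives
  `‖DᵏQ[v](x)‖ ≤ λ^{−(k+2)}‖DᵏQ[w](x/|x|)‖`, `w = λv(λ·)`, and `w` keeps the scale-invariant bounds
  `|y|^{j+1}‖Dʲw(y)‖ ≤ C`; at the unit vector `e`, `Q[w] = −Q₁^{1/4,1/2}[w] − Q₂^{1/4,1/2}[w]` with
  `DᵏQ₁ = Γ₀ * DᵏG[w]` (`G[w] = ∂ᵢ∂ⱼ(wᵢwⱼ)`; on the support `|e − z| ≥ 1/2`, where the pointwise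
  Leibniz bound gives `‖DᵏG[w]‖ ≤ 2^{k+1}(2^{k+3}C)²‖tr‖(1+‖tr‖)` — this is where `D^{k+2}v` enters)
  and `DᵏQ₂ = (DᵏD²Γ∞) * (w ⊗ w)` (the kernel `D^{k+2}Γ∞` decays like `(1+|z|)⁻³`, against
  `C²|y|⁻²`); for `|x| ≤ 1` the split at scale `1` directly.
* Tools, all orders (file-private, `[folklore]`): `iteratedFDeriv_newtonKernel_homogeneous` (`DⁿΓ` is homogeneous of degree
  `−1−n`), `exists_hasDecay_iteratedFDeriv_newtonFar` (`‖DⁿΓ∞(z)‖ ≤ M_n(1+|z|)⁻³`, `n ≥ 2`),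
  `contDiff_integral_clm_apply_comp_sub_decay_top` (far-type potentials `∫ L(y)Φ(x−y)dy` of the
  decay class are `C^∞` with all derivatives under the integral sign — the tree's
  `FunctionSpaces.iteratedFDeriv_integral_of_dominated`), `iteratedFDeriv_nearPotential_eq`
  (`DᵏQ₁[w] = Γ₀ * DᵏG[w]`, the tree's `JiaSverak2014.iteratedFDeriv_integral_smul_comp_sub`),
  `contDiff_farPotential_decay_top` / `contDiff_pressurePotential_decay_top` (`Q₂[w], Q[w] ∈ C^∞` on
  the decay class).
* `IsTypeIAncientMild.exists_forall_norm_iteratedFDeriv_pressurePotential_lerayOrbit_le_of_hasTypeIDecay`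
  — **(8.3) for the pressure, every order, on the KNSS-gauge Type I class** `IsTypeIAncientMild C V ∧
  HasTypeIDecay C V` (`TypeIAncientMild.lean`): `‖DᵏQ[U(s,·)](y)‖ ≤ M_k(C)(1+|y|)^{−(k+2)}` for ALL
  `s ∈ ℝ`, `y ∈ ℝ³`, where `U = lerayOrbit V` is the similarity profile — the class-uniform bounds
  `(1+|y|)^{n+1}‖DⁿU(s,·)(y)‖ ≤ K_n(C)` of every order
  (`IsTypeIAncientMild.exists_forall_pow_mul_norm_iteratedFDeriv_lerayOrbit_le_of_hasTypeIDecay`,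
  = (8.3) for `U`, Chae–Wolf (3.6) / Pineau–Vicol (7.2)) fed into the first theorem; the constant
  depends on `k` and `C` only, hence "uniformly in `α`" (the norms are rotation invariant) and in `s`.

* **The polar form** (appended): `pressureSourceBil v w = ∂ᵢ∂ⱼ(vᵢwⱼ) = div((v·∇)w + (div v)w)`,
  `nearPotentialBil`, `farPotentialBil`, `pressurePotentialBil v w = −Q₁[v,w] − Q₂[v,w]` (each
  `rfl`-equal to the quadratic object on the diagonal), `pressurePotentialSym v w = ½(Q[v,w] + Q[w,v])`
  — the symmetric bilinear form whose value at `(∂ₛU, U)` is `½∂ₛRᵢRⱼ(UᵢUⱼ)`, the pressure term of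
  the `s`-differentiated equation (1.14a) in the proof of Lemma 8.1; homogeneity in each slot,
  additivity and the polarisation identities `pressurePotential_add_sub` (`Q[v+w] − Q[v−w] = 4Qˢ[v,w]`)
  and `pressurePotential_add_smul_sub` (`Q[v+tw] − Q[v−tw] = 4tQˢ[v,w]`) for `C²` fields of the decay
  class; and `PineauVicol2026.exists_bound_norm_iteratedFDeriv_pressurePotentialSym_decay (k)` —
  **(8.3) for the polar form at every order with the PRODUCT of the constants**,
  `‖DᵏQˢ[v,w](x)‖ ≤ A_k Cᵥ C_w (1+|x|)^{−(k+2)}` (the all-orders quadratic bound at `v ± tw`,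
  `t = Cᵥ/C_w`), with the nested shapes `|Qˢ|`, `‖DQˢ‖`, `‖D²Qˢ‖` for `k = 0, 1, 2` — the shape of the
  printed "Arguing as in Lemma 2.1, these bounds then imply `|∇ᵏ∂ₛP| ≤ C_{U,s}(1+|α|)(1+|y|)^{−2+σ−k}`,
  `k ∈ {0,1,2}`" (p. 28), linear in the constant of `∂ₛU`. Not done here: the identification
  `∂ₛ(Q[U(·,s)]) = 2Qˢ[∂ₛU, U]` along a profile differentiable in `s`.

Tree note: the physical-variable form of the orders `k ≤ 2` for classical Type I solutions on the
whole past has been in the tree Summits-side since 2026-08-16 (`apexRieszPressure_scaleInvariantBounds`,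
not importable from `Literature/`); the Leray-variable orders `k = 0, 1` with the nested-`fderiv`
shapes are `PineauVicol2026.exists_bound_abs_pressurePotential_decay` /
`exists_bound_norm_fderiv_pressurePotential_decay` (`PineauVicolPressurePointwiseDecay`).

## References

* B. Pineau, V. Vicol, arXiv:2607.09619 (2026): Lemma 8.1 and its proof, (8.2)–(8.3) (p. 28);
  Lemma 2.1, (1.9), (2.1)–(2.2) (p. 9) and its proof (p. 10); Lemma 7.1 (7.2) (p. 24). [PineauVicol2026]
* D. Chae, J. Wolf, Comm. PDE 42 (2017) = arXiv:1610.09464, §3 (3.6) (p. 8). [ChaeWolf2017RemovingDSS]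
* G. Koch, N. Nadirashvili, G. Seregin, V. Šverák, Acta Math. 203 (2009) = arXiv:0709.3599, §4.
  [KochNadirashviliSereginSverak2009]
-/

noncomputable section

open MeasureTheory Set Filter Metric Topology InnerProductSpace Function
open scoped RealInnerProductSpace Laplacian ContDiff ENNReal

namespace Literature.Analysis.FluidPDE

namespace PineauVicol2026

open Literature.Analysis.FluidPDE.FourierNS (HasDecay)

-- nested operator types
set_option maxSynthPendingDepth 3

/-! ### Helpers copied (file-private) from `PineauVicolPressurePointwiseDecay`, so that this file does not import it -/

/-- `|y|⁻²` is integrable on balls of `ℝ³` (`2 < 3 = dim`). [folklore] -/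
private theorem integrableOn_inv_norm_sq_ball_ao (r : ℝ) :
    IntegrableOn (fun y : (EuclideanSpace ℝ (Fin 3)) => (‖y‖ ^ 2)⁻¹) (ball 0 r) := by
  have hd : Module.finrank ℝ (EuclideanSpace ℝ (Fin 3)) = 3 := finrank_euclideanSpace_fin
  refine integrableOn_ball_of_norm_le_rpow (μ := volume) (C := 1) (α := 2) (by rw [hd]; norm_num)
    (by rw [hd]; norm_num) (Eventually.of_forall fun y => le_of_eq ?_) ?_
  · rw [Real.rpow_neg (norm_nonneg y), Real.rpow_two, norm_inv, norm_pow, norm_norm, one_mul]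
  · exact ((continuous_norm.pow 2).measurable.inv).aestronglyMeasurable

/-! ### The far potential at unit scale against the weight `|y|⁻²` -/

/-- `aᵏ · C/(1+a)ᵏ ≤ C` for `a, C ≥ 0`. [folklore] -/
private theorem pow_mul_div_one_add_pow_le_ao {a C : ℝ} (ha : 0 ≤ a) (hC : 0 ≤ C) (k : ℕ) :
    a ^ k * (C / (1 + a) ^ k) ≤ C := by
  have h1 : a ^ k ≤ (1 + a) ^ k := pow_le_pow_left₀ ha (by linarith) k
  have hp : 0 < (1 + a) ^ k := by positivity
  rw [mul_div_assoc', div_le_iff₀ hp]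
  nlinarith [mul_le_mul_of_nonneg_left h1 hC]

/-- The dilation `w(z) = λ v(λ z)`, `λ > 0`, of a field with `(1+|y|)|v(y)| ≤ C₀` stays in the decay
class, with constant `max(λ,1) C₀` (the rescaling `ũ = r u(y + r x̃)` of the source's proof).
[cite: PineauVicol2026, Lemma 2.1, proof of (2.1) (p. 9–10)] -/
private theorem norm_smul_comp_smul_le_decay_ao {v : (EuclideanSpace ℝ (Fin 3)) → (EuclideanSpace ℝ (Fin 3))} {C₀ : ℝ} (hv : ∀ y, ‖v y‖ ≤ C₀ / (1 + ‖y‖))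
    {lam : ℝ} (hlam : 0 < lam) (y : (EuclideanSpace ℝ (Fin 3))) :
    ‖lam • v (lam • y)‖ ≤ max lam 1 * C₀ / (1 + ‖y‖) := by
  have hC0 : 0 ≤ C₀ := by
    have h := (norm_nonneg _).trans (hv 0); rw [norm_zero, add_zero, div_one] at h; exact h
  have h := hv (lam • y)
  rw [norm_smul, Real.norm_eq_abs, abs_of_pos hlam] at h ⊢
  have hden : 0 < 1 + lam * ‖y‖ := by positivity
  have hden' : 0 < 1 + ‖y‖ := by positivity
  have hmax1 : 1 ≤ max lam 1 := le_max_right _ _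
  have hmaxl : lam ≤ max lam 1 := le_max_left _ _
  rw [le_div_iff₀ hden']
  calc lam * ‖v (lam • y)‖ * (1 + ‖y‖) ≤ lam * (C₀ / (1 + lam * ‖y‖)) * (1 + ‖y‖) :=
        mul_le_mul_of_nonneg_right (mul_le_mul_of_nonneg_left h hlam.le) hden'.le
    _ = (lam * (1 + ‖y‖)) * C₀ / (1 + lam * ‖y‖) := by ring
    _ ≤ (max lam 1 * (1 + lam * ‖y‖)) * C₀ / (1 + lam * ‖y‖) := by
        refine div_le_div_of_nonneg_right (mul_le_mul_of_nonneg_right ?_ hC0) hden.le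
        nlinarith [mul_le_mul_of_nonneg_right hmaxl (norm_nonneg y),
          mul_le_mul_of_nonneg_right hmax1 (mul_nonneg hlam.le (norm_nonneg y))]
    _ = max lam 1 * C₀ := by field_simp

/-- For the dilation `w(z) = λ v(λ z)`: `|y| |w(y)| ≤ C₀` from `(1+|y|)|v(y)| ≤ C₀` — the constant
does not see `λ` (the rescaling `ũ = r u(y + r x̃)`, "a bound which is independent of `y`").
[cite: PineauVicol2026, Lemma 2.1, proof of (2.1) (p. 9–10)] -/
private theorem norm_smul_comp_smul_mul_norm_le_ao {v : (EuclideanSpace ℝ (Fin 3)) → (EuclideanSpace ℝ (Fin 3))} {C₀ : ℝ} (hv : ∀ y, ‖v y‖ ≤ C₀ / (1 + ‖y‖))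
    {lam : ℝ} (hlam : 0 < lam) (y : (EuclideanSpace ℝ (Fin 3))) : ‖lam • v (lam • y)‖ * ‖y‖ ≤ C₀ := by
  have hC0 : 0 ≤ C₀ := by
    have h := (norm_nonneg _).trans (hv 0); rw [norm_zero, add_zero, div_one] at h; exact h
  have h := hv (lam • y)
  rw [norm_smul, Real.norm_eq_abs, abs_of_pos hlam] at h ⊢
  calc lam * ‖v (lam • y)‖ * ‖y‖ = (lam * ‖y‖) ^ 1 * ‖v (lam • y)‖ := by ring
    _ ≤ (lam * ‖y‖) ^ 1 * (C₀ / (1 + lam * ‖y‖) ^ 1) := by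
        rw [pow_one (1 + lam * ‖y‖)]
        exact mul_le_mul_of_nonneg_left h (by positivity)
    _ ≤ C₀ := pow_mul_div_one_add_pow_le_ao (by positivity) hC0 1

/-- **Far part, unit scale, any kernel decaying like `(1+|z|)⁻³`**: for `‖Ψ z‖ ≤ M/(1+|z|)³`, a field
with `|y| |w(y)| ≤ C₀` and `|e| ≤ 1`, `∫ ‖Ψ(e − y)‖ ‖w y‖² dy ≤ M C₀² (I₂ + 8 K₅)` in the sense of an
integrable a.e. dominator (as in `exists_bound_farPotential_unitScale`). [cite: PineauVicol2026, Lemma 2.1, proof of (2.2) (p. 10)] -/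
private theorem exists_dominator_unitScale_ao :
    ∃ K : ℝ, 0 ≤ K ∧ ∀ {F : Type*} [NormedAddCommGroup F] (Ψ : EuclideanSpace ℝ (Fin 3) → F) (M : ℝ),
      0 ≤ M → (∀ z, ‖Ψ z‖ ≤ M / (1 + ‖z‖) ^ 3) →
      ∀ (w : EuclideanSpace ℝ (Fin 3) → EuclideanSpace ℝ (Fin 3)) (C₀ : ℝ),
        (∀ y, ‖w y‖ * ‖y‖ ≤ C₀) → ∀ e : EuclideanSpace ℝ (Fin 3), ‖e‖ ≤ 1 →
          ∃ g : EuclideanSpace ℝ (Fin 3) → ℝ, Integrable g ∧ ∫ y, g y ≤ K * M * C₀ ^ 2 ∧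
            ∀ᵐ y : EuclideanSpace ℝ (Fin 3) ∂volume, ‖Ψ (e - y)‖ * ‖w y‖ ^ 2 ≤ g y := by
  set I₂ : ℝ := ∫ y in ball (0 : EuclideanSpace ℝ (Fin 3)) 2, (‖y‖ ^ 2)⁻¹ with hI₂
  set K₅ : ℝ := ∫ y : EuclideanSpace ℝ (Fin 3), ((1 + ‖y‖) ^ 5)⁻¹ with hK₅
  have hI₂0 : 0 ≤ I₂ := integral_nonneg fun y => by positivity
  have hK₅0 : 0 ≤ K₅ := integral_nonneg fun y => by positivity
  refine ⟨I₂ + 8 * K₅, by positivity, ?_⟩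
  intro F _ Ψ M hM0 hΨ w C₀ hw e he
  have hC0 : 0 ≤ C₀ := by simpa using hw 0
  set g : EuclideanSpace ℝ (Fin 3) → ℝ := fun y =>
    M * C₀ ^ 2 * ((ball (0 : EuclideanSpace ℝ (Fin 3)) 2).indicator (fun y => (‖y‖ ^ 2)⁻¹) y +
      8 * ((1 + ‖y‖) ^ 5)⁻¹) with hg
  have hgi : Integrable g := by
    refine Integrable.const_mul (Integrable.add ?_ ?_) _
    · exact (integrableOn_inv_norm_sq_ball_ao 2).integrable_indicator measurableSet_ball
    · exact (integrable_inv_one_add_norm_pow (by norm_num : 4 ≤ 5)).const_mul 8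
  have hgint : ∫ y, g y = M * C₀ ^ 2 * (I₂ + 8 * K₅) := by
    simp only [hg]
    rw [integral_const_mul, integral_add
      ((integrableOn_inv_norm_sq_ball_ao 2).integrable_indicator measurableSet_ball)
      ((integrable_inv_one_add_norm_pow (by norm_num : 4 ≤ 5)).const_mul 8),
      integral_indicator measurableSet_ball, integral_const_mul]
  refine ⟨g, hgi, by rw [hgint]; exact le_of_eq (by ring), ?_⟩
  filter_upwards [Measure.ae_ne volume (0 : EuclideanSpace ℝ (Fin 3))] with y hy
  have hy0 : 0 < ‖y‖ := norm_pos_iff.2 hy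
  have hwy : ‖w y‖ ≤ C₀ / ‖y‖ := by rw [le_div_iff₀ hy0]; exact hw y
  have hwy2 : ‖w y‖ ^ 2 ≤ C₀ ^ 2 * (‖y‖ ^ 2)⁻¹ := by
    rw [← div_eq_mul_inv, ← div_pow]
    exact pow_le_pow_left₀ (norm_nonneg _) hwy 2
  have hker := hΨ (e - y)
  by_cases hy2 : ‖y‖ < 2
  · have hind : (ball (0 : EuclideanSpace ℝ (Fin 3)) 2).indicator
        (fun y : EuclideanSpace ℝ (Fin 3) => (‖y‖ ^ 2)⁻¹) y = (‖y‖ ^ 2)⁻¹ :=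
      indicator_of_mem (mem_ball_zero_iff.2 hy2) _
    have hk1 : ‖Ψ (e - y)‖ ≤ M := by
      refine hker.trans (div_le_self hM0 ?_)
      exact one_le_pow₀ (by linarith [norm_nonneg (e - y)])
    calc ‖Ψ (e - y)‖ * ‖w y‖ ^ 2 ≤ M * (C₀ ^ 2 * (‖y‖ ^ 2)⁻¹) :=
          mul_le_mul hk1 hwy2 (sq_nonneg _) hM0
      _ ≤ g y := by
          simp only [hg, hind]
          have : 0 ≤ M * C₀ ^ 2 * (8 * ((1 + ‖y‖) ^ 5)⁻¹) := by positivity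
          nlinarith [this]
  · rw [not_lt] at hy2
    have hind : (ball (0 : EuclideanSpace ℝ (Fin 3)) 2).indicator
        (fun y : EuclideanSpace ℝ (Fin 3) => (‖y‖ ^ 2)⁻¹) y = 0 :=
      indicator_of_notMem (by rw [mem_ball_zero_iff, not_lt]; exact hy2) _
    have hey : ‖y‖ ≤ 1 + ‖e - y‖ := by
      have := norm_sub_norm_le y e
      rw [norm_sub_rev] at this
      linarith
    have hk1 : ‖Ψ (e - y)‖ ≤ M / ‖y‖ ^ 3 := by
      refine hker.trans (div_le_div_of_nonneg_left hM0 (by positivity) ?_)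
      exact pow_le_pow_left₀ (norm_nonneg _) hey 3
    have h5 : M / ‖y‖ ^ 3 * (C₀ ^ 2 * (‖y‖ ^ 2)⁻¹) = M * C₀ ^ 2 / ‖y‖ ^ 5 := by
      field_simp
    have h6 : M * C₀ ^ 2 / ‖y‖ ^ 5 ≤ M * C₀ ^ 2 * (8 * ((1 + ‖y‖) ^ 5)⁻¹) := by
      rw [div_le_iff₀ (by positivity)]
      have hp : 0 < (1 + ‖y‖) ^ 5 := by positivity
      have : M * C₀ ^ 2 * (8 * ((1 + ‖y‖) ^ 5)⁻¹) * ‖y‖ ^ 5 =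
          M * C₀ ^ 2 * ((8 * ‖y‖ ^ 5) / (1 + ‖y‖) ^ 5) := by
        field_simp
      rw [this]
      have h23 : (1 + ‖y‖) ^ 5 ≤ 8 * ‖y‖ ^ 5 := by
        have h1 : 1 + ‖y‖ ≤ (3 / 2) * ‖y‖ := by linarith
        have h2 : (1 + ‖y‖) ^ 5 ≤ ((3 / 2) * ‖y‖) ^ 5 := pow_le_pow_left₀ (by positivity) h1 5
        nlinarith [h2, pow_nonneg hy0.le 5]
      have h7 : 1 ≤ (8 * ‖y‖ ^ 5) / (1 + ‖y‖) ^ 5 := by rw [le_div_iff₀ hp]; linarith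
      have hMC : 0 ≤ M * C₀ ^ 2 := by positivity
      nlinarith [mul_le_mul_of_nonneg_left h7 hMC]
    calc ‖Ψ (e - y)‖ * ‖w y‖ ^ 2 ≤ M / ‖y‖ ^ 3 * (C₀ ^ 2 * (‖y‖ ^ 2)⁻¹) :=
          mul_le_mul hk1 hwy2 (sq_nonneg _) (by positivity)
      _ = M * C₀ ^ 2 / ‖y‖ ^ 5 := h5
      _ ≤ M * C₀ ^ 2 * (8 * ((1 + ‖y‖) ^ 5)⁻¹) := h6
      _ = g y := by simp only [hg, hind, zero_add]

/-- For the dilation `w(z) = λ v(λ z)`, `λ > 0`: `|y|^{j+1} ‖Dʲw(y)‖ ≤ C` from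
`(1+|y|)^{j+1} ‖Dʲv(y)‖ ≤ C` (`Dʲw(y) = λ^{j+1} (Dʲv)(λy)`; the rescaling of the source's proof).
[cite: PineauVicol2026, Lemma 2.1, proof of (2.1) (p. 9–10)] -/
private theorem pow_mul_norm_iteratedFDeriv_smul_comp_smul_le_ao
    {v : EuclideanSpace ℝ (Fin 3) → EuclideanSpace ℝ (Fin 3)} (hv : ContDiff ℝ ∞ v) {C : ℝ} {j : ℕ}
    (hC : ∀ y, (1 + ‖y‖) ^ (j + 1) * ‖iteratedFDeriv ℝ j v y‖ ≤ C) {lam : ℝ} (hlam : 0 < lam)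
    (y : EuclideanSpace ℝ (Fin 3)) :
    ‖y‖ ^ (j + 1) * ‖iteratedFDeriv ℝ j (fun z => lam • v (lam • z)) y‖ ≤ C := by
  have hC0 : 0 ≤ C := by
    have := hC 0
    exact le_trans (by positivity) this
  -- `‖Dʲ(λ v(λ ·))(y)‖ ≤ λ^{j+1} ‖Dʲv(λ y)‖` (chain rule with the dilation `L = λ id`)
  have h : ‖iteratedFDeriv ℝ j (fun z => lam • v (lam • z)) y‖ ≤
      lam * lam ^ j * ‖iteratedFDeriv ℝ j v (lam • y)‖ := by
    set L : EuclideanSpace ℝ (Fin 3) →L[ℝ] EuclideanSpace ℝ (Fin 3) :=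
      lam • ContinuousLinearMap.id ℝ (EuclideanSpace ℝ (Fin 3)) with hL
    have hvj : ContDiff ℝ j v := hv.of_le (by exact_mod_cast le_top)
    have hvL : ContDiff ℝ j (v ∘ L) := hvj.comp L.contDiff
    have e1 : (fun z => lam • v (lam • z)) = lam • (v ∘ L) := by
      funext z; simp [hL]
    rw [e1, iteratedFDeriv_const_smul_apply (a := lam) hvL.contDiffAt, norm_smul, Real.norm_eq_abs,
      abs_of_pos hlam, L.iteratedFDeriv_comp_right hvj y le_rfl]
    have hLy : L y = lam • y := by simp [hL]
    rw [hLy, mul_assoc]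
    refine mul_le_mul_of_nonneg_left ?_ hlam.le
    refine (ContinuousMultilinearMap.norm_compContinuousLinearMap_le _ _).trans ?_
    rw [Finset.prod_const, Finset.card_univ, Fintype.card_fin, mul_comm]
    have hLn : ‖L‖ ≤ lam := by
      rw [hL, norm_smul, Real.norm_eq_abs, abs_of_pos hlam]
      calc lam * ‖ContinuousLinearMap.id ℝ (EuclideanSpace ℝ (Fin 3))‖ ≤ lam * 1 := by
            gcongr; exact ContinuousLinearMap.norm_id_le
        _ = lam := mul_one _
    exact mul_le_mul_of_nonneg_right (pow_le_pow_left₀ (norm_nonneg _) hLn j) (norm_nonneg _)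
  have h2 := hC (lam • y)
  rw [norm_smul, Real.norm_eq_abs, abs_of_pos hlam] at h2
  have hly : 0 ≤ lam * ‖y‖ := by positivity
  have hpow : (lam * ‖y‖) ^ (j + 1) ≤ (1 + lam * ‖y‖) ^ (j + 1) :=
    pow_le_pow_left₀ hly (by linarith) _
  have hD0 := norm_nonneg (iteratedFDeriv ℝ j v (lam • y))
  calc ‖y‖ ^ (j + 1) * ‖iteratedFDeriv ℝ j (fun z => lam • v (lam • z)) y‖
      ≤ ‖y‖ ^ (j + 1) * (lam * lam ^ j * ‖iteratedFDeriv ℝ j v (lam • y)‖) :=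
        mul_le_mul_of_nonneg_left h (by positivity)
    _ = (lam * ‖y‖) ^ (j + 1) * ‖iteratedFDeriv ℝ j v (lam • y)‖ := by ring
    _ ≤ (1 + lam * ‖y‖) ^ (j + 1) * ‖iteratedFDeriv ℝ j v (lam • y)‖ :=
        mul_le_mul_of_nonneg_right hpow hD0
    _ ≤ C := h2



/-! ### The derivatives of all orders of the Newton kernel and of `Γ∞` -/

/-- **`DⁿΓ` is homogeneous of degree `−1−n`** (all orders; induction on `n` with the tree's
`fderiv_homogeneous` and the curry-left isomorphism). [folklore] -/
private theorem iteratedFDeriv_newtonKernel_homogeneous (n : ℕ) :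
    ∀ c : ℝ, 0 < c → ∀ z : EuclideanSpace ℝ (Fin 3),
      iteratedFDeriv ℝ n newtonKernel (c • z) = c ^ (-1 - (n : ℤ)) • iteratedFDeriv ℝ n newtonKernel z := by
  induction n with
  | zero =>
    intro c hc z
    ext v
    rw [iteratedFDeriv_zero_apply, smul_apply, iteratedFDeriv_zero_apply,
      newtonKernel_homogeneous c hc z]
    simp
  | succ n ih =>
    intro c hc z
    rw [iteratedFDeriv_succ_eq_comp_left, Function.comp_apply, Function.comp_apply,
      fderiv_homogeneous _ _ ih c hc z, map_smul]
    congr 1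
    push_cast
    ring_nf

variable {r₀ r₁ : ℝ}

/-- **`DⁿΓ∞` decays like `(1+|z|)⁻³` for every `n ≥ 2`** (off the ball of radius `r₁` it is
`DⁿΓ`, homogeneous of degree `−1−n ≤ −3`; inside it is bounded): the all-orders form of the tree's
`exists_hasDecay_fderiv_newtonFar` (`n = 2, 3, 4`). [folklore] -/
private theorem exists_hasDecay_iteratedFDeriv_newtonFar (h₀ : 0 < r₀) (h₁ : r₀ < r₁) {n : ℕ} (hn : 2 ≤ n) :
    ∃ M, HasDecay 3 M (iteratedFDeriv ℝ n (newtonFar r₀ r₁)) := by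
  have hr1 : 0 ≤ r₁ := (h₀.trans h₁).le
  have hΨ : Continuous (iteratedFDeriv ℝ n (newtonFar r₀ r₁)) :=
    (contDiff_newtonFar h₀ h₁ (n := n)).continuous_iteratedFDeriv le_rfl
  have heq : ∀ z : EuclideanSpace ℝ (Fin 3), r₁ < ‖z‖ →
      iteratedFDeriv ℝ n (newtonFar r₀ r₁) z = iteratedFDeriv ℝ n newtonKernel z := by
    intro z hz
    have hopen : IsOpen {w : EuclideanSpace ℝ (Fin 3) | r₁ < ‖w‖} := isOpen_lt continuous_const continuous_norm
    have hev : newtonFar r₀ r₁ =ᶠ[𝓝 z] newtonKernel :=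
      Filter.eventuallyEq_of_mem (hopen.mem_nhds hz) fun w hw => newtonFar_eq_newtonKernel h₀.le h₁ (le_of_lt hw)
    exact (hev.iteratedFDeriv ℝ n).eq_of_nhds
  have hcont : ContinuousOn (iteratedFDeriv ℝ n newtonKernel) {0}ᶜ := by
    have h1 := (contDiffOn_newtonKernel (n := n)).continuousOn_iteratedFDerivWithin le_rfl
      isOpen_compl_singleton.uniqueDiffOn
    exact h1.congr fun z hz => (iteratedFDerivWithin_of_isOpen n isOpen_compl_singleton hz).symm
  obtain ⟨M, hM0, hM⟩ := exists_decay_of_homogeneous _ (-1 - (n : ℤ)) (by omega)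
    (iteratedFDeriv_newtonKernel_homogeneous n) hcont
  exact hasDecay_three_of_eqOn_far hΨ hr1 heq hM0 (by omega) hM

/-- The same for `Φ = D²Γ∞`: every derivative `DᵐΦ` decays like `(1+|z|)⁻³`
(`‖Dᵐ(D²Γ∞)‖ = ‖D^{m+2}Γ∞‖`). [folklore] -/
private theorem exists_hasDecay_iteratedFDeriv_fderiv2_newtonFar (h₀ : 0 < r₀) (h₁ : r₀ < r₁) (m : ℕ) :
    ∃ M, HasDecay 3 M (iteratedFDeriv ℝ m (fderiv ℝ (fderiv ℝ (newtonFar r₀ r₁)))) := by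
  obtain ⟨M, hM⟩ := exists_hasDecay_iteratedFDeriv_newtonFar h₀ h₁ (n := m + 2) (by omega)
  refine ⟨M, fun z => ?_⟩
  rw [norm_iteratedFDeriv_fderiv, norm_iteratedFDeriv_fderiv]
  exact hM z

/-! ### Far-type parametric integrals `∫ L(y)(Φ(x − y)) dy` of the decay class: all orders -/

section FarAllOrders

variable {F : Type*} [NormedAddCommGroup F] [NormedSpace ℝ F]
  {G : Type*} [NormedAddCommGroup G] [NormedSpace ℝ G]

/-- The parameter derivatives of `x ↦ L(y)(Φ(x − y))`: `Dᵐₓ[L(y)(Φ(x − y))] = L(y) ∘ (DᵐΦ)(x − y)`.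
[folklore] -/
private theorem iteratedFDeriv_clm_apply_comp_sub {Φ : EuclideanSpace ℝ (Fin 3) → F}
    (hΦ : ContDiff ℝ ∞ Φ) (L : F →L[ℝ] G) (m : ℕ) (y x : EuclideanSpace ℝ (Fin 3)) :
    iteratedFDeriv ℝ m (fun q => L (Φ (q - y))) x =
      L.compContinuousMultilinearMap (iteratedFDeriv ℝ m Φ (x - y)) := by
  have hf : ContDiff ℝ ∞ (fun q : EuclideanSpace ℝ (Fin 3) => Φ (q - y)) :=
    hΦ.comp (contDiff_id.sub contDiff_const)
  have e1 : (fun q => L (Φ (q - y))) = L ∘ (fun q => Φ (q - y)) := rfl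
  rw [e1, L.iteratedFDeriv_comp_left hf.contDiffAt (by exact_mod_cast le_top),
    iteratedFDeriv_comp_sub]

/-- **All derivatives under the integral sign for far-type potentials of the decay class.** If
`Φ ∈ C^∞` has every derivative decaying like `(1+|z|)⁻³` and the operator weight `L` is continuous
with `‖L(y)‖ ≤ A(1+|y|)⁻²`, then `x ↦ ∫ L(y)(Φ(x − y)) dy` is `C^∞` with
`Dᵐ ∫ L(y)(Φ(x − y)) dy = ∫ L(y) ∘ (DᵐΦ)(x − y) dy` (local domination by
`M_m A (2+|x₀|)³ (1+|y|)⁻⁵`, the tree's `FunctionSpaces.iteratedFDeriv_integral_of_dominated`).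
[folklore] -/
private theorem contDiff_integral_clm_apply_comp_sub_decay_top [CompleteSpace G]
    {Φ : EuclideanSpace ℝ (Fin 3) → F} {L : EuclideanSpace ℝ (Fin 3) → F →L[ℝ] G}
    (hΦ : ContDiff ℝ ∞ Φ) {M : ℕ → ℝ} (hM : ∀ m, HasDecay 3 (M m) (iteratedFDeriv ℝ m Φ))
    (hLc : Continuous L) {A : ℝ} (hL : HasDecay 2 A L) :
    ContDiff ℝ ∞ (fun x => ∫ y, L y (Φ (x - y))) ∧
      ∀ (m : ℕ) (x : EuclideanSpace ℝ (Fin 3)), iteratedFDeriv ℝ m (fun x => ∫ y, L y (Φ (x - y))) x =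
        ∫ y, (L y).compContinuousMultilinearMap (iteratedFDeriv ℝ m Φ (x - y)) := by
  have hform := fun m y x => iteratedFDeriv_clm_apply_comp_sub hΦ (L y) m y x
  have hf : ∀ᵐ y : EuclideanSpace ℝ (Fin 3) ∂volume,
      ContDiffOn ℝ ∞ (fun x => L y (Φ (x - y))) univ :=
    Eventually.of_forall fun y =>
      ((L y).contDiff.comp (hΦ.comp (contDiff_id.sub contDiff_const))).contDiffOn
  have hmeas : ∀ m : ℕ, ∀ x ∈ (univ : Set (EuclideanSpace ℝ (Fin 3))),
      AEStronglyMeasurable (fun y => iteratedFDeriv ℝ m (fun q => L y (Φ (q - y))) x) volume := by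
    intro m x _
    have e1 : (fun y => iteratedFDeriv ℝ m (fun q => L y (Φ (q - y))) x) =
        fun y => (L y).compContinuousMultilinearMap (iteratedFDeriv ℝ m Φ (x - y)) := by
      funext y; exact hform m y x
    rw [e1]
    have hB := (ContinuousLinearMap.compContinuousMultilinearMapL ℝ
      (fun _ : Fin m => EuclideanSpace ℝ (Fin 3)) F G).continuous₂
    have hΦm : Continuous (iteratedFDeriv ℝ m Φ) := hΦ.continuous_iteratedFDeriv (by exact_mod_cast le_top)
    exact (hB.comp (hLc.prodMk (hΦm.comp (continuous_const.sub continuous_id)))).aestronglyMeasurable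
  have hdom : ∀ m : ℕ, ∀ x₀ ∈ (univ : Set (EuclideanSpace ℝ (Fin 3))), ∃ ε > 0,
      ∃ g : EuclideanSpace ℝ (Fin 3) → ℝ, Integrable g volume ∧
        ∀ᵐ y : EuclideanSpace ℝ (Fin 3) ∂volume, ∀ x ∈ ball x₀ ε,
          ‖iteratedFDeriv ℝ m (fun q => L y (Φ (q - y))) x‖ ≤ g y := by
    intro m x₀ _
    refine ⟨1, one_pos, fun y => M m * A * (2 + ‖x₀‖) ^ 3 * ((1 + ‖y‖) ^ 5)⁻¹,
      integrable_inv_one_add_norm_pow_five.const_mul _, Eventually.of_forall fun y x hx => ?_⟩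
    rw [hform m y x]
    have hx' : ‖x - x₀‖ < 1 := by rwa [mem_ball_iff_norm] at hx
    calc ‖(L y).compContinuousMultilinearMap (iteratedFDeriv ℝ m Φ (x - y))‖
        ≤ ‖L y‖ * ‖iteratedFDeriv ℝ m Φ (x - y)‖ :=
          ContinuousLinearMap.norm_compContinuousMultilinearMap_le _ _
      _ ≤ M m * A * (2 + ‖x₀‖) ^ 3 * ((1 + ‖y‖) ^ 5)⁻¹ := norm_mul_norm_comp_sub_le (hM m) hL hx' y
  refine ⟨contDiffOn_univ.1 (FunctionSpaces.contDiffOn_integral_of_dominated isOpen_univ hf hmeas hdom),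
    fun m x => ?_⟩
  rw [FunctionSpaces.iteratedFDeriv_integral_of_dominated isOpen_univ hf hmeas hdom m (mem_univ x)]
  exact integral_congr_ae (Eventually.of_forall fun y => hform m y x)

end FarAllOrders

/-! ### The near potential: all derivatives fall on the source -/

/-- **`DᵏQ₁[w](x) = ∫ Γ₀(z) DᵏG[w](x − z) dz`** for `w ∈ C^∞` (the tree's
`JiaSverak2014.iteratedFDeriv_integral_smul_comp_sub`: `Γ₀ ∈ L¹` vanishes off the ball of radius
`r₁`, `G[w] ∈ C^∞`). [folklore] -/
private theorem iteratedFDeriv_nearPotential_eq (h₀ : 0 ≤ r₀) (h₁ : r₀ < r₁)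
    {w : EuclideanSpace ℝ (Fin 3) → EuclideanSpace ℝ (Fin 3)} (hw : ContDiff ℝ ∞ w) (k : ℕ)
    (x : EuclideanSpace ℝ (Fin 3)) :
    iteratedFDeriv ℝ k (nearPotential r₀ r₁ w) x =
      ∫ z, newtonNear r₀ r₁ z • iteratedFDeriv ℝ k (pressureSource w) (x - z) := by
  have hG : ContDiff ℝ k (pressureSource w) :=
    contDiff_pressureSource (n := k) (by exact_mod_cast (contDiff_infty.1 hw (k + 2)))
  have e1 : nearPotential r₀ r₁ w = fun x => ∫ z, newtonNear r₀ r₁ z • pressureSource w (x - z) := by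
    funext x; rfl
  have h := JiaSverak2014.iteratedFDeriv_integral_smul_comp_sub (integrable_newtonNear h₀ h₁)
    (fun z hz => newtonNear_eq_zero h₀ h₁ hz.le) hG k le_rfl
  rw [e1, h]

/-- **The near part is bounded by `‖Γ₀‖₁` times a bound for `DᵏG[w]` on the ball `B(x, r₁)`**:
if `‖DᵏG[w](x − z)‖ ≤ B` for `|z| < r₁` then `‖DᵏQ₁[w](x)‖ ≤ ‖Γ₀‖₁ B`. [folklore] -/
private theorem norm_iteratedFDeriv_nearPotential_le (h₀ : 0 ≤ r₀) (h₁ : r₀ < r₁)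
    {w : EuclideanSpace ℝ (Fin 3) → EuclideanSpace ℝ (Fin 3)} (hw : ContDiff ℝ ∞ w) (k : ℕ)
    (x : EuclideanSpace ℝ (Fin 3)) {B : ℝ}
    (hB : ∀ z : EuclideanSpace ℝ (Fin 3), ‖z‖ < r₁ → ‖iteratedFDeriv ℝ k (pressureSource w) (x - z)‖ ≤ B) :
    ‖iteratedFDeriv ℝ k (nearPotential r₀ r₁ w) x‖ ≤ (∫ z, |newtonNear r₀ r₁ z|) * B := by
  rw [iteratedFDeriv_nearPotential_eq h₀ h₁ hw k x]
  have hint : Integrable fun z => |newtonNear r₀ r₁ z| * B := (integrable_newtonNear h₀ h₁).abs.mul_const _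
  calc ‖∫ z, newtonNear r₀ r₁ z • iteratedFDeriv ℝ k (pressureSource w) (x - z)‖
      ≤ ∫ z, |newtonNear r₀ r₁ z| * B := by
        refine norm_integral_le_of_norm_le hint (Eventually.of_forall fun z => ?_)
        rw [norm_smul, Real.norm_eq_abs]
        by_cases hz : r₁ ≤ ‖z‖
        · rw [newtonNear_eq_zero h₀ h₁ hz, abs_zero, zero_mul, zero_mul]
        · exact mul_le_mul_of_nonneg_left (hB z (not_le.1 hz)) (abs_nonneg _)
    _ = (∫ z, |newtonNear r₀ r₁ z|) * B := integral_mul_const _ _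

/-- `Σᵢ C(m,i) aᵢ bᵢ ≤ 2ᵐ B²` when `0 ≤ aᵢ ≤ B`, `0 ≤ bᵢ ≤ B`. [folklore] -/
private theorem sum_choose_mul_le_sq_allOrders {m : ℕ} {a b : ℕ → ℝ} {B : ℝ} (hB : 0 ≤ B)
    (hb0 : ∀ i, 0 ≤ b i)
    (ha : ∀ i ∈ Finset.range (m + 1), a i ≤ B) (hb : ∀ i ∈ Finset.range (m + 1), b i ≤ B) :
    ∑ i ∈ Finset.range (m + 1), (m.choose i : ℝ) * a i * b i ≤ 2 ^ m * B ^ 2 := by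
  have hsum : ∑ i ∈ Finset.range (m + 1), (m.choose i : ℝ) = 2 ^ m := by
    have := Nat.sum_range_choose m
    exact_mod_cast this
  calc ∑ i ∈ Finset.range (m + 1), (m.choose i : ℝ) * a i * b i
      ≤ ∑ i ∈ Finset.range (m + 1), (m.choose i : ℝ) * B * B :=
        Finset.sum_le_sum fun i hi =>
          mul_le_mul (mul_le_mul_of_nonneg_left (ha i hi) (Nat.cast_nonneg _)) (hb i hi) (hb0 i)
            (mul_nonneg (Nat.cast_nonneg _) hB)
    _ = (∑ i ∈ Finset.range (m + 1), (m.choose i : ℝ)) * B * B := by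
        rw [Finset.sum_mul, Finset.sum_mul]
    _ = 2 ^ m * B ^ 2 := by rw [hsum]; ring

/-- **Pointwise Leibniz bound for the derivatives of the quadratic source**
`G[w] = ∂ᵢ∂ⱼ(wᵢwⱼ) = div(Dw[w] + (div w) w)`: if `‖Dʲw(y)‖ ≤ B` for all `j ≤ k + 2` AT THE POINT `y`,
then `‖DᵏG[w](y)‖ ≤ 2^{k+1} B² T (1+T)`, `T = ‖tr‖` (twin of the file-private lemma of
`PineauVicolPressurePointwiseDecay`). [folklore] -/
private theorem norm_iteratedFDeriv_pressureSource_le_of_pointwise_bounds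
    {w : (EuclideanSpace ℝ (Fin 3)) → (EuclideanSpace ℝ (Fin 3))}
    (hw : ContDiff ℝ ∞ w) (k : ℕ) {B : ℝ} (hB0 : 0 ≤ B) (y : EuclideanSpace ℝ (Fin 3))
    (hB : ∀ j ≤ k + 2, ‖iteratedFDeriv ℝ j w y‖ ≤ B) :
    ‖iteratedFDeriv ℝ k (pressureSource w) y‖ ≤
      2 ^ (k + 1) * B ^ 2 *
        (‖(traceCLM : ((EuclideanSpace ℝ (Fin 3)) →L[ℝ] (EuclideanSpace ℝ (Fin 3))) →L[ℝ] ℝ)‖ *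
          (1 + ‖(traceCLM : ((EuclideanSpace ℝ (Fin 3)) →L[ℝ] (EuclideanSpace ℝ (Fin 3))) →L[ℝ] ℝ)‖)) := by
  set T : ℝ := ‖(traceCLM : ((EuclideanSpace ℝ (Fin 3)) →L[ℝ] (EuclideanSpace ℝ (Fin 3))) →L[ℝ] ℝ)‖
    with hT
  have hT0 : 0 ≤ T := norm_nonneg _
  have hDw : ContDiff ℝ ∞ (fderiv ℝ w) := hw.fderiv_right (m := ∞) le_rfl
  have hdiv : ContDiff ℝ ∞ (VectorCalculus.divergence w) := by
    rw [divergence_eq_traceCLM_comp]; exact traceCLM.contDiff.comp hDw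
  have hconv : ContDiff ℝ ∞ (convect w w) := by
    have e : convect w w = fun y => (fderiv ℝ w y) (w y) := rfl
    rw [e]; exact hDw.clm_apply hw
  have hsm : ContDiff ℝ ∞ (fun y => VectorCalculus.divergence w y • w y) := hdiv.smul hw
  set W : (EuclideanSpace ℝ (Fin 3)) → (EuclideanSpace ℝ (Fin 3)) :=
    convect w w + fun y => VectorCalculus.divergence w y • w y with hW
  have hWs : ContDiff ℝ ∞ W := hconv.add hsm
  have hG : pressureSource w = traceCLM ∘ fderiv ℝ W := by
    rw [pressureSource_def, divergence_eq_traceCLM_comp]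
    rfl
  have hDj : ∀ i ∈ Finset.range (k + 2), ‖iteratedFDeriv ℝ i (fderiv ℝ w) y‖ ≤ B := by
    intro i hi
    rw [norm_iteratedFDeriv_fderiv]
    exact hB (i + 1) (by have := Finset.mem_range.1 hi; omega)
  have hwj : ∀ i ∈ Finset.range (k + 2), ‖iteratedFDeriv ℝ (k + 1 - i) w y‖ ≤ B := by
    intro i hi
    exact hB (k + 1 - i) (by omega)
  have hdivj : ∀ i ∈ Finset.range (k + 2), ‖iteratedFDeriv ℝ i (VectorCalculus.divergence w) y‖ ≤ T * B := by
    intro i hi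
    rw [divergence_eq_traceCLM_comp]
    calc ‖iteratedFDeriv ℝ i (traceCLM ∘ fderiv ℝ w) y‖ ≤ T * ‖iteratedFDeriv ℝ i (fderiv ℝ w) y‖ :=
          ContinuousLinearMap.norm_iteratedFDeriv_comp_left _ hDw.contDiffAt (by exact_mod_cast le_top)
      _ ≤ T * B := mul_le_mul_of_nonneg_left (hDj i hi) hT0
  have ha : ‖iteratedFDeriv ℝ (k + 1) (convect w w) y‖ ≤ 2 ^ (k + 1) * B ^ 2 := by
    have e : convect w w = fun y => (fderiv ℝ w y) (w y) := rfl
    rw [e]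
    refine (norm_iteratedFDeriv_clm_apply hDw hw y (by exact_mod_cast le_top)).trans ?_
    exact sum_choose_mul_le_sq_allOrders hB0 (fun _ => norm_nonneg _) hDj hwj
  have hb : ‖iteratedFDeriv ℝ (k + 1) (fun y => VectorCalculus.divergence w y • w y) y‖ ≤
      2 ^ (k + 1) * (T * B) * B := by
    refine (norm_iteratedFDeriv_smul_le hdiv hw y (by exact_mod_cast le_top)).trans ?_
    have hTB : 0 ≤ T * B := mul_nonneg hT0 hB0
    calc ∑ i ∈ Finset.range (k + 1 + 1), ((k + 1).choose i : ℝ) *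
          ‖iteratedFDeriv ℝ i (VectorCalculus.divergence w) y‖ * ‖iteratedFDeriv ℝ (k + 1 - i) w y‖
        ≤ ∑ i ∈ Finset.range (k + 1 + 1), ((k + 1).choose i : ℝ) * (T * B) * B :=
          Finset.sum_le_sum fun i hi =>
            mul_le_mul (mul_le_mul_of_nonneg_left (hdivj i hi) (Nat.cast_nonneg _)) (hwj i hi)
              (norm_nonneg _) (mul_nonneg (Nat.cast_nonneg _) hTB)
      _ = (∑ i ∈ Finset.range (k + 1 + 1), ((k + 1).choose i : ℝ)) * (T * B) * B := by
          rw [Finset.sum_mul, Finset.sum_mul]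
      _ = 2 ^ (k + 1) * (T * B) * B := by
          have hsum : ∑ i ∈ Finset.range (k + 1 + 1), ((k + 1).choose i : ℝ) = 2 ^ (k + 1) := by
            have := Nat.sum_range_choose (k + 1)
            exact_mod_cast this
          rw [hsum]
  have hWk : ‖iteratedFDeriv ℝ (k + 1) W y‖ ≤ 2 ^ (k + 1) * B ^ 2 + 2 ^ (k + 1) * (T * B) * B := by
    rw [hW, iteratedFDeriv_add_apply (hconv.of_le (by exact_mod_cast le_top)).contDiffAt
      (hsm.of_le (by exact_mod_cast le_top)).contDiffAt]
    exact (norm_add_le _ _).trans (add_le_add ha hb)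
  rw [hG]
  calc ‖iteratedFDeriv ℝ k (traceCLM ∘ fderiv ℝ W) y‖ ≤ T * ‖iteratedFDeriv ℝ k (fderiv ℝ W) y‖ :=
        ContinuousLinearMap.norm_iteratedFDeriv_comp_left _
          (hWs.fderiv_right (m := ∞) le_rfl).contDiffAt (by exact_mod_cast le_top)
    _ = T * ‖iteratedFDeriv ℝ (k + 1) W y‖ := by rw [norm_iteratedFDeriv_fderiv]
    _ ≤ T * (2 ^ (k + 1) * B ^ 2 + 2 ^ (k + 1) * (T * B) * B) := mul_le_mul_of_nonneg_left hWk hT0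
    _ = 2 ^ (k + 1) * B ^ 2 * (T * (1 + T)) := by ring

/-! ### Unit-scale bounds for `DᵏQ₁`, `DᵏQ₂` -/

/-- **Far part, order `k`, any cutoff, `|e| ≤ 1`**: `‖DᵏQ₂[w](e)‖ ≤ K C₀²` for `w` continuous in the
decay class with `|y| |w(y)| ≤ C₀` (the kernel `D^{k+2}Γ∞`, decaying like `(1+|z|)⁻³`, against the
weight `C₀²|y|⁻²`: the tree's `exists_dominator_unitScale_ao`). [cite: PineauVicol2026, Lemma 2.1, proof of (2.2) (p. 10)] -/
theorem exists_bound_iteratedFDeriv_farPotential_le (h₀ : 0 < r₀) (h₁ : r₀ < r₁) (k : ℕ) :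
    ∃ K : ℝ, 0 ≤ K ∧ ∀ (w : EuclideanSpace ℝ (Fin 3) → EuclideanSpace ℝ (Fin 3)) (C₀ C' : ℝ),
      Continuous w → (∀ y, ‖w y‖ ≤ C' / (1 + ‖y‖)) → (∀ y, ‖w y‖ * ‖y‖ ≤ C₀) →
      ∀ e : EuclideanSpace ℝ (Fin 3), ‖e‖ ≤ 1 →
        ‖iteratedFDeriv ℝ k (farPotential r₀ r₁ w) e‖ ≤ K * C₀ ^ 2 := by
  choose M hM using fun m => exists_hasDecay_iteratedFDeriv_fderiv2_newtonFar h₀ h₁ m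
  have hΓ : ContDiff ℝ ∞ (newtonFar r₀ r₁) := contDiff_newtonFar h₀ h₁
  have hΦ : ContDiff ℝ ∞ (fderiv ℝ (fderiv ℝ (newtonFar r₀ r₁))) :=
    (hΓ.fderiv_right (m := ∞) le_rfl).fderiv_right (m := ∞) le_rfl
  obtain ⟨K, hK0, hK⟩ := exists_dominator_unitScale_ao
  refine ⟨K * M k, mul_nonneg hK0 (hM k).nonneg, ?_⟩
  intro w C₀ C' hwc hdec hw e he
  have hform := (contDiff_integral_clm_apply_comp_sub_decay_top (L := fun y => evalDiag (w y)) hΦ hM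
    (continuous_evalDiag.comp hwc) (hasDecay_two_evalDiag hdec)).2 k e
  rw [farPotential_eq, hform]
  obtain ⟨g, hgi, hgint, hg⟩ := hK _ (M k) (hM k).nonneg (hasDecay_iff_div.1 (hM k)) w C₀ hw e he
  calc ‖∫ y, (evalDiag (w y)).compContinuousMultilinearMap
          (iteratedFDeriv ℝ k (fderiv ℝ (fderiv ℝ (newtonFar r₀ r₁))) (e - y))‖
      ≤ ∫ y, g y := by
        refine norm_integral_le_of_norm_le hgi ?_
        filter_upwards [hg] with y hy
        calc ‖(evalDiag (w y)).compContinuousMultilinearMap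
              (iteratedFDeriv ℝ k (fderiv ℝ (fderiv ℝ (newtonFar r₀ r₁))) (e - y))‖
            ≤ ‖evalDiag (w y)‖ * ‖iteratedFDeriv ℝ k (fderiv ℝ (fderiv ℝ (newtonFar r₀ r₁))) (e - y)‖ :=
              ContinuousLinearMap.norm_compContinuousMultilinearMap_le _ _
          _ ≤ ‖w y‖ ^ 2 * ‖iteratedFDeriv ℝ k (fderiv ℝ (fderiv ℝ (newtonFar r₀ r₁))) (e - y)‖ :=
              mul_le_mul_of_nonneg_right (norm_evalDiag_le _) (norm_nonneg _)
          _ = ‖iteratedFDeriv ℝ k (fderiv ℝ (fderiv ℝ (newtonFar r₀ r₁))) (e - y)‖ * ‖w y‖ ^ 2 :=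
              mul_comm _ _
          _ ≤ g y := hy
    _ ≤ K * M k * C₀ ^ 2 := hgint

/-- **Near part, order `k`, unit scale**: for `w ∈ C^∞` with `|y|^{j+1} ‖Dʲw(y)‖ ≤ C`, `j ≤ k+2`, and
a unit vector `e`, `‖DᵏQ₁^{1/4,1/2}[w](e)‖ ≤ K C²` (on the support `|z| ≤ 1/2` one has
`|e − z| ≥ 1/2`, where `‖Dʲw‖ ≤ 2^{j+1}C ≤ 2^{k+3}C` and so `‖DᵏG[w]‖ ≤ 2^{k+1}(2^{k+3}C)² T(1+T)`).
[cite: PineauVicol2026, Lemma 2.1, proof of (2.2) (p. 10)] -/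
theorem exists_bound_iteratedFDeriv_nearPotential_unitScale (k : ℕ) :
    ∃ K : ℝ, 0 ≤ K ∧ ∀ (w : EuclideanSpace ℝ (Fin 3) → EuclideanSpace ℝ (Fin 3)) (C : ℝ),
      ContDiff ℝ ∞ w → (∀ j ≤ k + 2, ∀ y, ‖y‖ ^ (j + 1) * ‖iteratedFDeriv ℝ j w y‖ ≤ C) →
      ∀ e : EuclideanSpace ℝ (Fin 3), ‖e‖ = 1 →
        ‖iteratedFDeriv ℝ k (nearPotential (4⁻¹ * 1) (4⁻¹ * 2) w) e‖ ≤ K * C ^ 2 := by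
  have h₀ : (0 : ℝ) ≤ 4⁻¹ * 1 := by norm_num
  have h₁ : (4⁻¹ * 1 : ℝ) < 4⁻¹ * 2 := by norm_num
  set N : ℝ := ∫ z, |newtonNear (4⁻¹ * 1) (4⁻¹ * 2) (z : EuclideanSpace ℝ (Fin 3))| with hN
  have hN0 : 0 ≤ N := integral_nonneg fun _ => abs_nonneg _
  set T : ℝ := ‖(traceCLM : ((EuclideanSpace ℝ (Fin 3)) →L[ℝ] (EuclideanSpace ℝ (Fin 3))) →L[ℝ] ℝ)‖
    with hT
  have hT0 : 0 ≤ T := norm_nonneg _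
  refine ⟨N * (2 ^ (k + 1) * (2 ^ (k + 3)) ^ 2 * (T * (1 + T))), by positivity, ?_⟩
  intro w C hw hC e he
  have hC0 : 0 ≤ C := le_trans (by positivity) (hC 0 (by omega) 0)
  -- the source bound on `|y| ≥ 1/2`
  have hG : ∀ y : EuclideanSpace ℝ (Fin 3), 2⁻¹ ≤ ‖y‖ →
      ‖iteratedFDeriv ℝ k (pressureSource w) y‖ ≤ 2 ^ (k + 1) * (2 ^ (k + 3) * C) ^ 2 * (T * (1 + T)) := by
    intro y hy
    have hB : ∀ j ≤ k + 2, ‖iteratedFDeriv ℝ j w y‖ ≤ 2 ^ (k + 3) * C := by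
      intro j hj
      have h1 := hC j hj y
      have hyj : (2⁻¹ : ℝ) ^ (j + 1) ≤ ‖y‖ ^ (j + 1) := pow_le_pow_left₀ (by norm_num) hy _
      have hD0 := norm_nonneg (iteratedFDeriv ℝ j w y)
      have h2 : (2⁻¹ : ℝ) ^ (j + 1) * ‖iteratedFDeriv ℝ j w y‖ ≤ C :=
        (mul_le_mul_of_nonneg_right hyj hD0).trans h1
      have h3 : ‖iteratedFDeriv ℝ j w y‖ ≤ 2 ^ (j + 1) * C := by
        have e2 : (2 : ℝ) ^ (j + 1) * ((2⁻¹ : ℝ) ^ (j + 1) * ‖iteratedFDeriv ℝ j w y‖) =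
            ‖iteratedFDeriv ℝ j w y‖ := by
          rw [← mul_assoc, ← mul_pow]; norm_num
        rw [← e2]
        exact mul_le_mul_of_nonneg_left h2 (by positivity)
      have h4 : (2 : ℝ) ^ (j + 1) * C ≤ 2 ^ (k + 3) * C :=
        mul_le_mul_of_nonneg_right (pow_le_pow_right₀ (by norm_num) (by omega)) hC0
      exact h3.trans h4
    have h := norm_iteratedFDeriv_pressureSource_le_of_pointwise_bounds hw k (by positivity) y hB
    rw [← hT] at h
    exact h
  refine (norm_iteratedFDeriv_nearPotential_le h₀ h₁ hw k e (B := 2 ^ (k + 1) * (2 ^ (k + 3) * C) ^ 2 * (T * (1 + T))) fun z hz => ?_).trans ?_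
  · have hez : 2⁻¹ ≤ ‖e - z‖ := by
      have := norm_sub_norm_le e z
      rw [he] at this
      have hz' : ‖z‖ < 2⁻¹ := by
        have : (4⁻¹ * 2 : ℝ) = 2⁻¹ := by norm_num
        rwa [this] at hz
      linarith
    exact hG _ hez
  · rw [← hN]
    have : N * (2 ^ (k + 1) * (2 ^ (k + 3) * C) ^ 2 * (T * (1 + T))) =
        N * (2 ^ (k + 1) * (2 ^ (k + 3)) ^ 2 * (T * (1 + T))) * C ^ 2 := by ring
    rw [this]

/-- **Near part, order `k`, cutoff `(1, 2)`, any point**: for `v ∈ C^∞` with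
`(1+|y|)^{j+1} ‖Dʲv(y)‖ ≤ C`, `j ≤ k+2`, `‖DᵏQ₁^{1,2}[v](x)‖ ≤ K C²` (here `‖Dʲv‖ ≤ C` everywhere, so
`‖DᵏG[v]‖ ≤ 2^{k+1}C²T(1+T)` everywhere). [cite: PineauVicol2026, Lemma 2.1, proof of (2.2) (p. 10)] -/
theorem exists_bound_iteratedFDeriv_nearPotential_of_decay (k : ℕ) :
    ∃ K : ℝ, 0 ≤ K ∧ ∀ (v : EuclideanSpace ℝ (Fin 3) → EuclideanSpace ℝ (Fin 3)) (C : ℝ),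
      ContDiff ℝ ∞ v → (∀ j ≤ k + 2, ∀ y, (1 + ‖y‖) ^ (j + 1) * ‖iteratedFDeriv ℝ j v y‖ ≤ C) →
      ∀ x : EuclideanSpace ℝ (Fin 3), ‖iteratedFDeriv ℝ k (nearPotential 1 2 v) x‖ ≤ K * C ^ 2 := by
  set N : ℝ := ∫ z, |newtonNear 1 2 (z : EuclideanSpace ℝ (Fin 3))| with hN
  have hN0 : 0 ≤ N := integral_nonneg fun _ => abs_nonneg _
  set T : ℝ := ‖(traceCLM : ((EuclideanSpace ℝ (Fin 3)) →L[ℝ] (EuclideanSpace ℝ (Fin 3))) →L[ℝ] ℝ)‖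
    with hT
  have hT0 : 0 ≤ T := norm_nonneg _
  refine ⟨N * (2 ^ (k + 1) * (T * (1 + T))), by positivity, ?_⟩
  intro v C hv hC x
  have hC0 : 0 ≤ C := le_trans (by positivity) (hC 0 (by omega) 0)
  have hG : ∀ y : EuclideanSpace ℝ (Fin 3),
      ‖iteratedFDeriv ℝ k (pressureSource v) y‖ ≤ 2 ^ (k + 1) * C ^ 2 * (T * (1 + T)) := by
    intro y
    have hBj : ∀ j ≤ k + 2, ‖iteratedFDeriv ℝ j v y‖ ≤ C := by
      intro j hj
      have h := hC j hj y
      have h1 : 1 ≤ (1 + ‖y‖) ^ (j + 1) := one_le_pow₀ (by linarith [norm_nonneg y])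
      have hD0 := norm_nonneg (iteratedFDeriv ℝ j v y)
      nlinarith [mul_le_mul_of_nonneg_right h1 hD0]
    have h := norm_iteratedFDeriv_pressureSource_le_of_pointwise_bounds hv k hC0 y hBj
    rw [← hT] at h
    exact h
  refine (norm_iteratedFDeriv_nearPotential_le zero_le_one one_lt_two hv k x
    (B := 2 ^ (k + 1) * C ^ 2 * (T * (1 + T))) fun z _ => hG _).trans ?_
  rw [← hN]
  exact le_of_eq (by ring)

/-! ### Pointwise decay of all the derivatives of the pressure potential ((8.3) for `P`, `σ = 0`) -/

/-- `Q₂[w] ∈ C^∞` for `w` continuous in the decay class (all-orders version of the tree's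
`contDiff_farPotential_decay`). [folklore] -/
private theorem contDiff_farPotential_decay_top (h₀ : 0 < r₀) (h₁ : r₀ < r₁)
    {w : EuclideanSpace ℝ (Fin 3) → EuclideanSpace ℝ (Fin 3)} (hwc : Continuous w)
    {C' : ℝ} (hdec : ∀ y, ‖w y‖ ≤ C' / (1 + ‖y‖)) : ContDiff ℝ ∞ (farPotential r₀ r₁ w) := by
  choose M hM using fun m => exists_hasDecay_iteratedFDeriv_fderiv2_newtonFar h₀ h₁ m
  have hΓ : ContDiff ℝ ∞ (newtonFar r₀ r₁) := contDiff_newtonFar h₀ h₁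
  have hΦ : ContDiff ℝ ∞ (fderiv ℝ (fderiv ℝ (newtonFar r₀ r₁))) :=
    (hΓ.fderiv_right (m := ∞) le_rfl).fderiv_right (m := ∞) le_rfl
  rw [farPotential_eq]
  exact (contDiff_integral_clm_apply_comp_sub_decay_top (L := fun y => evalDiag (w y)) hΦ hM
    (continuous_evalDiag.comp hwc) (hasDecay_two_evalDiag hdec)).1

/-- **`Q[w] ∈ C^∞` for `w ∈ C^∞` in the decay class** `(1+|y|)|w(y)| ≤ C′` (the regularity behind
(8.3) for `P`: near part by `contDiff_nearPotential`, far part by dominated differentiation at all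
orders). Exposed (no longer `private`) for the sequel files of the (8.2) programme.
[cite: PineauVicol2026, Lemma 2.1, proof (p. 10); Lemma 8.1 (8.3) (p. 28)] -/
theorem contDiff_pressurePotential_decay_top
    {w : EuclideanSpace ℝ (Fin 3) → EuclideanSpace ℝ (Fin 3)} (hw : ContDiff ℝ ∞ w)
    {C' : ℝ} (hdec : ∀ y, ‖w y‖ ≤ C' / (1 + ‖y‖)) : ContDiff ℝ ∞ (pressurePotential w) := by
  have hn : ContDiff ℝ ∞ (nearPotential 1 2 w) :=
    contDiff_infty.2 fun n => contDiff_nearPotential zero_le_one one_lt_two n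
      (by exact_mod_cast (contDiff_infty.1 hw (n + 2)))
  have hf : ContDiff ℝ ∞ (farPotential 1 2 w) := contDiff_farPotential_decay_top one_pos one_lt_two
    hw.continuous hdec
  have e : pressurePotential w = fun x => -nearPotential 1 2 w x - farPotential 1 2 w x := rfl
  rw [e]
  exact hn.neg.sub hf

/-- `Dᵏ(−f − g)(x) = −Dᵏf(x) − Dᵏg(x)` for `f, g ∈ Cᵏ` near `x`. [folklore] -/
private theorem iteratedFDeriv_neg_sub_apply_pv {f g : EuclideanSpace ℝ (Fin 3) → ℝ} {k : ℕ}
    {x : EuclideanSpace ℝ (Fin 3)} (hf : ContDiffAt ℝ k f x) (hg : ContDiffAt ℝ k g x) :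
    iteratedFDeriv ℝ k (fun y => -f y - g y) x = -iteratedFDeriv ℝ k f x - iteratedFDeriv ℝ k g x := by
  have e : (fun y => -f y - g y) = (-f) - g := rfl
  have hf' : ContDiffAt ℝ k (-f) x := hf.neg
  rw [e, iteratedFDeriv_sub_apply hf' hg, iteratedFDeriv_neg_apply]

/-- **The unit-scale bound for `DᵏQ`**: for `w ∈ C^∞` with `|y|^{j+1}‖Dʲw(y)‖ ≤ C` (`j ≤ k+2`),
`|w(y)| ≤ C'/(1+|y|)` and `|y||w(y)| ≤ C₀`, at a unit vector `e`,
`‖DᵏQ[w](e)‖ ≤ K_n C² + K_f C₀²` (split at scale `1/4`: `Q = −Q₁^{1/4,1/2} − Q₂^{1/4,1/2}`).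
[cite: PineauVicol2026, Lemma 2.1, proof of (2.2) (p. 10)] -/
theorem exists_bound_iteratedFDeriv_pressurePotential_unitScale (k : ℕ) :
    ∃ Kn Kf : ℝ, 0 ≤ Kn ∧ 0 ≤ Kf ∧
      ∀ (w : EuclideanSpace ℝ (Fin 3) → EuclideanSpace ℝ (Fin 3)) (C C' C₀ : ℝ),
        ContDiff ℝ ∞ w → (∀ j ≤ k + 2, ∀ y, ‖y‖ ^ (j + 1) * ‖iteratedFDeriv ℝ j w y‖ ≤ C) →
        (∀ y, ‖w y‖ ≤ C' / (1 + ‖y‖)) → (∀ y, ‖w y‖ * ‖y‖ ≤ C₀) →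
        ∀ e : EuclideanSpace ℝ (Fin 3), ‖e‖ = 1 →
          ‖iteratedFDeriv ℝ k (pressurePotential w) e‖ ≤ Kn * C ^ 2 + Kf * C₀ ^ 2 := by
  have h₀' : (0 : ℝ) < 4⁻¹ * 1 := by norm_num
  have h₁' : (4⁻¹ * 1 : ℝ) < 4⁻¹ * 2 := by norm_num
  obtain ⟨Kn, hKn0, hKn⟩ := exists_bound_iteratedFDeriv_nearPotential_unitScale k
  obtain ⟨Kf, hKf0, hKf⟩ := exists_bound_iteratedFDeriv_farPotential_le h₀' h₁' k
  refine ⟨Kn, Kf, hKn0, hKf0, ?_⟩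
  intro w C C' C₀ hw hC hdec hw0 e he
  have hsplit : pressurePotential w =
      fun y => -nearPotential (4⁻¹ * 1) (4⁻¹ * 2) w y - farPotential (4⁻¹ * 1) (4⁻¹ * 2) w y := by
    funext y
    exact pressurePotential_eq_scale_decay (R := 4⁻¹) (by norm_num) (contDiff_infty.1 hw 2) hdec y
  have hn : ContDiff ℝ k (nearPotential (4⁻¹ * 1) (4⁻¹ * 2) w) :=
    contDiff_nearPotential h₀'.le h₁' k (by exact_mod_cast (contDiff_infty.1 hw (k + 2)))
  have hf : ContDiff ℝ k (farPotential (4⁻¹ * 1) (4⁻¹ * 2) w) :=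
    (contDiff_farPotential_decay_top h₀' h₁' hw.continuous hdec).of_le (by exact_mod_cast le_top)
  rw [hsplit, iteratedFDeriv_neg_sub_apply_pv hn.contDiffAt hf.contDiffAt]
  calc ‖-iteratedFDeriv ℝ k (nearPotential (4⁻¹ * 1) (4⁻¹ * 2) w) e -
          iteratedFDeriv ℝ k (farPotential (4⁻¹ * 1) (4⁻¹ * 2) w) e‖
      ≤ ‖iteratedFDeriv ℝ k (nearPotential (4⁻¹ * 1) (4⁻¹ * 2) w) e‖ +
          ‖iteratedFDeriv ℝ k (farPotential (4⁻¹ * 1) (4⁻¹ * 2) w) e‖ := by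
        rw [← norm_neg (iteratedFDeriv ℝ k (nearPotential (4⁻¹ * 1) (4⁻¹ * 2) w) e)]
        exact norm_sub_le _ _
    _ ≤ Kn * C ^ 2 + Kf * C₀ ^ 2 := add_le_add (hKn w C hw hC e he) (hKf w C₀ C' hw.continuous hdec hw0 e he.le)

/-- **The bound for `DᵏQ` on the unit ball**: for `v ∈ C^∞` with `(1+|y|)^{j+1}‖Dʲv(y)‖ ≤ C`
(`j ≤ k+2`) and `|x| ≤ 1`, `‖DᵏQ[v](x)‖ ≤ K C²` (split at scale `1`: `Q = −Q₁^{1,2} − Q₂^{1,2}`).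
[cite: PineauVicol2026, Lemma 2.1, proof of (2.2) (p. 10)] -/
theorem exists_bound_iteratedFDeriv_pressurePotential_of_decay (k : ℕ) :
    ∃ K : ℝ, 0 ≤ K ∧ ∀ (v : EuclideanSpace ℝ (Fin 3) → EuclideanSpace ℝ (Fin 3)) (C : ℝ),
      ContDiff ℝ ∞ v → (∀ j ≤ k + 2, ∀ y, (1 + ‖y‖) ^ (j + 1) * ‖iteratedFDeriv ℝ j v y‖ ≤ C) →
      ∀ x : EuclideanSpace ℝ (Fin 3), ‖x‖ ≤ 1 → ‖iteratedFDeriv ℝ k (pressurePotential v) x‖ ≤ K * C ^ 2 := by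
  obtain ⟨Kn, hKn0, hKn⟩ := exists_bound_iteratedFDeriv_nearPotential_of_decay k
  obtain ⟨Kf, hKf0, hKf⟩ := exists_bound_iteratedFDeriv_farPotential_le one_pos one_lt_two k
  refine ⟨Kn + Kf, by positivity, ?_⟩
  intro v C hv hC x hx
  have hdec : ∀ y, ‖v y‖ ≤ C / (1 + ‖y‖) := by
    intro y
    have h := hC 0 (by omega) y
    rw [norm_iteratedFDeriv_zero, zero_add, pow_one] at h
    rw [le_div_iff₀ (by positivity)]
    linarith
  have hv0 : ∀ y, ‖v y‖ * ‖y‖ ≤ C := by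
    intro y
    have h := hC 0 (by omega) y
    rw [norm_iteratedFDeriv_zero, zero_add, pow_one] at h
    nlinarith [norm_nonneg (v y), norm_nonneg y]
  have hn : ContDiff ℝ k (nearPotential 1 2 v) :=
    contDiff_nearPotential zero_le_one one_lt_two k (by exact_mod_cast (contDiff_infty.1 hv (k + 2)))
  have hf : ContDiff ℝ k (farPotential 1 2 v) :=
    (contDiff_farPotential_decay_top one_pos one_lt_two hv.continuous hdec).of_le (by exact_mod_cast le_top)
  have e : pressurePotential v = fun y => -nearPotential 1 2 v y - farPotential 1 2 v y := rfl
  rw [e, iteratedFDeriv_neg_sub_apply_pv hn.contDiffAt hf.contDiffAt]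
  calc ‖-iteratedFDeriv ℝ k (nearPotential 1 2 v) x - iteratedFDeriv ℝ k (farPotential 1 2 v) x‖
      ≤ ‖iteratedFDeriv ℝ k (nearPotential 1 2 v) x‖ + ‖iteratedFDeriv ℝ k (farPotential 1 2 v) x‖ := by
        rw [← norm_neg (iteratedFDeriv ℝ k (nearPotential 1 2 v) x)]
        exact norm_sub_le _ _
    _ ≤ Kn * C ^ 2 + Kf * C ^ 2 := add_le_add (hKn v C hv hC x) (hKf v C C hv.continuous hdec hv0 x hx)
    _ = (Kn + Kf) * C ^ 2 := by ring

/-- **Pineau–Vicol 2026, (8.3) for the pressure, every order `k`, `σ = 0` — pointwise decay of all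
the derivatives of the Calderón–Zygmund pressure on the decay class.** For every `k` there is an
absolute `A_k` such that for `v ∈ C^∞(ℝ³)` with `(1+|y|)^{j+1} ‖Dʲv(y)‖ ≤ C` for `j ≤ k + 2` (the
Type I decay (1.9)/(2.1)/(8.3) of the profile up to order `k + 2`), the pressure potential
`Q[v] = −Δ⁻¹∂ᵢ∂ⱼ(vᵢvⱼ)` satisfies `‖DᵏQ[v](x)‖ ≤ A_k C² (1+|x|)^{−(k+2)}` for all `x`: the printed
"By the same argument, one can deduce the bounds `|∇ᵏ_yU| ≤ C_{U,k}(1+|y|)^{−(k+1)}`,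
`|∇ᵏ_yP| ≤ C_{P,k}(1+|y|)^{−(2−σ+k)}`, `k ≥ 0`" ((8.3), here with `σ = 0`; `k = 0` is Lemma 2.1
(2.2)). Proof = the argument of Lemma 2.1 at order `k`: the Navier–Stokes dilation
`Q[v](x') = λ⁻²Q[λv(λ·)](x'/λ)`, `λ = |x| ≥ 1`, so `‖DᵏQ[v](x)‖ ≤ λ^{−k−2}‖DᵏQ[λv(λ·)](x/|x|)‖`, and at
the unit vector the near part `Γ₀ * DᵏG` is bounded by the pointwise Leibniz bound for `DᵏG` on
`|y| ≥ 1/2` (this is where `D^{k+2}v` enters) and the far part `D^{k+2}Γ∞ * (v ⊗ v)` by the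
`(1+|z|)⁻³` decay of `D^{k+2}Γ∞` against `C²|y|⁻²`; `|x| ≤ 1` directly. The tree's `k = 0, 1`
cases are `exists_bound_abs_pressurePotential_decay` / `exists_bound_norm_fderiv_pressurePotential_decay`
(`PineauVicolPressurePointwiseDecay`). [cite: PineauVicol2026, Lemma 8.1 (8.3) (p. 28); Lemma 2.1 (2.1)–(2.2) (p. 9), proof p. 10] -/
theorem exists_bound_norm_iteratedFDeriv_pressurePotential_decay (k : ℕ) :
    ∃ A : ℝ, 0 ≤ A ∧ ∀ (v : EuclideanSpace ℝ (Fin 3) → EuclideanSpace ℝ (Fin 3)) (C : ℝ),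
      ContDiff ℝ ∞ v → (∀ j ≤ k + 2, ∀ y, (1 + ‖y‖) ^ (j + 1) * ‖iteratedFDeriv ℝ j v y‖ ≤ C) →
      ∀ x, ‖iteratedFDeriv ℝ k (pressurePotential v) x‖ ≤ A * C ^ 2 / (1 + ‖x‖) ^ (k + 2) := by
  obtain ⟨Kn, Kf, hKn0, hKf0, hK⟩ := exists_bound_iteratedFDeriv_pressurePotential_unitScale k
  obtain ⟨Kg, hKg0, hKg⟩ := exists_bound_iteratedFDeriv_pressurePotential_of_decay k
  refine ⟨2 ^ (k + 2) * (Kn + Kf + Kg), by positivity, ?_⟩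
  intro v C hv hC x
  have hC0 : 0 ≤ C := le_trans (by positivity) (hC 0 (by omega) 0)
  have hdec : ∀ y, ‖v y‖ ≤ C / (1 + ‖y‖) := by
    intro y
    have h := hC 0 (by omega) y
    rw [norm_iteratedFDeriv_zero, zero_add, pow_one] at h
    rw [le_div_iff₀ (by positivity)]
    linarith
  have hpos : 0 < (1 + ‖x‖) ^ (k + 2) := by positivity
  rw [le_div_iff₀ hpos]
  by_cases hx : ‖x‖ ≤ 1
  · have h := hKg v C hv hC x hx
    have h2 : (1 + ‖x‖) ^ (k + 2) ≤ 2 ^ (k + 2) :=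
      pow_le_pow_left₀ (by positivity) (by linarith) _
    calc ‖iteratedFDeriv ℝ k (pressurePotential v) x‖ * (1 + ‖x‖) ^ (k + 2) ≤ Kg * C ^ 2 * 2 ^ (k + 2) :=
          mul_le_mul h h2 hpos.le (by positivity)
      _ ≤ 2 ^ (k + 2) * (Kn + Kf + Kg) * C ^ 2 := by
          nlinarith [mul_nonneg (mul_nonneg (add_nonneg hKn0 hKf0) (sq_nonneg C)) (pow_nonneg zero_le_two (k + 2) : (0:ℝ) ≤ 2 ^ (k + 2))]
  · rw [not_le] at hx
    have hlam : 0 < ‖x‖ := by linarith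
    have he : ‖‖x‖⁻¹ • x‖ = 1 := by
      rw [norm_smul, norm_inv, norm_norm, inv_mul_cancel₀ hlam.ne']
    -- the dilated field
    have hw : ContDiff ℝ ∞ (fun z => ‖x‖ • v (‖x‖ • z)) :=
      (hv.comp (contDiff_id.const_smul ‖x‖)).const_smul ‖x‖
    have hv2 : ContDiff ℝ 2 v := contDiff_infty.1 hv 2
    have hwdec := norm_smul_comp_smul_le_decay_ao hdec hlam
    have hw0 := norm_smul_comp_smul_mul_norm_le_ao hdec hlam
    have hwC : ∀ j ≤ k + 2, ∀ y, ‖y‖ ^ (j + 1) *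
        ‖iteratedFDeriv ℝ j (fun z => ‖x‖ • v (‖x‖ • z)) y‖ ≤ C :=
      fun j hj y => pow_mul_norm_iteratedFDeriv_smul_comp_smul_le_ao hv (hC j hj) hlam y
    -- `Q[v] = λ⁻² Q[w] ∘ (λ⁻¹ ·)`
    set L : EuclideanSpace ℝ (Fin 3) →L[ℝ] EuclideanSpace ℝ (Fin 3) :=
      ‖x‖⁻¹ • ContinuousLinearMap.id ℝ (EuclideanSpace ℝ (Fin 3)) with hL
    have hLy : ∀ y, L y = ‖x‖⁻¹ • y := fun y => by simp [hL]
    have hQv : pressurePotential v =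
        fun x' => (‖x‖ ^ 2)⁻¹ • (pressurePotential (fun z => ‖x‖ • v (‖x‖ • z)) ∘ L) x' := by
      funext x'
      rw [Function.comp_apply, hLy, pressurePotential_smul_comp_smul hv2 hdec hlam (‖x‖⁻¹ • x'),
        smul_smul, mul_inv_cancel₀ hlam.ne', one_smul, smul_eq_mul, ← mul_assoc,
        inv_mul_cancel₀ (by positivity), one_mul]
    have hQw : ContDiff ℝ k (pressurePotential (fun z => ‖x‖ • v (‖x‖ • z))) :=
      (contDiff_pressurePotential_decay_top hw hwdec).of_le (by exact_mod_cast le_top)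
    have hQwL : ContDiffAt ℝ k (pressurePotential (fun z => ‖x‖ • v (‖x‖ • z)) ∘ L) x :=
      (hQw.comp L.contDiff).contDiffAt
    have hD : iteratedFDeriv ℝ k (pressurePotential v) x =
        (‖x‖ ^ 2)⁻¹ • (iteratedFDeriv ℝ k (pressurePotential (fun z => ‖x‖ • v (‖x‖ • z))) (L x)).compContinuousLinearMap
          fun _ => L := by
      rw [hQv, iteratedFDeriv_const_smul_apply' hQwL, L.iteratedFDeriv_comp_right hQw x le_rfl]
    have hLn : ‖L‖ ≤ ‖x‖⁻¹ := by
      rw [hL, norm_smul, norm_inv, norm_norm]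
      calc ‖x‖⁻¹ * ‖ContinuousLinearMap.id ℝ (EuclideanSpace ℝ (Fin 3))‖ ≤ ‖x‖⁻¹ * 1 := by
            gcongr; exact ContinuousLinearMap.norm_id_le
        _ = ‖x‖⁻¹ := mul_one _
    have hunit := hK _ C _ C hw hwC hwdec hw0 (L x) (by rw [hLy]; exact he)
    have hprod : ∏ _i : Fin k, ‖L‖ ≤ ‖x‖⁻¹ ^ k := by
      rw [Finset.prod_const, Finset.card_univ, Fintype.card_fin]
      exact pow_le_pow_left₀ (norm_nonneg _) hLn k
    have hbound : ‖iteratedFDeriv ℝ k (pressurePotential v) x‖ ≤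
        (‖x‖ ^ 2)⁻¹ * ((Kn * C ^ 2 + Kf * C ^ 2) * ‖x‖⁻¹ ^ k) := by
      rw [hD, norm_smul, norm_inv, norm_pow, norm_norm]
      refine mul_le_mul_of_nonneg_left ?_ (by positivity)
      refine (ContinuousMultilinearMap.norm_compContinuousLinearMap_le _ _).trans ?_
      exact mul_le_mul hunit hprod (Finset.prod_nonneg fun _ _ => norm_nonneg _) (by positivity)
    -- undo the dilation: `(1+|x|)^{k+2} ≤ 2^{k+2}|x|^{k+2}`
    have h2 : (1 + ‖x‖) ^ (k + 2) ≤ (2 * ‖x‖) ^ (k + 2) :=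
      pow_le_pow_left₀ (by positivity) (by linarith) _
    have hxk : (‖x‖ ^ 2)⁻¹ * ‖x‖⁻¹ ^ k * ‖x‖ ^ (k + 2) = 1 := by
      rw [inv_pow]
      field_simp
      ring
    calc ‖iteratedFDeriv ℝ k (pressurePotential v) x‖ * (1 + ‖x‖) ^ (k + 2)
        ≤ (‖x‖ ^ 2)⁻¹ * ((Kn * C ^ 2 + Kf * C ^ 2) * ‖x‖⁻¹ ^ k) * (2 * ‖x‖) ^ (k + 2) :=
          mul_le_mul hbound h2 hpos.le (by positivity)
      _ = 2 ^ (k + 2) * (Kn + Kf) * C ^ 2 * ((‖x‖ ^ 2)⁻¹ * ‖x‖⁻¹ ^ k * ‖x‖ ^ (k + 2)) := by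
          rw [mul_pow]; ring
      _ = 2 ^ (k + 2) * (Kn + Kf) * C ^ 2 := by rw [hxk, mul_one]
      _ ≤ 2 ^ (k + 2) * (Kn + Kf + Kg) * C ^ 2 := by
          have : (0:ℝ) ≤ 2 ^ (k + 2) * Kg * C ^ 2 := by positivity
          nlinarith

end PineauVicol2026


/-! ### (8.3) for the pressure, every order, along the Leray orbit of the Type I class -/

section TypeIClass

open Literature.Analysis.FluidPDE.FourierNS (HasDecay)

-- nested operator types
set_option maxSynthPendingDepth 3

/-- Slices of the similarity orbit of a class element are smooth (the class is `C^∞` on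
`(−∞,0) × ℝ³`; `contDiff_uncurry_lerayOrbit`). [cite: KochNadirashviliSereginSverak2009, §4 p. 8 (arXiv:0709.3599)] -/
private theorem contDiff_lerayOrbit_slice_of_typeI_top {C : ℝ}
    {V : ℝ → EuclideanSpace ℝ (Fin 3) → EuclideanSpace ℝ (Fin 3)} (hV : IsTypeIAncientMild C V)
    (s : ℝ) : ContDiff ℝ ∞ (lerayOrbit V s) := by
  have h : ContDiff ℝ ∞ (uncurry (lerayOrbit V)) :=
    contDiff_uncurry_lerayOrbit (hV.1.of_le (by exact_mod_cast le_top))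
  exact h.comp (contDiff_prodMk_right s)

/-- **Pineau–Vicol 2026, (8.3) for the pressure, every order `k`, `σ = 0`, on the KNSS-gauge Type I
class.** For every `k` and `C` there is `M = M(k, C) ≥ 0` such that for every `V` with
`IsTypeIAncientMild C V` and `HasTypeIDecay C V`, the Calderón–Zygmund pressure `Q[U(s,·)]` of the
similarity profile `U = lerayOrbit V` satisfies `‖Dᵏ_y Q[U(s,·)](y)‖ ≤ M/(1+|y|)^{k+2}` for all `s ∈ ℝ`
and `y ∈ ℝ³` — the printed "`|∇ᵏ_yP(y,s)| ≤ C_{P,k}(1+|y|)^{−(2−σ+k)}`, `k ≥ 0`, for all `(y,s)`,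
uniformly in `α`" (the class bounds (8.3) for `U` of orders `≤ k+2`,
`IsTypeIAncientMild.exists_forall_pow_mul_norm_iteratedFDeriv_lerayOrbit_le_of_hasTypeIDecay`, fed
into `PineauVicol2026.exists_bound_norm_iteratedFDeriv_pressurePotential_decay`).
[cite: PineauVicol2026, Lemma 8.1 (8.3) (p. 28); Lemma 2.1 (2.1)–(2.2) (p. 9); Lemma 7.1 (7.2) (p. 24)] -/
theorem IsTypeIAncientMild.exists_forall_norm_iteratedFDeriv_pressurePotential_lerayOrbit_le_of_hasTypeIDecay
    (k : ℕ) (C : ℝ) :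
    ∃ M : ℝ, 0 ≤ M ∧ ∀ ⦃V : ℝ → EuclideanSpace ℝ (Fin 3) → EuclideanSpace ℝ (Fin 3)⦄,
      IsTypeIAncientMild C V → HasTypeIDecay C V →
      ∀ (s : ℝ) (y : EuclideanSpace ℝ (Fin 3)),
        ‖iteratedFDeriv ℝ k (pressurePotential (lerayOrbit V s)) y‖ ≤ M / (1 + ‖y‖) ^ (k + 2) := by
  choose K hK0 hK using fun n =>
    IsTypeIAncientMild.exists_forall_pow_mul_norm_iteratedFDeriv_lerayOrbit_le_of_hasTypeIDecay n C
  obtain ⟨A, hA0, hA⟩ := PineauVicol2026.exists_bound_norm_iteratedFDeriv_pressurePotential_decay k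
  set Ks : ℝ := ∑ j ∈ Finset.range (k + 3), K j with hKs
  refine ⟨A * Ks ^ 2, by positivity, fun V hV hdec s y => ?_⟩
  have hsm : ContDiff ℝ ∞ (lerayOrbit V s) := contDiff_lerayOrbit_slice_of_typeI_top hV s
  have hKj : ∀ j ≤ k + 2, ∀ z, (1 + ‖z‖) ^ (j + 1) * ‖iteratedFDeriv ℝ j (lerayOrbit V s) z‖ ≤ Ks := by
    intro j hj z
    refine (hK j hV hdec s z).trans ?_
    rw [hKs]
    exact Finset.single_le_sum (f := K) (fun i _ => hK0 i) (Finset.mem_range.2 (by omega))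
  exact hA _ Ks hsm hKj y

/-- The same at order `2` in the nested shape `‖D²Q‖ = ‖fderiv (fderiv Q)‖` (the pressure HESSIAN of
every similarity slice decays like `|y|⁻⁴`). [cite: PineauVicol2026, Lemma 8.1 (8.3) (p. 28)] -/
theorem IsTypeIAncientMild.exists_forall_norm_fderiv2_pressurePotential_lerayOrbit_le_of_hasTypeIDecay
    (C : ℝ) :
    ∃ M : ℝ, 0 ≤ M ∧ ∀ ⦃V : ℝ → EuclideanSpace ℝ (Fin 3) → EuclideanSpace ℝ (Fin 3)⦄,
      IsTypeIAncientMild C V → HasTypeIDecay C V →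
      ∀ (s : ℝ) (y : EuclideanSpace ℝ (Fin 3)),
        ‖fderiv ℝ (fderiv ℝ (pressurePotential (lerayOrbit V s))) y‖ ≤ M / (1 + ‖y‖) ^ 4 := by
  obtain ⟨M, hM0, hM⟩ :=
    IsTypeIAncientMild.exists_forall_norm_iteratedFDeriv_pressurePotential_lerayOrbit_le_of_hasTypeIDecay 2 C
  refine ⟨M, hM0, fun V hV hdec s y => ?_⟩
  have h := hM hV hdec s y
  rw [← norm_iteratedFDeriv_fderiv, ← norm_iteratedFDeriv_fderiv, norm_iteratedFDeriv_zero] at h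
  exact h

end TypeIClass


/-! ## The polar form `Qˢ[v,w]` of the pressure and its decay with PRODUCT constants, every order

The bilinear objects and the polarisation identities of this part were drafted by the lit g14 seat
(as a `PineauVicolPressureBilinear` candidate) and are re-homed here so that the all-orders bound of
this file polarises inside the same module. -/

-- nested operator types `ℝ³ →L[ℝ] ℝ³ →L[ℝ] ℝ`
set_option maxSynthPendingDepth 3

/-! ### The bilinear source and potentials -/

/-- **The bilinear source** `G[v,w] = ∂ᵢ∂ⱼ(vᵢwⱼ) = div((v·∇)w + (div v) w)` (basis-free:
`∂ⱼ(vᵢwⱼ)` summed over `i` is `(div v) wⱼ + (v·∇)wⱼ`); `G[v,v] = G[v]` is the quadratic source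
`pressureSource v`. [folklore] -/
def pressureSourceBil (v w : EuclideanSpace ℝ (Fin 3) → EuclideanSpace ℝ (Fin 3))
    (x : EuclideanSpace ℝ (Fin 3)) : ℝ :=
  VectorCalculus.divergence (fun y => convect v w y + VectorCalculus.divergence v y • w y) x

/-- `G[v,v] = G[v]`. [cite: PineauVicol2026, Lemma 8.1, proof (p. 28): the polar form of `RᵢRⱼ(UᵢUⱼ)` behind `∂ₛP = 2RᵢRⱼ(∂ₛUᵢUⱼ)`] -/
@[simp] theorem pressureSourceBil_self (v : EuclideanSpace ℝ (Fin 3) → EuclideanSpace ℝ (Fin 3)) :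
    pressureSourceBil v v = pressureSource v := rfl

/-- **The bilinear near potential** `Q₁[v,w](x) = ∫ Γ₀(z) G[v,w](x − z) dz`. [folklore] -/
def nearPotentialBil (r₀ r₁ : ℝ) (v w : EuclideanSpace ℝ (Fin 3) → EuclideanSpace ℝ (Fin 3))
    (x : EuclideanSpace ℝ (Fin 3)) : ℝ :=
  ∫ z, newtonNear r₀ r₁ z * pressureSourceBil v w (x - z)

/-- **The bilinear far potential** `Q₂[v,w](x) = ∫ D²Γ∞(x − y)(v y, w y) dy`. [folklore] -/
def farPotentialBil (r₀ r₁ : ℝ) (v w : EuclideanSpace ℝ (Fin 3) → EuclideanSpace ℝ (Fin 3))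
    (x : EuclideanSpace ℝ (Fin 3)) : ℝ :=
  ∫ y, fderiv ℝ (fderiv ℝ (newtonFar r₀ r₁)) (x - y) (v y) (w y)

/-- **The bilinear pressure potential** `Q[v,w] = −Q₁[v,w] − Q₂[v,w]` (cutoff radii `1, 2`), the
bilinear companion of `pressurePotential` (`Q[v,v] = Q[v]`). [folklore] -/
def pressurePotentialBil (v w : EuclideanSpace ℝ (Fin 3) → EuclideanSpace ℝ (Fin 3))
    (x : EuclideanSpace ℝ (Fin 3)) : ℝ :=
  -nearPotentialBil 1 2 v w x - farPotentialBil 1 2 v w x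

/-- **The symmetrised bilinear pressure potential** `Qˢ[v,w] = ½(Q[v,w] + Q[w,v])`, the polar form
of the quadratic `Q[v] = pressurePotential v`: `Q[v+w] − Q[v−w] = 4Qˢ[v,w]`
(`pressurePotential_add_sub`). For a profile `U(·,s)` differentiable in `s` it is the shape of
`∂ₛ RᵢRⱼ(UᵢUⱼ) = 2RᵢRⱼ(∂ₛUᵢ Uⱼ)`, the pressure term of the `s`-differentiated equation (1.14a) in the
proof of Lemma 8.1 of Pineau–Vicol. [folklore] -/
def pressurePotentialSym (v w : EuclideanSpace ℝ (Fin 3) → EuclideanSpace ℝ (Fin 3))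
    (x : EuclideanSpace ℝ (Fin 3)) : ℝ :=
  2⁻¹ * (pressurePotentialBil v w x + pressurePotentialBil w v x)

/-- `Q₁[v,v] = Q₁[v]`. [cite: PineauVicol2026, Lemma 8.1, proof (p. 28): the polar form of `RᵢRⱼ(UᵢUⱼ)` behind `∂ₛP = 2RᵢRⱼ(∂ₛUᵢUⱼ)`] -/
@[simp] theorem nearPotentialBil_self (r₀ r₁ : ℝ)
    (v : EuclideanSpace ℝ (Fin 3) → EuclideanSpace ℝ (Fin 3)) :
    nearPotentialBil r₀ r₁ v v = nearPotential r₀ r₁ v := rfl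

/-- `Q₂[v,v] = Q₂[v]`. [cite: PineauVicol2026, Lemma 8.1, proof (p. 28): the polar form of `RᵢRⱼ(UᵢUⱼ)` behind `∂ₛP = 2RᵢRⱼ(∂ₛUᵢUⱼ)`] -/
@[simp] theorem farPotentialBil_self (r₀ r₁ : ℝ)
    (v : EuclideanSpace ℝ (Fin 3) → EuclideanSpace ℝ (Fin 3)) :
    farPotentialBil r₀ r₁ v v = farPotential r₀ r₁ v := rfl

/-- `Q[v,v] = Q[v]`. [cite: PineauVicol2026, Lemma 8.1, proof (p. 28): the polar form of `RᵢRⱼ(UᵢUⱼ)` behind `∂ₛP = 2RᵢRⱼ(∂ₛUᵢUⱼ)`] -/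
@[simp] theorem pressurePotentialBil_self (v : EuclideanSpace ℝ (Fin 3) → EuclideanSpace ℝ (Fin 3)) :
    pressurePotentialBil v v = pressurePotential v := rfl

/-- `Qˢ[v,v] = Q[v]`. [cite: PineauVicol2026, Lemma 8.1, proof (p. 28): the polar form of `RᵢRⱼ(UᵢUⱼ)` behind `∂ₛP = 2RᵢRⱼ(∂ₛUᵢUⱼ)`] -/
@[simp] theorem pressurePotentialSym_self (v : EuclideanSpace ℝ (Fin 3) → EuclideanSpace ℝ (Fin 3)) :
    pressurePotentialSym v v = pressurePotential v := by
  funext x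
  simp only [pressurePotentialSym, pressurePotentialBil_self]
  ring

/-- `Qˢ[v,w] = Qˢ[w,v]`. [cite: PineauVicol2026, Lemma 8.1, proof (p. 28): the polar form of `RᵢRⱼ(UᵢUⱼ)` behind `∂ₛP = 2RᵢRⱼ(∂ₛUᵢUⱼ)`] -/
theorem pressurePotentialSym_comm (v w : EuclideanSpace ℝ (Fin 3) → EuclideanSpace ℝ (Fin 3)) :
    pressurePotentialSym v w = pressurePotentialSym w v := by
  funext x
  simp only [pressurePotentialSym]
  ring

/-! ### Homogeneity (no hypotheses: `fderiv` commutes with scalars over a field) -/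

/-- `div (t v) = t div v`. [folklore] -/
private theorem divergence_const_smul_aux (t : ℝ)
    (v : EuclideanSpace ℝ (Fin 3) → EuclideanSpace ℝ (Fin 3)) :
    VectorCalculus.divergence (t • v) = fun y => t * VectorCalculus.divergence v y := by
  funext y
  unfold VectorCalculus.divergence
  rw [fderiv_const_smul_field, Pi.smul_apply, ContinuousLinearMap.toLinearMap_smul, map_smul, smul_eq_mul]

/-- `G[t v, w] = t G[v,w]`. [folklore] -/
private theorem pressureSourceBil_smul_left (t : ℝ)
    (v w : EuclideanSpace ℝ (Fin 3) → EuclideanSpace ℝ (Fin 3)) :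
    pressureSourceBil (t • v) w = fun x => t * pressureSourceBil v w x := by
  funext x
  unfold pressureSourceBil
  have h : (fun y => convect (t • v) w y + VectorCalculus.divergence (t • v) y • w y) =
      t • fun y => convect v w y + VectorCalculus.divergence v y • w y := by
    funext y
    rw [divergence_const_smul_aux]
    simp only [convect_apply, Pi.smul_apply, map_smul, smul_add, smul_smul]
  rw [h, divergence_const_smul_aux]

/-- `G[v, t w] = t G[v,w]`. [folklore] -/
private theorem pressureSourceBil_smul_right (t : ℝ)
    (v w : EuclideanSpace ℝ (Fin 3) → EuclideanSpace ℝ (Fin 3)) :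
    pressureSourceBil v (t • w) = fun x => t * pressureSourceBil v w x := by
  funext x
  unfold pressureSourceBil
  have h : (fun y => convect v (t • w) y + VectorCalculus.divergence v y • (t • w) y) =
      t • fun y => convect v w y + VectorCalculus.divergence v y • w y := by
    funext y
    simp only [convect_apply, fderiv_const_smul_field, Pi.smul_apply,
      FunLike.coe_smul, smul_add, smul_smul, mul_comm _ t]
  rw [h, divergence_const_smul_aux]

/-- `Q₁[t v, w] = t Q₁[v,w]`. [folklore] -/
private theorem nearPotentialBil_smul_left (r₀ r₁ t : ℝ)
    (v w : EuclideanSpace ℝ (Fin 3) → EuclideanSpace ℝ (Fin 3)) :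
    nearPotentialBil r₀ r₁ (t • v) w = fun x => t * nearPotentialBil r₀ r₁ v w x := by
  funext x
  unfold nearPotentialBil
  rw [pressureSourceBil_smul_left, ← integral_const_mul]
  refine integral_congr_ae (Eventually.of_forall fun z => ?_)
  simp only
  ring

/-- `Q₁[v, t w] = t Q₁[v,w]`. [folklore] -/
private theorem nearPotentialBil_smul_right (r₀ r₁ t : ℝ)
    (v w : EuclideanSpace ℝ (Fin 3) → EuclideanSpace ℝ (Fin 3)) :
    nearPotentialBil r₀ r₁ v (t • w) = fun x => t * nearPotentialBil r₀ r₁ v w x := by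
  funext x
  unfold nearPotentialBil
  rw [pressureSourceBil_smul_right, ← integral_const_mul]
  refine integral_congr_ae (Eventually.of_forall fun z => ?_)
  simp only
  ring

/-- `Q₂[t v, w] = t Q₂[v,w]`. [folklore] -/
private theorem farPotentialBil_smul_left (r₀ r₁ t : ℝ)
    (v w : EuclideanSpace ℝ (Fin 3) → EuclideanSpace ℝ (Fin 3)) :
    farPotentialBil r₀ r₁ (t • v) w = fun x => t * farPotentialBil r₀ r₁ v w x := by
  funext x
  unfold farPotentialBil
  rw [← integral_const_mul]
  refine integral_congr_ae (Eventually.of_forall fun y => ?_)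
  simp only [Pi.smul_apply, map_smul, FunLike.coe_smul, smul_eq_mul]

/-- `Q₂[v, t w] = t Q₂[v,w]`. [folklore] -/
private theorem farPotentialBil_smul_right (r₀ r₁ t : ℝ)
    (v w : EuclideanSpace ℝ (Fin 3) → EuclideanSpace ℝ (Fin 3)) :
    farPotentialBil r₀ r₁ v (t • w) = fun x => t * farPotentialBil r₀ r₁ v w x := by
  funext x
  unfold farPotentialBil
  rw [← integral_const_mul]
  refine integral_congr_ae (Eventually.of_forall fun y => ?_)
  simp only [Pi.smul_apply, map_smul, smul_eq_mul]

/-- `Qˢ[v, t w] = t Qˢ[v,w]`. [cite: PineauVicol2026, Lemma 8.1, proof (p. 28): the polar form of `RᵢRⱼ(UᵢUⱼ)` behind `∂ₛP = 2RᵢRⱼ(∂ₛUᵢUⱼ)`] -/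
theorem pressurePotentialSym_smul_right (t : ℝ)
    (v w : EuclideanSpace ℝ (Fin 3) → EuclideanSpace ℝ (Fin 3)) :
    pressurePotentialSym v (t • w) = fun x => t * pressurePotentialSym v w x := by
  funext x
  simp only [pressurePotentialSym, pressurePotentialBil, nearPotentialBil_smul_right,
    nearPotentialBil_smul_left, farPotentialBil_smul_right, farPotentialBil_smul_left]
  ring

/-- `Qˢ[t v, w] = t Qˢ[v,w]`. [cite: PineauVicol2026, Lemma 8.1, proof (p. 28): the polar form of `RᵢRⱼ(UᵢUⱼ)` behind `∂ₛP = 2RᵢRⱼ(∂ₛUᵢUⱼ)`] -/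
theorem pressurePotentialSym_smul_left (t : ℝ)
    (v w : EuclideanSpace ℝ (Fin 3) → EuclideanSpace ℝ (Fin 3)) :
    pressurePotentialSym (t • v) w = fun x => t * pressurePotentialSym v w x := by
  rw [pressurePotentialSym_comm, pressurePotentialSym_smul_right, pressurePotentialSym_comm]

/-! ### Smoothness and additivity of the bilinear source -/

/-- `G[v,w] ∈ Cⁿ` for `v, w ∈ Cⁿ⁺²`. [folklore] -/
private theorem contDiff_pressureSourceBil {v w : EuclideanSpace ℝ (Fin 3) → EuclideanSpace ℝ (Fin 3)}
    {n : ℕ∞} (hv : ContDiff ℝ (n + 2) v) (hw : ContDiff ℝ (n + 2) w) :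
    ContDiff ℝ n (pressureSourceBil v w) := by
  have hv' : ContDiff ℝ (n + 1 + 1) v := by
    rwa [add_assoc, show (1 : WithTop ℕ∞) + 1 = 2 from rfl]
  have hw' : ContDiff ℝ (n + 1 + 1) w := by
    rwa [add_assoc, show (1 : WithTop ℕ∞) + 1 = 2 from rfl]
  have hc : ContDiff ℝ (n + 1) (convect v w) := by
    have e : convect v w = fun y => fderiv ℝ w y (v y) := rfl
    rw [e]
    exact (hw'.fderiv_right (m := n + 1) le_rfl).clm_apply (hv'.of_le le_self_add)
  have hW : ContDiff ℝ (n + 1) fun y => convect v w y + VectorCalculus.divergence v y • w y :=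
    hc.add ((contDiff_divergence hv').smul (hw'.of_le le_self_add))
  exact contDiff_divergence hW

/-- `div (f + g) = div f + div g` at a point of differentiability. [folklore] -/
private theorem divergence_add_aux {f g : EuclideanSpace ℝ (Fin 3) → EuclideanSpace ℝ (Fin 3)}
    {x : EuclideanSpace ℝ (Fin 3)} (hf : DifferentiableAt ℝ f x) (hg : DifferentiableAt ℝ g x) :
    VectorCalculus.divergence (f + g) x =
      VectorCalculus.divergence f x + VectorCalculus.divergence g x := by
  unfold VectorCalculus.divergence
  rw [fderiv_add hf hg, ContinuousLinearMap.toLinearMap_add, map_add]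

/-- The inner field `(v·∇)w + (div v) w` of `G[v,w]` is differentiable for `v, w ∈ C²`. [folklore] -/
private theorem differentiable_innerField {v w : EuclideanSpace ℝ (Fin 3) → EuclideanSpace ℝ (Fin 3)}
    (hv : ContDiff ℝ 2 v) (hw : ContDiff ℝ 2 w) :
    Differentiable ℝ fun y => convect v w y + VectorCalculus.divergence v y • w y := by
  have hc : ContDiff ℝ 1 (convect v w) := by
    have e : convect v w = fun y => fderiv ℝ w y (v y) := rfl
    rw [e]
    exact (hw.fderiv_right (m := 1) (by norm_num)).clm_apply (hv.of_le (by norm_num))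
  have hd : ContDiff ℝ 1 (VectorCalculus.divergence v) :=
    contDiff_divergence (n := 1) (by exact_mod_cast hv)
  exact (hc.add (hd.smul (hw.of_le (by norm_num)))).differentiable one_ne_zero

/-- `G[v₁ + v₂, w] = G[v₁,w] + G[v₂,w]` for `C²` fields. [folklore] -/
private theorem pressureSourceBil_add_left {v₁ v₂ w : EuclideanSpace ℝ (Fin 3) → EuclideanSpace ℝ (Fin 3)}
    (h₁ : ContDiff ℝ 2 v₁) (h₂ : ContDiff ℝ 2 v₂) (hw : ContDiff ℝ 2 w) :
    pressureSourceBil (v₁ + v₂) w = fun x => pressureSourceBil v₁ w x + pressureSourceBil v₂ w x := by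
  funext x
  unfold pressureSourceBil
  have hsum : (fun y => convect (v₁ + v₂) w y + VectorCalculus.divergence (v₁ + v₂) y • w y) =
      (fun y => convect v₁ w y + VectorCalculus.divergence v₁ y • w y) +
        fun y => convect v₂ w y + VectorCalculus.divergence v₂ y • w y := by
    funext y
    have hd : VectorCalculus.divergence (v₁ + v₂) y =
        VectorCalculus.divergence v₁ y + VectorCalculus.divergence v₂ y :=
      divergence_add_aux ((h₁.differentiable (by norm_num)) y) ((h₂.differentiable (by norm_num)) y)
    simp only [Pi.add_apply, convect_apply, map_add, hd, add_smul]
    abel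
  rw [hsum, divergence_add_aux (differentiable_innerField h₁ hw x) (differentiable_innerField h₂ hw x)]

/-- `G[v, w₁ + w₂] = G[v,w₁] + G[v,w₂]` for `C²` fields. [folklore] -/
private theorem pressureSourceBil_add_right {v w₁ w₂ : EuclideanSpace ℝ (Fin 3) → EuclideanSpace ℝ (Fin 3)}
    (hv : ContDiff ℝ 2 v) (h₁ : ContDiff ℝ 2 w₁) (h₂ : ContDiff ℝ 2 w₂) :
    pressureSourceBil v (w₁ + w₂) = fun x => pressureSourceBil v w₁ x + pressureSourceBil v w₂ x := by
  funext x
  unfold pressureSourceBil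
  have hsum : (fun y => convect v (w₁ + w₂) y + VectorCalculus.divergence v y • (w₁ + w₂) y) =
      (fun y => convect v w₁ y + VectorCalculus.divergence v y • w₁ y) +
        fun y => convect v w₂ y + VectorCalculus.divergence v y • w₂ y := by
    funext y
    have hd : fderiv ℝ (w₁ + w₂) y = fderiv ℝ w₁ y + fderiv ℝ w₂ y :=
      fderiv_add ((h₁.differentiable (by norm_num)) y) ((h₂.differentiable (by norm_num)) y)
    simp only [Pi.add_apply, convect_apply, hd, add_apply, smul_add]
    abel
  rw [hsum, divergence_add_aux (differentiable_innerField hv h₁ x) (differentiable_innerField hv h₂ x)]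

/-- **Polarisation of the source**: `G[v+w] − G[v−w] = 2(G[v,w] + G[w,v])` for `C²` fields. [folklore] -/
private theorem pressureSource_add_sub {v w : EuclideanSpace ℝ (Fin 3) → EuclideanSpace ℝ (Fin 3)}
    (hv : ContDiff ℝ 2 v) (hw : ContDiff ℝ 2 w) (x : EuclideanSpace ℝ (Fin 3)) :
    pressureSource (v + w) x - pressureSource (v - w) x =
      2 * (pressureSourceBil v w x + pressureSourceBil w v x) := by
  have hw' : ContDiff ℝ 2 ((-1 : ℝ) • w) := by
    have h := hw.const_smul (-1 : ℝ)
    exact h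
  have e1 : v - w = v + (-1 : ℝ) • w := by
    funext y; simp [sub_eq_add_neg]
  have hvw : ContDiff ℝ 2 (v + w) := hv.add hw
  have hvw' : ContDiff ℝ 2 (v + (-1 : ℝ) • w) := hv.add hw'
  rw [← pressureSourceBil_self, ← pressureSourceBil_self, e1,
    pressureSourceBil_add_left hv hw hvw, pressureSourceBil_add_left hv hw' hvw']
  simp only
  rw [pressureSourceBil_add_right hv hv hw, pressureSourceBil_add_right hw hv hw,
    pressureSourceBil_add_right hv hv hw', pressureSourceBil_add_right hw' hv hw',
    pressureSourceBil_smul_right, pressureSourceBil_smul_left, pressureSourceBil_smul_left,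
    pressureSourceBil_smul_right]
  simp only
  ring


namespace PineauVicol2026

open Literature.Analysis.FluidPDE.FourierNS (HasDecay)

-- nested operator types
set_option maxSynthPendingDepth 3


/-- Evaluation of a bilinear form at a pair, `B ↦ B(a, b)`, as a continuous linear functional
(`evalPair a a = evalDiag a`). [folklore] -/
def evalPair (a b : EuclideanSpace ℝ (Fin 3)) :
    ((EuclideanSpace ℝ (Fin 3)) →L[ℝ] (EuclideanSpace ℝ (Fin 3)) →L[ℝ] ℝ) →L[ℝ] ℝ :=
  (ContinuousLinearMap.apply ℝ ℝ b).comp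
    (ContinuousLinearMap.apply ℝ ((EuclideanSpace ℝ (Fin 3)) →L[ℝ] ℝ) a)

/-- Unfolding `evalPair`. [folklore] -/
@[simp] private theorem evalPair_apply (a b : EuclideanSpace ℝ (Fin 3))
    (B : (EuclideanSpace ℝ (Fin 3)) →L[ℝ] (EuclideanSpace ℝ (Fin 3)) →L[ℝ] ℝ) :
    evalPair a b B = B a b := rfl

/-- `‖evalPair a b‖ ≤ ‖a‖ ‖b‖`. [folklore] -/
private theorem norm_evalPair_le (a b : EuclideanSpace ℝ (Fin 3)) : ‖evalPair a b‖ ≤ ‖a‖ * ‖b‖ := by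
  refine ContinuousLinearMap.opNorm_le_bound _ (by positivity) fun B => ?_
  rw [evalPair_apply]
  calc ‖B a b‖ ≤ ‖B a‖ * ‖b‖ := ContinuousLinearMap.le_opNorm _ _
    _ ≤ ‖B‖ * ‖a‖ * ‖b‖ := by gcongr; exact ContinuousLinearMap.le_opNorm _ _
    _ = ‖a‖ * ‖b‖ * ‖B‖ := by ring

/-- `y ↦ evalPair (v y) (w y)` is continuous for continuous `v, w`. [folklore] -/
private theorem continuous_evalPair_comp {v w : EuclideanSpace ℝ (Fin 3) → EuclideanSpace ℝ (Fin 3)}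
    (hv : Continuous v) (hw : Continuous w) : Continuous fun y => evalPair (v y) (w y) :=
  (((ContinuousLinearMap.apply ℝ ℝ).continuous).comp hw).clm_comp
    (((ContinuousLinearMap.apply ℝ ((EuclideanSpace ℝ (Fin 3)) →L[ℝ] ℝ)).continuous).comp hv)

/-- Integrability of the bilinear far integrand on the decay class. [folklore] -/
private theorem integrable_farPotentialBil_integrand {r₀ r₁ : ℝ} (h₀ : 0 < r₀) (h₁ : r₀ < r₁)
    {v w : EuclideanSpace ℝ (Fin 3) → EuclideanSpace ℝ (Fin 3)} (hvc : Continuous v)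
    (hwc : Continuous w) {Cv Cw : ℝ} (hv : ∀ y, ‖v y‖ ≤ Cv / (1 + ‖y‖))
    (hw : ∀ y, ‖w y‖ ≤ Cw / (1 + ‖y‖)) (x : EuclideanSpace ℝ (Fin 3)) :
    Integrable fun y => fderiv ℝ (fderiv ℝ (newtonFar r₀ r₁)) (x - y) (v y) (w y) := by
  obtain ⟨⟨M₀, hM₀⟩, -, -⟩ := exists_hasDecay_fderiv_newtonFar h₀ h₁
  have hCv : 0 ≤ Cv := le_trans (norm_nonneg _) ((hv 0).trans (by simp))
  have hL : HasDecay 2 (Cv * Cw) fun y => evalPair (v y) (w y) := by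
    intro y
    have hy : 0 < 1 + ‖y‖ := by positivity
    calc ‖evalPair (v y) (w y)‖ ≤ ‖v y‖ * ‖w y‖ := norm_evalPair_le _ _
      _ ≤ Cv / (1 + ‖y‖) * (Cw / (1 + ‖y‖)) :=
          mul_le_mul (hv y) (hw y) (norm_nonneg _) (div_nonneg hCv hy.le)
      _ = Cv * Cw * ((1 + ‖y‖) ^ 2)⁻¹ := by field_simp
  have h := integrable_clm_apply_comp_sub_decay (contDiff_fderiv2_newtonFar h₀ h₁).continuous hM₀
    (continuous_evalPair_comp hvc hwc) hL x
  simpa only [evalPair_apply] using h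

/-- **Polarisation of the near potential**: `Q₁[v+w] − Q₁[v−w] = 2(Q₁[v,w] + Q₁[w,v])` for `C²`
fields. [folklore] -/
private theorem nearPotential_add_sub {r₀ r₁ : ℝ} (h₀ : 0 ≤ r₀) (h₁ : r₀ < r₁)
    {v w : EuclideanSpace ℝ (Fin 3) → EuclideanSpace ℝ (Fin 3)} (hv : ContDiff ℝ 2 v)
    (hw : ContDiff ℝ 2 w) (x : EuclideanSpace ℝ (Fin 3)) :
    nearPotential r₀ r₁ (v + w) x - nearPotential r₀ r₁ (v - w) x =
      2 * (nearPotentialBil r₀ r₁ v w x + nearPotentialBil r₀ r₁ w v x) := by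
  have hi : ∀ {u : EuclideanSpace ℝ (Fin 3) → EuclideanSpace ℝ (Fin 3)}, ContDiff ℝ 2 u →
      Integrable fun z => newtonNear r₀ r₁ z * pressureSource u (x - z) :=
    fun hu => integrable_nearPotential_integrand h₀ h₁ hu x
  have hib : ∀ {u u' : EuclideanSpace ℝ (Fin 3) → EuclideanSpace ℝ (Fin 3)}, ContDiff ℝ 2 u →
      ContDiff ℝ 2 u' → Integrable fun z => newtonNear r₀ r₁ z * pressureSourceBil u u' (x - z) := by
    intro u u' hu hu'
    have hc : Continuous (pressureSourceBil u u') :=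
      (contDiff_pressureSourceBil (n := 0) (by exact_mod_cast hu) (by exact_mod_cast hu')).continuous
    exact integrable_smul_comp_sub (integrable_newtonNear h₀ h₁)
      (fun z hz => newtonNear_eq_zero h₀ h₁ hz.le) hc x
  have hi1 : Integrable fun z => newtonNear r₀ r₁ z * pressureSource (v + w) (x - z) :=
    hi (hv.add hw)
  have hi2 : Integrable fun z => newtonNear r₀ r₁ z * pressureSource (v - w) (x - z) :=
    hi (hv.sub hw)
  unfold nearPotential nearPotentialBil
  rw [← integral_sub hi1 hi2]
  have hpt : ∀ z, newtonNear r₀ r₁ z * pressureSource (v + w) (x - z) -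
      newtonNear r₀ r₁ z * pressureSource (v - w) (x - z) =
      2 * (newtonNear r₀ r₁ z * pressureSourceBil v w (x - z)) +
        2 * (newtonNear r₀ r₁ z * pressureSourceBil w v (x - z)) := by
    intro z
    rw [← mul_sub, pressureSource_add_sub hv hw]
    ring
  simp_rw [hpt]
  rw [integral_add ((hib hv hw).const_mul 2) ((hib hw hv).const_mul 2), integral_const_mul,
    integral_const_mul]
  ring

/-- **Polarisation of the far potential**: `Q₂[v+w] − Q₂[v−w] = 2(Q₂[v,w] + Q₂[w,v])` for continuous
fields in the decay class. [folklore] -/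
private theorem farPotential_add_sub {r₀ r₁ : ℝ} (h₀ : 0 < r₀) (h₁ : r₀ < r₁)
    {v w : EuclideanSpace ℝ (Fin 3) → EuclideanSpace ℝ (Fin 3)} (hvc : Continuous v)
    (hwc : Continuous w) {Cv Cw : ℝ} (hv : ∀ y, ‖v y‖ ≤ Cv / (1 + ‖y‖))
    (hw : ∀ y, ‖w y‖ ≤ Cw / (1 + ‖y‖)) (x : EuclideanSpace ℝ (Fin 3)) :
    farPotential r₀ r₁ (v + w) x - farPotential r₀ r₁ (v - w) x =
      2 * (farPotentialBil r₀ r₁ v w x + farPotentialBil r₀ r₁ w v x) := by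
  have hvw : ∀ y, ‖(v + w) y‖ ≤ (Cv + Cw) / (1 + ‖y‖) := fun y => by
    rw [Pi.add_apply, add_div]; exact (norm_add_le _ _).trans (add_le_add (hv y) (hw y))
  have hvw' : ∀ y, ‖(v - w) y‖ ≤ (Cv + Cw) / (1 + ‖y‖) := fun y => by
    rw [Pi.sub_apply, add_div]; exact (norm_sub_le _ _).trans (add_le_add (hv y) (hw y))
  have hi1 := integrable_farPotentialBil_integrand h₀ h₁ (hvc.add hwc) (hvc.add hwc) hvw hvw x
  have hi2 := integrable_farPotentialBil_integrand h₀ h₁ (hvc.sub hwc) (hvc.sub hwc) hvw' hvw' x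
  have hi3 := integrable_farPotentialBil_integrand h₀ h₁ hvc hwc hv hw x
  have hi4 := integrable_farPotentialBil_integrand h₀ h₁ hwc hvc hw hv x
  unfold farPotential farPotentialBil
  rw [← integral_sub hi1 hi2]
  have hpt : ∀ y, fderiv ℝ (fderiv ℝ (newtonFar r₀ r₁)) (x - y) ((v + w) y) ((v + w) y) -
      fderiv ℝ (fderiv ℝ (newtonFar r₀ r₁)) (x - y) ((v - w) y) ((v - w) y) =
      2 * (fderiv ℝ (fderiv ℝ (newtonFar r₀ r₁)) (x - y) (v y) (w y)) +
        2 * (fderiv ℝ (fderiv ℝ (newtonFar r₀ r₁)) (x - y) (w y) (v y)) := by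
    intro y
    simp only [Pi.add_apply, Pi.sub_apply, map_add, map_sub, add_apply,
      sub_apply]
    ring
  simp_rw [hpt]
  rw [integral_add (hi3.const_mul 2) (hi4.const_mul 2), integral_const_mul, integral_const_mul]
  ring

/-- **Polarisation**: `Q[v+w] − Q[v−w] = 4 Qˢ[v,w]` for `C²` fields in the decay class. [cite: PineauVicol2026, Lemma 8.1, proof (p. 28): the polar form of `RᵢRⱼ(UᵢUⱼ)` behind `∂ₛP = 2RᵢRⱼ(∂ₛUᵢUⱼ)`] -/
theorem pressurePotential_add_sub {v w : EuclideanSpace ℝ (Fin 3) → EuclideanSpace ℝ (Fin 3)}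
    (hv : ContDiff ℝ 2 v) (hw : ContDiff ℝ 2 w) {Cv Cw : ℝ} (hv0 : ∀ y, ‖v y‖ ≤ Cv / (1 + ‖y‖))
    (hw0 : ∀ y, ‖w y‖ ≤ Cw / (1 + ‖y‖)) (x : EuclideanSpace ℝ (Fin 3)) :
    pressurePotential (v + w) x - pressurePotential (v - w) x = 4 * pressurePotentialSym v w x := by
  have hn := nearPotential_add_sub zero_le_one one_lt_two hv hw x
  have hf := farPotential_add_sub one_pos one_lt_two hv.continuous hw.continuous hv0 hw0 x
  simp only [pressurePotential, pressurePotentialSym, pressurePotentialBil]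
  linarith

/-- **Polarisation with a scale**: `Q[v + t w] − Q[v − t w] = 4t Qˢ[v,w]`. [cite: PineauVicol2026, Lemma 8.1, proof (p. 28): the polar form of `RᵢRⱼ(UᵢUⱼ)` behind `∂ₛP = 2RᵢRⱼ(∂ₛUᵢUⱼ)`] -/
theorem pressurePotential_add_smul_sub {v w : EuclideanSpace ℝ (Fin 3) → EuclideanSpace ℝ (Fin 3)}
    (hv : ContDiff ℝ 2 v) (hw : ContDiff ℝ 2 w) {Cv Cw : ℝ} (hv0 : ∀ y, ‖v y‖ ≤ Cv / (1 + ‖y‖))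
    (hw0 : ∀ y, ‖w y‖ ≤ Cw / (1 + ‖y‖)) (t : ℝ) (x : EuclideanSpace ℝ (Fin 3)) :
    pressurePotential (v + t • w) x - pressurePotential (v - t • w) x =
      4 * t * pressurePotentialSym v w x := by
  have hw' : ContDiff ℝ 2 (t • w) := by
    have h := hw.const_smul t
    exact h
  have hw0' : ∀ y, ‖(t • w) y‖ ≤ |t| * Cw / (1 + ‖y‖) := fun y => by
    rw [Pi.smul_apply, norm_smul, Real.norm_eq_abs, mul_div_assoc]
    exact mul_le_mul_of_nonneg_left (hw0 y) (abs_nonneg t)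
  rw [pressurePotential_add_sub hv hw' hv0 hw0' x, pressurePotentialSym_smul_right]
  ring


/-- A field whose values have norm `≤ 0 / (1+|y|)` vanishes, and then `Qˢ[v,w] = 0`. [folklore] -/
private theorem pressurePotentialSym_eq_zero_of_right
    (v : EuclideanSpace ℝ (Fin 3) → EuclideanSpace ℝ (Fin 3))
    {w : EuclideanSpace ℝ (Fin 3) → EuclideanSpace ℝ (Fin 3)} (hw : ∀ y, ‖w y‖ ≤ 0 / (1 + ‖y‖))
    (x : EuclideanSpace ℝ (Fin 3)) : pressurePotentialSym v w x = 0 := by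
  have hw0 : w = (0 : ℝ) • w := by
    funext y
    have h := hw y
    rw [zero_div] at h
    rw [Pi.smul_apply, zero_smul]
    exact norm_le_zero_iff.1 h
  rw [hw0, pressurePotentialSym_smul_right]
  simp


/-! ### Decay of the polar form with PRODUCT constants, every order (the scaling trick `w ↦ t w`) -/

/-- Weighted bounds of every order for `v + t w` from those of `v` and `w`. [folklore] -/
private theorem pow_mul_norm_iteratedFDeriv_add_smul_le
    {v w : EuclideanSpace ℝ (Fin 3) → EuclideanSpace ℝ (Fin 3)} (hv : ContDiff ℝ ∞ v) (hw : ContDiff ℝ ∞ w)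
    {Cv Cw : ℝ} (t : ℝ) {j : ℕ}
    (hvC : ∀ y, (1 + ‖y‖) ^ (j + 1) * ‖iteratedFDeriv ℝ j v y‖ ≤ Cv)
    (hwC : ∀ y, (1 + ‖y‖) ^ (j + 1) * ‖iteratedFDeriv ℝ j w y‖ ≤ Cw) (y : EuclideanSpace ℝ (Fin 3)) :
    (1 + ‖y‖) ^ (j + 1) * ‖iteratedFDeriv ℝ j (v + t • w) y‖ ≤ Cv + |t| * Cw := by
  have hvj : ContDiffAt ℝ j v y := hv.contDiffAt.of_le (by exact_mod_cast le_top)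
  have hwj : ContDiffAt ℝ j w y := hw.contDiffAt.of_le (by exact_mod_cast le_top)
  have htw : ContDiffAt ℝ j (t • w) y := hwj.const_smul t
  rw [iteratedFDeriv_add_apply hvj htw, iteratedFDeriv_const_smul_apply hwj]
  have hp : 0 ≤ (1 + ‖y‖) ^ (j + 1) := by positivity
  calc (1 + ‖y‖) ^ (j + 1) * ‖iteratedFDeriv ℝ j v y + t • iteratedFDeriv ℝ j w y‖
      ≤ (1 + ‖y‖) ^ (j + 1) * (‖iteratedFDeriv ℝ j v y‖ + |t| * ‖iteratedFDeriv ℝ j w y‖) := by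
        refine mul_le_mul_of_nonneg_left ((norm_add_le _ _).trans (add_le_add le_rfl ?_)) hp
        rw [norm_smul, Real.norm_eq_abs]
    _ = (1 + ‖y‖) ^ (j + 1) * ‖iteratedFDeriv ℝ j v y‖ +
          |t| * ((1 + ‖y‖) ^ (j + 1) * ‖iteratedFDeriv ℝ j w y‖) := by ring
    _ ≤ Cv + |t| * Cw := add_le_add (hvC y) (mul_le_mul_of_nonneg_left (hwC y) (abs_nonneg t))

/-- A field with `(1+|y|)‖w y‖ ≤ 0` vanishes, and then `Qˢ[v,w]` is the zero function. [folklore] -/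
private theorem pressurePotentialSym_eq_zero_fun_of_right
    (v : EuclideanSpace ℝ (Fin 3) → EuclideanSpace ℝ (Fin 3))
    {w : EuclideanSpace ℝ (Fin 3) → EuclideanSpace ℝ (Fin 3)}
    (hw : ∀ y, (1 + ‖y‖) ^ (0 + 1) * ‖iteratedFDeriv ℝ 0 w y‖ ≤ 0) :
    pressurePotentialSym v w = fun _ => 0 := by
  funext x
  refine pressurePotentialSym_eq_zero_of_right v (fun y => ?_) x
  have h := hw y
  rw [norm_iteratedFDeriv_zero, zero_add, pow_one] at h
  rw [le_div_iff₀ (by positivity)]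
  nlinarith [norm_nonneg (w y), norm_nonneg y]

/-- **Pineau–Vicol 2026, (8.3) for the polar form of the pressure, every order `k`, with the PRODUCT
of the constants** (the shape of the printed "Arguing as in Lemma 2.1, these bounds then imply
`|∇ᵏ∂ₛP(y,s)| ≤ C_{U,s}(1+|α|)(1+|y|)^{−2+σ−k}`, `k ∈ {0,1,2}`", p. 28, where
`∂ₛP = 2RᵢRⱼ(∂ₛUᵢUⱼ)` is the polar form at `(∂ₛU, U)` and the bound is LINEAR in the constant of
`∂ₛU`): for every `k` there is an absolute `A_k` such that for `v, w ∈ C^∞(ℝ³; ℝ³)` with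
`(1+|y|)^{j+1}‖Dʲv(y)‖ ≤ Cᵥ`, `(1+|y|)^{j+1}‖Dʲw(y)‖ ≤ C_w` (`j ≤ k+2`),
`‖DᵏQˢ[v,w](x)‖ ≤ A_k Cᵥ C_w (1+|x|)^{−(k+2)}`. Proof: `4t Qˢ[v,w] = Q[v+tw] − Q[v−tw]`
(`pressurePotential_add_smul_sub`), the all-orders quadratic bound
`exists_bound_norm_iteratedFDeriv_pressurePotential_decay` at `v ± tw` (constants `Cᵥ + tC_w`), and
the balancing choice `t = Cᵥ/C_w`.
[cite: PineauVicol2026, Lemma 8.1, proof (p. 28); Lemma 2.1 (2.1)–(2.2) (p. 9), proof p. 10] -/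
theorem exists_bound_norm_iteratedFDeriv_pressurePotentialSym_decay (k : ℕ) :
    ∃ A : ℝ, 0 ≤ A ∧ ∀ (v w : EuclideanSpace ℝ (Fin 3) → EuclideanSpace ℝ (Fin 3)) (Cv Cw : ℝ),
      ContDiff ℝ ∞ v → ContDiff ℝ ∞ w →
      (∀ j ≤ k + 2, ∀ y, (1 + ‖y‖) ^ (j + 1) * ‖iteratedFDeriv ℝ j v y‖ ≤ Cv) →
      (∀ j ≤ k + 2, ∀ y, (1 + ‖y‖) ^ (j + 1) * ‖iteratedFDeriv ℝ j w y‖ ≤ Cw) →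
      ∀ x, ‖iteratedFDeriv ℝ k (pressurePotentialSym v w) x‖ ≤ A * Cv * Cw / (1 + ‖x‖) ^ (k + 2) := by
  obtain ⟨A, hA0, hA⟩ := exists_bound_norm_iteratedFDeriv_pressurePotential_decay k
  refine ⟨2 * A, by positivity, ?_⟩
  intro v w Cv Cw hv hw hvC hwC x
  have hpos : 0 < (1 + ‖x‖) ^ (k + 2) := by positivity
  have hCv0 : 0 ≤ Cv := le_trans (by positivity) (hvC 0 (by omega) 0)
  have hCw0 : 0 ≤ Cw := le_trans (by positivity) (hwC 0 (by omega) 0)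
  -- degenerate cases: `Cw = 0` or `Cv = 0` force `w = 0` or `v = 0`, and `Qˢ[v,w] = 0`
  rcases hCw0.eq_or_lt with hCw | hCw
  · have hz : pressurePotentialSym v w = fun _ => 0 :=
      pressurePotentialSym_eq_zero_fun_of_right v (fun y => by rw [hCw]; exact hwC 0 (by omega) y)
    rw [hz, iteratedFDeriv_fun_zero]
    simp only [Pi.zero_apply, norm_zero]
    positivity
  rcases hCv0.eq_or_lt with hCv | hCv
  · have hz : pressurePotentialSym v w = fun _ => 0 := by
      rw [pressurePotentialSym_comm]
      exact pressurePotentialSym_eq_zero_fun_of_right w (fun y => by rw [hCv]; exact hvC 0 (by omega) y)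
    rw [hz, iteratedFDeriv_fun_zero]
    simp only [Pi.zero_apply, norm_zero]
    positivity
  -- the balanced scale `t = Cv / Cw`
  set t : ℝ := Cv / Cw with ht
  have ht0 : 0 < t := div_pos hCv hCw
  have htabs : |t| = t := abs_of_pos ht0
  have htCw : |t| * Cw = Cv := by rw [htabs, ht]; field_simp
  -- order-zero decay of `v`, `w` (for the polarisation identity)
  have hv0 : ∀ y, ‖v y‖ ≤ Cv / (1 + ‖y‖) := by
    intro y
    have h := hvC 0 (by omega) y
    rw [norm_iteratedFDeriv_zero, zero_add, pow_one] at h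
    rw [le_div_iff₀ (by positivity)]; linarith
  have hw0 : ∀ y, ‖w y‖ ≤ Cw / (1 + ‖y‖) := by
    intro y
    have h := hwC 0 (by omega) y
    rw [norm_iteratedFDeriv_zero, zero_add, pow_one] at h
    rw [le_div_iff₀ (by positivity)]; linarith
  -- the fields `v ± t w`
  have hp : ContDiff ℝ ∞ (v + t • w) := hv.add (hw.const_smul t)
  have hm : ContDiff ℝ ∞ (v - t • w) := hv.sub (hw.const_smul t)
  have hpC : ∀ j ≤ k + 2, ∀ y, (1 + ‖y‖) ^ (j + 1) * ‖iteratedFDeriv ℝ j (v + t • w) y‖ ≤ 2 * Cv := by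
    intro j hj y
    have h := pow_mul_norm_iteratedFDeriv_add_smul_le hv hw t (hvC j hj) (hwC j hj) y
    rw [htCw] at h
    linarith
  have hmC : ∀ j ≤ k + 2, ∀ y, (1 + ‖y‖) ^ (j + 1) * ‖iteratedFDeriv ℝ j (v - t • w) y‖ ≤ 2 * Cv := by
    intro j hj y
    have h := pow_mul_norm_iteratedFDeriv_add_smul_le hv hw (-t) (hvC j hj) (hwC j hj) y
    rw [abs_neg, htCw, neg_smul, ← sub_eq_add_neg] at h
    linarith
  have hp0 : ∀ y, ‖(v + t • w) y‖ ≤ 2 * Cv / (1 + ‖y‖) := by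
    intro y
    have h := hpC 0 (by omega) y
    rw [norm_iteratedFDeriv_zero, zero_add, pow_one] at h
    rw [le_div_iff₀ (by positivity)]; linarith
  have hm0 : ∀ y, ‖(v - t • w) y‖ ≤ 2 * Cv / (1 + ‖y‖) := by
    intro y
    have h := hmC 0 (by omega) y
    rw [norm_iteratedFDeriv_zero, zero_add, pow_one] at h
    rw [le_div_iff₀ (by positivity)]; linarith
  -- the polarisation identity as functions, and its `k`-th derivative
  have hpol : pressurePotentialSym v w =
      fun y => (4 * t)⁻¹ • (pressurePotential (v + t • w) y - pressurePotential (v - t • w) y) := by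
    funext y
    rw [pressurePotential_add_smul_sub (contDiff_infty.1 hv 2) (contDiff_infty.1 hw 2) hv0 hw0 t y,
      smul_eq_mul, ← mul_assoc, inv_mul_cancel₀ (by positivity), one_mul]
  have hQp : ContDiffAt ℝ k (pressurePotential (v + t • w)) x :=
    (contDiff_pressurePotential_decay_top hp hp0).contDiffAt.of_le (by exact_mod_cast le_top)
  have hQm : ContDiffAt ℝ k (pressurePotential (v - t • w)) x :=
    (contDiff_pressurePotential_decay_top hm hm0).contDiffAt.of_le (by exact_mod_cast le_top)
  have hQpm : ContDiffAt ℝ k (fun y => pressurePotential (v + t • w) y - pressurePotential (v - t • w) y) x :=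
    hQp.sub hQm
  have hD : iteratedFDeriv ℝ k (pressurePotentialSym v w) x =
      (4 * t)⁻¹ • (iteratedFDeriv ℝ k (pressurePotential (v + t • w)) x -
        iteratedFDeriv ℝ k (pressurePotential (v - t • w)) x) := by
    rw [hpol, iteratedFDeriv_const_smul_apply' hQpm]
    congr 1
    exact iteratedFDeriv_sub_apply hQp hQm
  have hbp := hA _ (2 * Cv) hp hpC x
  have hbm := hA _ (2 * Cv) hm hmC x
  rw [hD, norm_smul, norm_inv, Real.norm_eq_abs, abs_of_pos (by positivity : (0:ℝ) < 4 * t)]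
  calc (4 * t)⁻¹ * ‖iteratedFDeriv ℝ k (pressurePotential (v + t • w)) x -
          iteratedFDeriv ℝ k (pressurePotential (v - t • w)) x‖
      ≤ (4 * t)⁻¹ * (A * (2 * Cv) ^ 2 / (1 + ‖x‖) ^ (k + 2) + A * (2 * Cv) ^ 2 / (1 + ‖x‖) ^ (k + 2)) := by
        refine mul_le_mul_of_nonneg_left ((norm_sub_le _ _).trans (add_le_add hbp hbm)) (by positivity)
    _ = 2 * A * Cv * Cw / (1 + ‖x‖) ^ (k + 2) := by
        rw [ht]
        field_simp
        ring

/-- The order-zero case in absolute-value form: `|Qˢ[v,w](x)| ≤ A Cᵥ C_w (1+|x|)⁻²`.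
[cite: PineauVicol2026, Lemma 8.1, proof (p. 28); Lemma 2.1 (2.2) (p. 9)] -/
theorem exists_bound_abs_pressurePotentialSym_decay :
    ∃ A : ℝ, 0 ≤ A ∧ ∀ (v w : EuclideanSpace ℝ (Fin 3) → EuclideanSpace ℝ (Fin 3)) (Cv Cw : ℝ),
      ContDiff ℝ ∞ v → ContDiff ℝ ∞ w →
      (∀ j ≤ 2, ∀ y, (1 + ‖y‖) ^ (j + 1) * ‖iteratedFDeriv ℝ j v y‖ ≤ Cv) →
      (∀ j ≤ 2, ∀ y, (1 + ‖y‖) ^ (j + 1) * ‖iteratedFDeriv ℝ j w y‖ ≤ Cw) →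
      ∀ x, |pressurePotentialSym v w x| ≤ A * Cv * Cw / (1 + ‖x‖) ^ 2 := by
  obtain ⟨A, hA0, hA⟩ := exists_bound_norm_iteratedFDeriv_pressurePotentialSym_decay 0
  refine ⟨A, hA0, fun v w Cv Cw hv hw hvC hwC x => ?_⟩
  have h := hA v w Cv Cw hv hw hvC hwC x
  rw [norm_iteratedFDeriv_zero, Real.norm_eq_abs] at h
  exact h

/-- The order-one case in the nested shape: `‖DQˢ[v,w](x)‖ ≤ A Cᵥ C_w (1+|x|)⁻³`.
[cite: PineauVicol2026, Lemma 8.1, proof (p. 28); Lemma 2.1 (2.2) (p. 9)] -/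
theorem exists_bound_norm_fderiv_pressurePotentialSym_decay :
    ∃ A : ℝ, 0 ≤ A ∧ ∀ (v w : EuclideanSpace ℝ (Fin 3) → EuclideanSpace ℝ (Fin 3)) (Cv Cw : ℝ),
      ContDiff ℝ ∞ v → ContDiff ℝ ∞ w →
      (∀ j ≤ 3, ∀ y, (1 + ‖y‖) ^ (j + 1) * ‖iteratedFDeriv ℝ j v y‖ ≤ Cv) →
      (∀ j ≤ 3, ∀ y, (1 + ‖y‖) ^ (j + 1) * ‖iteratedFDeriv ℝ j w y‖ ≤ Cw) →
      ∀ x, ‖fderiv ℝ (pressurePotentialSym v w) x‖ ≤ A * Cv * Cw / (1 + ‖x‖) ^ 3 := by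
  obtain ⟨A, hA0, hA⟩ := exists_bound_norm_iteratedFDeriv_pressurePotentialSym_decay 1
  refine ⟨A, hA0, fun v w Cv Cw hv hw hvC hwC x => ?_⟩
  have h := hA v w Cv Cw hv hw hvC hwC x
  rw [← norm_iteratedFDeriv_fderiv, norm_iteratedFDeriv_zero] at h
  exact h

/-- The order-two case in the nested shape: `‖D²Qˢ[v,w](x)‖ ≤ A Cᵥ C_w (1+|x|)⁻⁴`.
[cite: PineauVicol2026, Lemma 8.1, proof (p. 28); Lemma 2.1 (2.2) (p. 9)] -/
theorem exists_bound_norm_fderiv2_pressurePotentialSym_decay :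
    ∃ A : ℝ, 0 ≤ A ∧ ∀ (v w : EuclideanSpace ℝ (Fin 3) → EuclideanSpace ℝ (Fin 3)) (Cv Cw : ℝ),
      ContDiff ℝ ∞ v → ContDiff ℝ ∞ w →
      (∀ j ≤ 4, ∀ y, (1 + ‖y‖) ^ (j + 1) * ‖iteratedFDeriv ℝ j v y‖ ≤ Cv) →
      (∀ j ≤ 4, ∀ y, (1 + ‖y‖) ^ (j + 1) * ‖iteratedFDeriv ℝ j w y‖ ≤ Cw) →
      ∀ x, ‖fderiv ℝ (fderiv ℝ (pressurePotentialSym v w)) x‖ ≤ A * Cv * Cw / (1 + ‖x‖) ^ 4 := by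
  obtain ⟨A, hA0, hA⟩ := exists_bound_norm_iteratedFDeriv_pressurePotentialSym_decay 2
  refine ⟨A, hA0, fun v w Cv Cw hv hw hvC hwC x => ?_⟩
  have h := hA v w Cv Cw hv hw hvC hwC x
  rw [← norm_iteratedFDeriv_fderiv, ← norm_iteratedFDeriv_fderiv, norm_iteratedFDeriv_zero] at h
  exact h

end PineauVicol2026


/-! ## The `s`-derivative of the pressure along a family of profiles: `∂ₛQ[U(·,s)] = 2Qˢ[∂ₛU, U]` -/

namespace PineauVicol2026

open Literature.Analysis.FluidPDE.FourierNS (HasDecay)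

-- nested operator types
set_option maxSynthPendingDepth 3

/-- **`∂ₛ` under the far integral.** For a family of continuous fields `U(σ)` with `(1+|y|)|U(σ)(y)| ≤ C`,
differentiable in `σ` pointwise with derivative `U'(σ)`, `(1+|y|)|U'(σ)(y)| ≤ D` (uniformly in `σ`),
`σ ↦ Q₂[U(σ)](x)` is differentiable with derivative `Q₂[U'(s),U(s)](x) + Q₂[U(s),U'(s)](x)` (dominated
differentiation: the kernel `D²Γ∞` decays like `(1+|z|)⁻³`, the weights like `(1+|y|)⁻²`). [folklore] -/
private theorem hasDerivAt_farPotential_family {r₀ r₁ : ℝ} (h₀ : 0 < r₀) (h₁ : r₀ < r₁)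
    {U U' : ℝ → EuclideanSpace ℝ (Fin 3) → EuclideanSpace ℝ (Fin 3)} {C D : ℝ} {s : ℝ}
    (hUc : ∀ σ, Continuous (U σ)) (hU'c : Continuous (U' s))
    (hU : ∀ σ y, ‖U σ y‖ ≤ C / (1 + ‖y‖)) (hU' : ∀ σ y, ‖U' σ y‖ ≤ D / (1 + ‖y‖))
    (hd : ∀ σ y, HasDerivAt (fun τ => U τ y) (U' σ y) σ) (x : EuclideanSpace ℝ (Fin 3)) :
    HasDerivAt (fun σ => farPotential r₀ r₁ (U σ) x)
      (farPotentialBil r₀ r₁ (U' s) (U s) x + farPotentialBil r₀ r₁ (U s) (U' s) x) s := by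
  obtain ⟨⟨M₀, hM₀⟩, -, -⟩ := exists_hasDecay_fderiv_newtonFar h₀ h₁
  have hM₀0 := hM₀.nonneg
  have hC0 : 0 ≤ C := le_trans (norm_nonneg _) ((hU s 0).trans (by simp))
  have hD0 : 0 ≤ D := le_trans (norm_nonneg _) ((hU' s 0).trans (by simp))
  set Φ := fderiv ℝ (fderiv ℝ (newtonFar r₀ r₁)) with hΦ
  have hΦc : Continuous Φ := (contDiff_fderiv2_newtonFar h₀ h₁).continuous
  set F : ℝ → EuclideanSpace ℝ (Fin 3) → ℝ := fun σ y => Φ (x - y) (U σ y) (U σ y) with hF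
  set F' : ℝ → EuclideanSpace ℝ (Fin 3) → ℝ :=
    fun σ y => Φ (x - y) (U' σ y) (U σ y) + Φ (x - y) (U σ y) (U' σ y) with hF'
  -- measurability
  have hΦxy : Continuous fun y : EuclideanSpace ℝ (Fin 3) => Φ (x - y) :=
    hΦc.comp (continuous_const.sub continuous_id)
  have hF_meas : ∀ σ, AEStronglyMeasurable (F σ) volume := fun σ =>
    (((hΦxy.clm_apply (hUc σ)).clm_apply (hUc σ))).aestronglyMeasurable
  have hF'_meas : AEStronglyMeasurable (F' s) volume :=
    (((hΦxy.clm_apply hU'c).clm_apply (hUc s)).add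
      ((hΦxy.clm_apply (hUc s)).clm_apply hU'c)).aestronglyMeasurable
  -- integrability of `F s`
  have hF_int : Integrable (F s) := by
    have h := integrable_clm_apply_comp_sub_decay (L := fun y => evalDiag (U s y)) hΦc hM₀
      (continuous_evalDiag.comp (hUc s)) (hasDecay_two_evalDiag (hU s)) x
    refine h.congr (Eventually.of_forall fun y => ?_)
    simp only [hF, evalDiag_apply]
  -- the dominating function
  set bound : EuclideanSpace ℝ (Fin 3) → ℝ :=
    fun y => 2 * (M₀ * (D * C) * (2 + ‖x‖) ^ 3 * ((1 + ‖y‖) ^ 5)⁻¹) with hbound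
  have hbi : Integrable bound := (integrable_inv_one_add_norm_pow_five.const_mul _).const_mul _
  have hL : ∀ σ, HasDecay 2 (D * C) (fun y => evalPair (U' σ y) (U σ y)) := by
    intro σ y
    have hy : 0 < 1 + ‖y‖ := by positivity
    calc ‖evalPair (U' σ y) (U σ y)‖ ≤ ‖U' σ y‖ * ‖U σ y‖ := norm_evalPair_le _ _
      _ ≤ D / (1 + ‖y‖) * (C / (1 + ‖y‖)) :=
          mul_le_mul (hU' σ y) (hU σ y) (norm_nonneg _) (div_nonneg hD0 hy.le)
      _ = D * C * ((1 + ‖y‖) ^ 2)⁻¹ := by field_simp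
  have h_bound : ∀ᵐ y : EuclideanSpace ℝ (Fin 3) ∂volume, ∀ σ ∈ ball s 1, ‖F' σ y‖ ≤ bound y := by
    refine Eventually.of_forall fun y σ _ => ?_
    have h1 : ‖Φ (x - y) (U' σ y) (U σ y)‖ ≤ M₀ * (D * C) * (2 + ‖x‖) ^ 3 * ((1 + ‖y‖) ^ 5)⁻¹ := by
      have h := norm_mul_norm_comp_sub_le hM₀ (hL σ) (x₀ := x) (x := x) (by simp) y
      calc ‖Φ (x - y) (U' σ y) (U σ y)‖ = ‖evalPair (U' σ y) (U σ y) (Φ (x - y))‖ := by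
            rw [evalPair_apply]
        _ ≤ ‖evalPair (U' σ y) (U σ y)‖ * ‖Φ (x - y)‖ := ContinuousLinearMap.le_opNorm _ _
        _ ≤ _ := h
    have h2 : ‖Φ (x - y) (U σ y) (U' σ y)‖ ≤ M₀ * (D * C) * (2 + ‖x‖) ^ 3 * ((1 + ‖y‖) ^ 5)⁻¹ := by
      have hL' : HasDecay 2 (D * C) (fun y => evalPair (U σ y) (U' σ y)) := by
        intro y'
        have hy : 0 < 1 + ‖y'‖ := by positivity
        calc ‖evalPair (U σ y') (U' σ y')‖ ≤ ‖U σ y'‖ * ‖U' σ y'‖ := norm_evalPair_le _ _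
          _ ≤ C / (1 + ‖y'‖) * (D / (1 + ‖y'‖)) :=
              mul_le_mul (hU σ y') (hU' σ y') (norm_nonneg _) (div_nonneg hC0 hy.le)
          _ = D * C * ((1 + ‖y'‖) ^ 2)⁻¹ := by field_simp
      have h := norm_mul_norm_comp_sub_le hM₀ hL' (x₀ := x) (x := x) (by simp) y
      calc ‖Φ (x - y) (U σ y) (U' σ y)‖ = ‖evalPair (U σ y) (U' σ y) (Φ (x - y))‖ := by
            rw [evalPair_apply]
        _ ≤ ‖evalPair (U σ y) (U' σ y)‖ * ‖Φ (x - y)‖ := ContinuousLinearMap.le_opNorm _ _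
        _ ≤ _ := h
    calc ‖F' σ y‖ ≤ ‖Φ (x - y) (U' σ y) (U σ y)‖ + ‖Φ (x - y) (U σ y) (U' σ y)‖ := norm_add_le _ _
      _ ≤ bound y := by rw [hbound]; linarith
  -- pointwise differentiability in `σ`
  have h_diff : ∀ᵐ y : EuclideanSpace ℝ (Fin 3) ∂volume, ∀ σ ∈ ball s 1,
      HasDerivAt (fun τ => F τ y) (F' σ y) σ := by
    refine Eventually.of_forall fun y σ _ => ?_
    have hB : HasDerivAt (fun τ => Φ (x - y) (U τ y)) (Φ (x - y) (U' σ y)) σ :=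
      (Φ (x - y)).hasFDerivAt.comp_hasDerivAt σ (hd σ y)
    have h := hB.clm_apply (hd σ y)
    -- `h : HasDerivAt (fun τ => Φ (x - y) (U τ y) (U τ y)) (Φ (x-y) (U' σ y) (U σ y) + Φ (x-y) (U σ y) (U' σ y)) σ`
    simpa only [hF, hF', add_comm] using h
  have hmain := (hasDerivAt_integral_of_dominated_loc_of_deriv_le (ball_mem_nhds s one_pos)
    (Eventually.of_forall hF_meas) hF_int hF'_meas h_bound hbi h_diff).2
  -- identify the integral of `F' s`
  have hi1 := integrable_farPotentialBil_integrand h₀ h₁ hU'c (hUc s) (hU' s) (hU s) x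
  have hi2 := integrable_farPotentialBil_integrand h₀ h₁ (hUc s) hU'c (hU s) (hU' s) x
  have e : (∫ y, F' s y) = farPotentialBil r₀ r₁ (U' s) (U s) x + farPotentialBil r₀ r₁ (U s) (U' s) x := by
    rw [hF']
    exact integral_add hi1 hi2
  rw [← e]
  exact hmain

/-- **`∂ₛ` under the near integral.** For a family of `C²` fields `U(σ)` whose quadratic source
`G[U(σ)](y)` is differentiable in `σ` pointwise, with derivative the polarised source
`G[U'(σ),U(σ)](y) + G[U(σ),U'(σ)](y)` and a uniform bound for it, `σ ↦ Q₁[U(σ)](x)` is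
differentiable with derivative `Q₁[U'(s),U(s)](x) + Q₁[U(s),U'(s)](x)` (dominated differentiation
against the `L¹` kernel `Γ₀`). [folklore] -/
private theorem hasDerivAt_nearPotential_family {r₀ r₁ : ℝ} (h₀ : 0 ≤ r₀) (h₁ : r₀ < r₁)
    {U U' : ℝ → EuclideanSpace ℝ (Fin 3) → EuclideanSpace ℝ (Fin 3)} {B : ℝ} {s : ℝ}
    (hU2 : ∀ σ, ContDiff ℝ 2 (U σ)) (hU'2 : ContDiff ℝ 2 (U' s))
    (hsrc : ∀ σ y, HasDerivAt (fun τ => pressureSource (U τ) y)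
      (pressureSourceBil (U' σ) (U σ) y + pressureSourceBil (U σ) (U' σ) y) σ)
    (hB : ∀ σ y, |pressureSourceBil (U' σ) (U σ) y + pressureSourceBil (U σ) (U' σ) y| ≤ B)
    (x : EuclideanSpace ℝ (Fin 3)) :
    HasDerivAt (fun σ => nearPotential r₀ r₁ (U σ) x)
      (nearPotentialBil r₀ r₁ (U' s) (U s) x + nearPotentialBil r₀ r₁ (U s) (U' s) x) s := by
  set F : ℝ → EuclideanSpace ℝ (Fin 3) → ℝ := fun σ z => newtonNear r₀ r₁ z * pressureSource (U σ) (x - z)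
    with hF
  set F' : ℝ → EuclideanSpace ℝ (Fin 3) → ℝ := fun σ z => newtonNear r₀ r₁ z *
    (pressureSourceBil (U' σ) (U σ) (x - z) + pressureSourceBil (U σ) (U' σ) (x - z)) with hF'
  have hF_int : ∀ σ, Integrable (F σ) := fun σ => integrable_nearPotential_integrand h₀ h₁ (hU2 σ) x
  have hc1 : Continuous (pressureSourceBil (U' s) (U s)) :=
    (contDiff_pressureSourceBil (n := 0) (by exact_mod_cast hU'2) (by exact_mod_cast hU2 s)).continuous
  have hc2 : Continuous (pressureSourceBil (U s) (U' s)) :=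
    (contDiff_pressureSourceBil (n := 0) (by exact_mod_cast hU2 s) (by exact_mod_cast hU'2)).continuous
  have hi1 : Integrable fun z => newtonNear r₀ r₁ z * pressureSourceBil (U' s) (U s) (x - z) :=
    integrable_smul_comp_sub (integrable_newtonNear h₀ h₁) (fun z hz => newtonNear_eq_zero h₀ h₁ hz.le) hc1 x
  have hi2 : Integrable fun z => newtonNear r₀ r₁ z * pressureSourceBil (U s) (U' s) (x - z) :=
    integrable_smul_comp_sub (integrable_newtonNear h₀ h₁) (fun z hz => newtonNear_eq_zero h₀ h₁ hz.le) hc2 x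
  have hF'_int : Integrable (F' s) := by
    refine (hi1.add hi2).congr (Eventually.of_forall fun z => ?_)
    simp only [hF', Pi.add_apply, mul_add]
  have h_bound : ∀ᵐ z : EuclideanSpace ℝ (Fin 3) ∂volume, ∀ σ ∈ ball s 1,
      ‖F' σ z‖ ≤ |newtonNear r₀ r₁ z| * B := by
    refine Eventually.of_forall fun z σ _ => ?_
    rw [hF', Real.norm_eq_abs, abs_mul]
    exact mul_le_mul_of_nonneg_left (hB σ (x - z)) (abs_nonneg _)
  have hbi : Integrable fun z => |newtonNear r₀ r₁ z| * B := (integrable_newtonNear h₀ h₁).abs.mul_const _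
  have h_diff : ∀ᵐ z : EuclideanSpace ℝ (Fin 3) ∂volume, ∀ σ ∈ ball s 1,
      HasDerivAt (fun τ => F τ z) (F' σ z) σ := by
    refine Eventually.of_forall fun z σ _ => ?_
    simp only [hF, hF']
    exact (hsrc σ (x - z)).const_mul (newtonNear r₀ r₁ z)
  have hmain := (hasDerivAt_integral_of_dominated_loc_of_deriv_le (ball_mem_nhds s one_pos)
    (Eventually.of_forall fun σ => (hF_int σ).aestronglyMeasurable) (hF_int s)
    hF'_int.aestronglyMeasurable h_bound hbi h_diff).2
  have e : (∫ z, F' s z) =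
      nearPotentialBil r₀ r₁ (U' s) (U s) x + nearPotentialBil r₀ r₁ (U s) (U' s) x := by
    unfold nearPotentialBil
    rw [← integral_add hi1 hi2]
    refine integral_congr_ae (Eventually.of_forall fun z => ?_)
    simp only [hF', mul_add]
  rw [← e]
  exact hmain

/-- **The bilinear source in terms of the 2-jets**: for `v, w ∈ C²`,
`G[v,w](y) = tr( D²w(y)(·)(v y) + Dw(y)∘Dv(y) + (tr Dv(y))·Dw(y) + (tr∘D²v(y)) ⊗ w(y) )` — the
derivative of `(v·∇)w + (div v) w` at `y`, traced. [folklore] -/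
private theorem pressureSourceBil_eq_jet {v w : EuclideanSpace ℝ (Fin 3) → EuclideanSpace ℝ (Fin 3)}
    (hv : ContDiff ℝ 2 v) (hw : ContDiff ℝ 2 w) (y : EuclideanSpace ℝ (Fin 3)) :
    pressureSourceBil v w y =
      (traceCLM : ((EuclideanSpace ℝ (Fin 3)) →L[ℝ] (EuclideanSpace ℝ (Fin 3))) →L[ℝ] ℝ)
        ((fderiv ℝ w y).comp (fderiv ℝ v y) + (fderiv ℝ (fderiv ℝ w) y).flip (v y) +
          ((traceCLM : ((EuclideanSpace ℝ (Fin 3)) →L[ℝ] (EuclideanSpace ℝ (Fin 3))) →L[ℝ] ℝ) (fderiv ℝ v y) • fderiv ℝ w y +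
            ((traceCLM : ((EuclideanSpace ℝ (Fin 3)) →L[ℝ] (EuclideanSpace ℝ (Fin 3))) →L[ℝ] ℝ).comp (fderiv ℝ (fderiv ℝ v) y)).smulRight (w y))) := by
  have hvd : Differentiable ℝ v := hv.differentiable (by norm_num)
  have hwd : Differentiable ℝ w := hw.differentiable (by norm_num)
  have hDvd : Differentiable ℝ (fderiv ℝ v) := (hv.fderiv_right (m := 1) (by norm_num)).differentiable one_ne_zero
  have hDwd : Differentiable ℝ (fderiv ℝ w) := (hw.fderiv_right (m := 1) (by norm_num)).differentiable one_ne_zero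
  set tr : ((EuclideanSpace ℝ (Fin 3)) →L[ℝ] (EuclideanSpace ℝ (Fin 3))) →L[ℝ] ℝ := traceCLM with htr
  -- the inner field and its derivative at `y`
  have d1 : HasFDerivAt (fun z => fderiv ℝ w z (v z))
      ((fderiv ℝ w y).comp (fderiv ℝ v y) + (fderiv ℝ (fderiv ℝ w) y).flip (v y)) y :=
    (hDwd y).hasFDerivAt.clm_apply (hvd y).hasFDerivAt
  have dc : HasFDerivAt (fun z => tr (fderiv ℝ v z)) (tr.comp (fderiv ℝ (fderiv ℝ v) y)) y :=
    tr.hasFDerivAt.comp y (hDvd y).hasFDerivAt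
  have d2 : HasFDerivAt (fun z => tr (fderiv ℝ v z) • w z)
      (tr (fderiv ℝ v y) • fderiv ℝ w y + (tr.comp (fderiv ℝ (fderiv ℝ v) y)).smulRight (w y)) y :=
    dc.smul (hwd y).hasFDerivAt
  have d12 : HasFDerivAt (fun z => fderiv ℝ w z (v z) + tr (fderiv ℝ v z) • w z)
      ((fderiv ℝ w y).comp (fderiv ℝ v y) + (fderiv ℝ (fderiv ℝ w) y).flip (v y) +
        (tr (fderiv ℝ v y) • fderiv ℝ w y + (tr.comp (fderiv ℝ (fderiv ℝ v) y)).smulRight (w y))) y :=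
    d1.add d2
  have eW : (fun z => convect v w z + VectorCalculus.divergence v z • w z) =
      fun z => fderiv ℝ w z (v z) + tr (fderiv ℝ v z) • w z := by
    funext z; rw [convect_apply, divergence_eq_traceCLM, htr]
  unfold pressureSourceBil
  rw [eW, divergence_eq_traceCLM, d12.fderiv, htr]

/-- `flipₗᵢ T = T.flip`. [folklore] -/
private theorem flipₗᵢ_apply_eq
    (T : EuclideanSpace ℝ (Fin 3) →L[ℝ] EuclideanSpace ℝ (Fin 3) →L[ℝ] EuclideanSpace ℝ (Fin 3)) :
    ContinuousLinearMap.flipₗᵢ ℝ (EuclideanSpace ℝ (Fin 3)) (EuclideanSpace ℝ (Fin 3))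
      (EuclideanSpace ℝ (Fin 3)) T = T.flip := rfl

/-- `smulRightL c f = c.smulRight f`. [folklore] -/
private theorem smulRightL_eq_smulRight (c : EuclideanSpace ℝ (Fin 3) →L[ℝ] ℝ) (f : EuclideanSpace ℝ (Fin 3)) :
    ContinuousLinearMap.smulRightL ℝ (EuclideanSpace ℝ (Fin 3)) (EuclideanSpace ℝ (Fin 3)) c f =
      c.smulRight f := by
  ext x
  simp [ContinuousLinearMap.smulRightL_apply_apply, ContinuousLinearMap.smulRight_apply]

/-- **From the `σ`-derivatives of the 2-jet to the `σ`-derivative of the source.** If at the point `y`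
the curves `σ ↦ U(σ)(y)`, `σ ↦ DU(σ)(y)`, `σ ↦ D²U(σ)(y)` have derivatives `U'(y)`, `DU'(y)`, `D²U'(y)`
at `σ` (as they do for a jointly smooth profile, with `U' = ∂ₛU(·,σ)`), then `σ ↦ G[U(σ)](y)` has
derivative `G[U',U(σ)](y) + G[U(σ),U'](y)` at `σ` (the source is a quadratic polynomial in the 2-jet;
product rules). [folklore] -/
private theorem hasDerivAt_pressureSource_of_jet
    {U : ℝ → EuclideanSpace ℝ (Fin 3) → EuclideanSpace ℝ (Fin 3)}
    {U' : EuclideanSpace ℝ (Fin 3) → EuclideanSpace ℝ (Fin 3)} {σ : ℝ}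
    (hU2 : ∀ τ, ContDiff ℝ 2 (U τ)) (hU'2 : ContDiff ℝ 2 U') (y : EuclideanSpace ℝ (Fin 3))
    (h0 : HasDerivAt (fun τ => U τ y) (U' y) σ)
    (h1 : HasDerivAt (fun τ => fderiv ℝ (U τ) y) (fderiv ℝ U' y) σ)
    (h2 : HasDerivAt (fun τ => fderiv ℝ (fderiv ℝ (U τ)) y) (fderiv ℝ (fderiv ℝ U') y) σ) :
    HasDerivAt (fun τ => pressureSource (U τ) y)
      (pressureSourceBil U' (U σ) y + pressureSourceBil (U σ) U' y) σ := by
  set tr : ((EuclideanSpace ℝ (Fin 3)) →L[ℝ] (EuclideanSpace ℝ (Fin 3))) →L[ℝ] ℝ := traceCLM with htr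
  set SM := ContinuousLinearMap.lsmul ℝ ℝ
    (E := (EuclideanSpace ℝ (Fin 3)) →L[ℝ] (EuclideanSpace ℝ (Fin 3))) with hSM
  set FL := (ContinuousLinearMap.flipₗᵢ ℝ (EuclideanSpace ℝ (Fin 3)) (EuclideanSpace ℝ (Fin 3))
    (EuclideanSpace ℝ (Fin 3))).toContinuousLinearEquiv with hFL
  set SR := ContinuousLinearMap.smulRightL ℝ (EuclideanSpace ℝ (Fin 3)) (EuclideanSpace ℝ (Fin 3)) with hSR
  set CL := (ContinuousLinearMap.compL ℝ (EuclideanSpace ℝ (Fin 3))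
      ((EuclideanSpace ℝ (Fin 3)) →L[ℝ] (EuclideanSpace ℝ (Fin 3))) ℝ) tr with hCL
  -- the jet expression of the source along the family, through the bundled bilinear maps
  have ejet : (fun τ => pressureSource (U τ) y) = tr ∘ fun τ =>
      (fderiv ℝ (U τ) y).comp (fderiv ℝ (U τ) y) + (FL (fderiv ℝ (fderiv ℝ (U τ)) y)) (U τ y) +
        ((SM (tr (fderiv ℝ (U τ) y))) (fderiv ℝ (U τ) y) + (SR (CL (fderiv ℝ (fderiv ℝ (U τ)) y))) (U τ y)) := by
    funext τ
    rw [← pressureSourceBil_self, pressureSourceBil_eq_jet (hU2 τ) (hU2 τ) y, htr, Function.comp_apply,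
      hFL, LinearIsometryEquiv.coe_toContinuousLinearEquiv, flipₗᵢ_apply_eq, hSM,
      ContinuousLinearMap.lsmul_apply, hSR, smulRightL_eq_smulRight, hCL, ContinuousLinearMap.compL_apply]
  rw [ejet]
  -- derivatives of the four pieces
  have dcomp := h1.clm_comp h1
  have dflipc : HasDerivAt (fun τ => FL (fderiv ℝ (fderiv ℝ (U τ)) y)) (FL (fderiv ℝ (fderiv ℝ U') y)) σ :=
    FL.hasFDerivAt.comp_hasDerivAt σ h2
  have dflip := dflipc.clm_apply h0
  have dtr : HasDerivAt (fun τ => tr (fderiv ℝ (U τ) y)) (tr (fderiv ℝ U' y)) σ :=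
    tr.hasFDerivAt.comp_hasDerivAt σ h1
  have dsmulc : HasDerivAt (fun τ => SM (tr (fderiv ℝ (U τ) y))) (SM (tr (fderiv ℝ U' y))) σ :=
    SM.hasFDerivAt.comp_hasDerivAt σ dtr
  have dsmul := dsmulc.clm_apply h1
  have dtrc : HasDerivAt (fun τ => CL (fderiv ℝ (fderiv ℝ (U τ)) y)) (CL (fderiv ℝ (fderiv ℝ U') y)) σ :=
    CL.hasFDerivAt.comp_hasDerivAt σ h2
  have dsrc : HasDerivAt (fun τ => SR (CL (fderiv ℝ (fderiv ℝ (U τ)) y))) (SR (CL (fderiv ℝ (fderiv ℝ U') y))) σ :=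
    SR.hasFDerivAt.comp_hasDerivAt σ dtrc
  have dsr := dsrc.clm_apply h0
  have dsum := (dcomp.add dflip).add (dsmul.add dsr)
  have dall := tr.hasFDerivAt.comp_hasDerivAt σ dsum
  refine dall.congr_deriv ?_
  rw [pressureSourceBil_eq_jet hU'2 (hU2 σ) y, pressureSourceBil_eq_jet (hU2 σ) hU'2 y, ← htr]
  simp only [hFL, hSM, hSR, hCL, LinearIsometryEquiv.coe_toContinuousLinearEquiv, flipₗᵢ_apply_eq,
    ContinuousLinearMap.lsmul_apply, smulRightL_eq_smulRight, ContinuousLinearMap.compL_apply, map_add]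
  ring

/-- `∂ₛQ[U(·,s)] = 2Qˢ[∂ₛU, U]` given the `σ`-derivative of the source (intermediate form). [folklore] -/
private theorem hasDerivAt_pressurePotential_family_of_source
    {U U' : ℝ → EuclideanSpace ℝ (Fin 3) → EuclideanSpace ℝ (Fin 3)} {C D B : ℝ} {s : ℝ}
    (hU2 : ∀ σ, ContDiff ℝ 2 (U σ)) (hU'2 : ContDiff ℝ 2 (U' s))
    (hU : ∀ σ y, ‖U σ y‖ ≤ C / (1 + ‖y‖)) (hU' : ∀ σ y, ‖U' σ y‖ ≤ D / (1 + ‖y‖))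
    (hd : ∀ σ y, HasDerivAt (fun τ => U τ y) (U' σ y) σ)
    (hsrc : ∀ σ y, HasDerivAt (fun τ => pressureSource (U τ) y)
      (pressureSourceBil (U' σ) (U σ) y + pressureSourceBil (U σ) (U' σ) y) σ)
    (hB : ∀ σ y, |pressureSourceBil (U' σ) (U σ) y + pressureSourceBil (U σ) (U' σ) y| ≤ B)
    (x : EuclideanSpace ℝ (Fin 3)) :
    HasDerivAt (fun σ => pressurePotential (U σ) x) (2 * pressurePotentialSym (U' s) (U s) x) s := by
  have hn := hasDerivAt_nearPotential_family zero_le_one one_lt_two hU2 hU'2 hsrc hB x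
  have hf := hasDerivAt_farPotential_family one_pos one_lt_two (fun σ => (hU2 σ).continuous)
    hU'2.continuous hU hU' hd x
  have h := hn.neg.sub hf
  have e : -(nearPotentialBil 1 2 (U' s) (U s) x + nearPotentialBil 1 2 (U s) (U' s) x) -
      (farPotentialBil 1 2 (U' s) (U s) x + farPotentialBil 1 2 (U s) (U' s) x) =
      2 * pressurePotentialSym (U' s) (U s) x := by
    simp only [pressurePotentialSym, pressurePotentialBil]
    ring
  rw [← e]
  exact h

/-- **Sup bound for the polarised source from sup bounds of the 2-jets**:
`|G[v,w](y)| ≤ 2‖tr‖(1+‖tr‖) K_v K_w` when `‖v(y)‖, ‖Dv(y)‖, ‖D²v(y)‖ ≤ K_v` and likewise for `w`.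
[folklore] -/
private theorem abs_pressureSourceBil_le_of_jets {v w : EuclideanSpace ℝ (Fin 3) → EuclideanSpace ℝ (Fin 3)}
    (hv : ContDiff ℝ 2 v) (hw : ContDiff ℝ 2 w) {Kv Kw : ℝ} (y : EuclideanSpace ℝ (Fin 3))
    (hv0 : ‖v y‖ ≤ Kv) (hv1 : ‖fderiv ℝ v y‖ ≤ Kv) (hv2 : ‖fderiv ℝ (fderiv ℝ v) y‖ ≤ Kv)
    (hw0 : ‖w y‖ ≤ Kw) (hw1 : ‖fderiv ℝ w y‖ ≤ Kw) (hw2 : ‖fderiv ℝ (fderiv ℝ w) y‖ ≤ Kw) :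
    |pressureSourceBil v w y| ≤
      2 * ‖(traceCLM : ((EuclideanSpace ℝ (Fin 3)) →L[ℝ] (EuclideanSpace ℝ (Fin 3))) →L[ℝ] ℝ)‖ * (1 + ‖(traceCLM : ((EuclideanSpace ℝ (Fin 3)) →L[ℝ] (EuclideanSpace ℝ (Fin 3))) →L[ℝ] ℝ)‖) * Kv * Kw := by
  set T : ℝ := ‖(traceCLM : ((EuclideanSpace ℝ (Fin 3)) →L[ℝ] (EuclideanSpace ℝ (Fin 3))) →L[ℝ] ℝ)‖ with hT
  have hT0 : 0 ≤ T := norm_nonneg _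
  have hKv : 0 ≤ Kv := (norm_nonneg _).trans hv0
  have hKw : 0 ≤ Kw := (norm_nonneg _).trans hw0
  rw [pressureSourceBil_eq_jet hv hw y, ← Real.norm_eq_abs]
  refine (ContinuousLinearMap.le_opNorm _ _).trans ?_
  rw [← hT]
  have n1 : ‖(fderiv ℝ w y).comp (fderiv ℝ v y)‖ ≤ Kw * Kv :=
    (ContinuousLinearMap.opNorm_comp_le _ _).trans (mul_le_mul hw1 hv1 (norm_nonneg _) hKw)
  have n2 : ‖(fderiv ℝ (fderiv ℝ w) y).flip (v y)‖ ≤ Kw * Kv := by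
    calc ‖(fderiv ℝ (fderiv ℝ w) y).flip (v y)‖ ≤ ‖(fderiv ℝ (fderiv ℝ w) y).flip‖ * ‖v y‖ :=
          ContinuousLinearMap.le_opNorm _ _
      _ = ‖fderiv ℝ (fderiv ℝ w) y‖ * ‖v y‖ := by rw [ContinuousLinearMap.opNorm_flip]
      _ ≤ Kw * Kv := mul_le_mul hw2 hv0 (norm_nonneg _) hKw
  have n3 : ‖(traceCLM : ((EuclideanSpace ℝ (Fin 3)) →L[ℝ] (EuclideanSpace ℝ (Fin 3))) →L[ℝ] ℝ) (fderiv ℝ v y) • fderiv ℝ w y‖ ≤ T * Kv * Kw := by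
    rw [norm_smul]
    calc ‖(traceCLM : ((EuclideanSpace ℝ (Fin 3)) →L[ℝ] (EuclideanSpace ℝ (Fin 3))) →L[ℝ] ℝ) (fderiv ℝ v y)‖ * ‖fderiv ℝ w y‖ ≤ (T * ‖fderiv ℝ v y‖) * ‖fderiv ℝ w y‖ :=
          mul_le_mul_of_nonneg_right (ContinuousLinearMap.le_opNorm _ _) (norm_nonneg _)
      _ ≤ (T * Kv) * Kw := mul_le_mul (mul_le_mul_of_nonneg_left hv1 hT0) hw1 (norm_nonneg _) (by positivity)
      _ = T * Kv * Kw := by ring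
  have n4 : ‖((traceCLM : ((EuclideanSpace ℝ (Fin 3)) →L[ℝ] (EuclideanSpace ℝ (Fin 3))) →L[ℝ] ℝ).comp (fderiv ℝ (fderiv ℝ v) y)).smulRight (w y)‖ ≤ T * Kv * Kw := by
    rw [ContinuousLinearMap.norm_smulRight_apply]
    calc ‖(traceCLM : ((EuclideanSpace ℝ (Fin 3)) →L[ℝ] (EuclideanSpace ℝ (Fin 3))) →L[ℝ] ℝ).comp (fderiv ℝ (fderiv ℝ v) y)‖ * ‖w y‖ ≤ (T * ‖fderiv ℝ (fderiv ℝ v) y‖) * ‖w y‖ :=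
          mul_le_mul_of_nonneg_right (ContinuousLinearMap.opNorm_comp_le _ _) (norm_nonneg _)
      _ ≤ (T * Kv) * Kw := mul_le_mul (mul_le_mul_of_nonneg_left hv2 hT0) hw0 (norm_nonneg _) (by positivity)
      _ = T * Kv * Kw := by ring
  have hsum : ‖(fderiv ℝ w y).comp (fderiv ℝ v y) + (fderiv ℝ (fderiv ℝ w) y).flip (v y) +
      ((traceCLM : ((EuclideanSpace ℝ (Fin 3)) →L[ℝ] (EuclideanSpace ℝ (Fin 3))) →L[ℝ] ℝ) (fderiv ℝ v y) • fderiv ℝ w y + ((traceCLM : ((EuclideanSpace ℝ (Fin 3)) →L[ℝ] (EuclideanSpace ℝ (Fin 3))) →L[ℝ] ℝ).comp (fderiv ℝ (fderiv ℝ v) y)).smulRight (w y))‖ ≤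
      Kw * Kv + Kw * Kv + (T * Kv * Kw + T * Kv * Kw) :=
    (norm_add_le _ _).trans (add_le_add ((norm_add_le _ _).trans (add_le_add n1 n2))
      ((norm_add_le _ _).trans (add_le_add n3 n4)))
  calc T * ‖(fderiv ℝ w y).comp (fderiv ℝ v y) + (fderiv ℝ (fderiv ℝ w) y).flip (v y) +
        ((traceCLM : ((EuclideanSpace ℝ (Fin 3)) →L[ℝ] (EuclideanSpace ℝ (Fin 3))) →L[ℝ] ℝ) (fderiv ℝ v y) • fderiv ℝ w y + ((traceCLM : ((EuclideanSpace ℝ (Fin 3)) →L[ℝ] (EuclideanSpace ℝ (Fin 3))) →L[ℝ] ℝ).comp (fderiv ℝ (fderiv ℝ v) y)).smulRight (w y))‖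
      ≤ T * (Kw * Kv + Kw * Kv + (T * Kv * Kw + T * Kv * Kw)) := mul_le_mul_of_nonneg_left hsum hT0
    _ = 2 * T * (1 + T) * Kv * Kw := by ring

/-- **`∂ₛQ[U(·,s)] = 2Qˢ[∂ₛU, U]` — the pressure term of the `s`-differentiated profile equation
(1.14a)** (Lemma 8.1, proof, p. 28: "by applying `∂ₛ` to (1.14a)", with `P = RᵢRⱼ(UᵢUⱼ)` a quadratic
form in `U`). For a family of `C²` fields `U(σ)` with `(1+|y|)|U(σ)(y)| ≤ C`, differentiable in `σ`
pointwise with derivative `U'(σ)`, `(1+|y|)|U'(σ)(y)| ≤ D` (uniformly in `σ`), whose quadratic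
source `∂ᵢ∂ⱼ(UᵢUⱼ)` is handled through the 2-jets: if at every `y` the curves `σ ↦ U(σ)(y), DU(σ)(y), D²U(σ)(y)` have
derivatives `U'(σ)(y), DU'(σ)(y), D²U'(σ)(y)` (as for a jointly smooth profile with `U' = ∂ₛU`) and
the 2-jets of `U(σ)`, `U'(σ)` are bounded uniformly in `σ`, then `σ ↦ Q[U(σ)](x)` is differentiable
at `s` with derivative `2Qˢ[U'(s), U(s)](x)` (the source is a quadratic polynomial in the 2-jet;
differentiation under the near and far integrals).
[cite: PineauVicol2026, Lemma 8.1, proof (p. 28); Lemma 2.1, proof (p. 10)] -/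
theorem hasDerivAt_pressurePotential_family
    {U U' : ℝ → EuclideanSpace ℝ (Fin 3) → EuclideanSpace ℝ (Fin 3)} {C D K K' : ℝ} {s : ℝ}
    (hU2 : ∀ σ, ContDiff ℝ 2 (U σ)) (hU'2 : ∀ σ, ContDiff ℝ 2 (U' σ))
    (hU : ∀ σ y, ‖U σ y‖ ≤ C / (1 + ‖y‖)) (hU' : ∀ σ y, ‖U' σ y‖ ≤ D / (1 + ‖y‖))
    (hK : ∀ σ y, ‖U σ y‖ ≤ K ∧ ‖fderiv ℝ (U σ) y‖ ≤ K ∧ ‖fderiv ℝ (fderiv ℝ (U σ)) y‖ ≤ K)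
    (hK' : ∀ σ y, ‖U' σ y‖ ≤ K' ∧ ‖fderiv ℝ (U' σ) y‖ ≤ K' ∧ ‖fderiv ℝ (fderiv ℝ (U' σ)) y‖ ≤ K')
    (h0 : ∀ σ y, HasDerivAt (fun τ => U τ y) (U' σ y) σ)
    (h1 : ∀ σ y, HasDerivAt (fun τ => fderiv ℝ (U τ) y) (fderiv ℝ (U' σ) y) σ)
    (h2 : ∀ σ y, HasDerivAt (fun τ => fderiv ℝ (fderiv ℝ (U τ)) y) (fderiv ℝ (fderiv ℝ (U' σ)) y) σ)
    (x : EuclideanSpace ℝ (Fin 3)) :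
    HasDerivAt (fun σ => pressurePotential (U σ) x) (2 * pressurePotentialSym (U' s) (U s) x) s := by
  set T : ℝ := ‖(traceCLM : ((EuclideanSpace ℝ (Fin 3)) →L[ℝ] (EuclideanSpace ℝ (Fin 3))) →L[ℝ] ℝ)‖ with hT
  have hsrc : ∀ σ y, HasDerivAt (fun τ => pressureSource (U τ) y)
      (pressureSourceBil (U' σ) (U σ) y + pressureSourceBil (U σ) (U' σ) y) σ :=
    fun σ y => hasDerivAt_pressureSource_of_jet hU2 (hU'2 σ) y (h0 σ y) (h1 σ y) (h2 σ y)
  have hB : ∀ σ y, |pressureSourceBil (U' σ) (U σ) y + pressureSourceBil (U σ) (U' σ) y| ≤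
      2 * T * (1 + T) * K' * K + 2 * T * (1 + T) * K * K' := by
    intro σ y
    obtain ⟨a0, a1, a2⟩ := hK σ y
    obtain ⟨b0, b1, b2⟩ := hK' σ y
    have e1 := abs_pressureSourceBil_le_of_jets (hU'2 σ) (hU2 σ) y b0 b1 b2 a0 a1 a2
    have e2 := abs_pressureSourceBil_le_of_jets (hU2 σ) (hU'2 σ) y a0 a1 a2 b0 b1 b2
    rw [← hT] at e1 e2
    exact (abs_add_le _ _).trans (add_le_add e1 e2)
  exact hasDerivAt_pressurePotential_family_of_source hU2 (hU'2 s) hU hU' h0 hsrc hB x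

/-! ## The jointly smooth case: `∂ₛQ[U(·,s)] = 2Qˢ[∂ₛU, U]` for a `C^∞` space–time profile -/

/-- **`∂ₛP = 2RᵢRⱼ((∂ₛU)ᵢUⱼ)` for a jointly smooth profile** (Lemma 8.1, proof, p. 28: the pressure
term of `∂ₛ` applied to (1.14a), `P = RᵢRⱼ(UᵢUⱼ)`). If `U : ℝ → ℝ³ → ℝ³` is jointly `C^∞`
(`IsSmoothSpaceTimeOn univ U`), obeys `(1+|y|)|U(σ,y)| ≤ C` and `(1+|y|)|∂ₛU(σ,y)| ≤ D`, and the
2-jets in `y` of `U(σ,·)` and of `∂ₛU(σ,·)` are bounded uniformly in `σ`, then for every `x` the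
pressure `σ ↦ Q[U(σ,·)](x)` is differentiable with derivative `2Qˢ[∂ₛU(s,·), U(s,·)](x)`, where
`∂ₛU(σ,y) = deriv (U · y) σ`. The jet-wise `σ`-derivatives required by
`hasDerivAt_pressurePotential_family` are supplied by the exchange of `∂ₛ` and `D_y` for jointly
smooth fields (Schwarz; the tree's `IsSmoothSpaceTimeOn.hasDerivAt_fderiv_slice_clm`).
[cite: PineauVicol2026, Lemma 8.1, proof (p. 28); Lemma 2.1, proof (p. 10)] -/
theorem hasDerivAt_pressurePotential_of_isSmoothSpaceTimeOn
    {U : ℝ → EuclideanSpace ℝ (Fin 3) → EuclideanSpace ℝ (Fin 3)} {C D K K' : ℝ} {s : ℝ}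
    (hU : IsSmoothSpaceTimeOn Set.univ U)
    (hC : ∀ σ y, ‖U σ y‖ ≤ C / (1 + ‖y‖))
    (hD : ∀ σ y, ‖deriv (fun τ => U τ y) σ‖ ≤ D / (1 + ‖y‖))
    (hK : ∀ σ y, ‖U σ y‖ ≤ K ∧ ‖fderiv ℝ (U σ) y‖ ≤ K ∧ ‖fderiv ℝ (fderiv ℝ (U σ)) y‖ ≤ K)
    (hK' : ∀ σ y, ‖deriv (fun τ => U τ y) σ‖ ≤ K' ∧
      ‖fderiv ℝ (fun y => deriv (fun τ => U τ y) σ) y‖ ≤ K' ∧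
      ‖fderiv ℝ (fderiv ℝ (fun y => deriv (fun τ => U τ y) σ)) y‖ ≤ K')
    (x : EuclideanSpace ℝ (Fin 3)) :
    HasDerivAt (fun σ => pressurePotential (U σ) x)
      (2 * pressurePotentialSym (fun y => deriv (fun τ => U τ y) s) (U s) x) s := by
  -- the time-derivative family `U'(σ)(y) = ∂ₛU(σ, y)` and the space-derivative family
  set U' : ℝ → EuclideanSpace ℝ (Fin 3) → EuclideanSpace ℝ (Fin 3) :=
    fun σ y => deriv (fun τ => U τ y) σ with hU'def
  have hU' : IsSmoothSpaceTimeOn Set.univ U' := hU.isSmoothSpaceTimeOn_deriv isOpen_univ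
  have hU₁ : IsSmoothSpaceTimeOn Set.univ fun σ y => fderiv ℝ (U σ) y :=
    hU.isSmoothSpaceTimeOn_fderiv_of_isOpen isOpen_univ
  have hU2 : ∀ σ, ContDiff ℝ 2 (U σ) := fun σ =>
    (hU.contDiff_slice (Set.mem_univ σ)).of_le (by norm_cast)
  have hU'2 : ∀ σ, ContDiff ℝ 2 (U' σ) := fun σ =>
    (hU'.contDiff_slice (Set.mem_univ σ)).of_le (by norm_cast)
  -- jet-wise `σ`-derivatives (exchange of `∂ₛ` and `D_y`)
  have h0 : ∀ σ y, HasDerivAt (fun τ => U τ y) (U' σ y) σ := fun σ y =>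
    hU.hasDerivAt_timeLine isOpen_univ (Set.mem_univ σ) y
  have h1 : ∀ σ y, HasDerivAt (fun τ => fderiv ℝ (U τ) y) (fderiv ℝ (U' σ) y) σ := fun σ y =>
    hU.hasDerivAt_fderiv_slice_clm isOpen_univ (Set.mem_univ σ) y
  have h2 : ∀ σ y, HasDerivAt (fun τ => fderiv ℝ (fderiv ℝ (U τ)) y)
      (fderiv ℝ (fderiv ℝ (U' σ)) y) σ := by
    intro σ y
    have h := hU₁.hasDerivAt_fderiv_slice_clm isOpen_univ (Set.mem_univ σ) y
    have heq : (fun y => deriv (fun τ => fderiv ℝ (U τ) y) σ) = fderiv ℝ (U' σ) :=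
      funext fun y => (h1 σ y).deriv
    rw [heq] at h
    exact h
  exact hasDerivAt_pressurePotential_family hU2 hU'2 hC hD hK hK' h0 h1 h2 x

/-! ## `∂ₛ` applied to the profile equation (1.14a) with `P = Q[U(s)]`, for a jointly smooth family

Lemma 8.1, proof (p. 28): "by applying `∂ₛ` to (1.14a) and using the above bounds …". For a jointly
smooth family `U(σ)` solving (1.14a) on every slice with the Calderón–Zygmund pressure
`P(σ) = Q[U(σ)]` and slice derivative `∂ₛU`, the `s`-differentiated equation — the hypothesis `heq`
of `norm_sliceDeriv2_le_of_dslice_equation` (`PineauVicolRDSSLargeAlpha`) — holds with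
`V = ∂ₛU(σ,·)`, `W = ∂ₛ²U(σ,·)` and `P′ = 2Qˢ[∂ₛU(σ,·), U(σ,·)]`. The exchange `∂ₛ∇P = ∇∂ₛP` is
obtained WITHOUT joint smoothness of the pressure: `∇P(σ,·)` is read off the equation (a jointly
continuous field with a jointly continuous `σ`-derivative), `∂ₛP = P′` pointwise
(`hasDerivAt_pressurePotential_of_isSmoothSpaceTimeOn`), and the fundamental theorem of calculus
along segments identifies `∇P′` with `∂ₛ∇P`. -/

section DSlice

/-- A field jointly smooth on all of space–time is jointly continuous. [folklore] -/
private theorem continuous_uncurry_of_smoothSpaceTime_univ_pv {F' : Type*}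
    [NormedAddCommGroup F'] [NormedSpace ℝ F'] {w : ℝ → EuclideanSpace ℝ (Fin 3) → F'}
    (h : IsSmoothSpaceTimeOn Set.univ w) : Continuous (uncurry w) := by
  have hc := ContDiffOn.continuousOn h
  rw [Set.univ_prod_univ] at hc
  exact continuousOn_univ.1 hc

/-- `Δf(y) = ∑ᵢ D²f(y)(bᵢ, bᵢ)` in the standard orthonormal basis (no regularity needed: both sides
are built from `fderiv`). [folklore] -/
private theorem laplacian_apply_eq_sum_fderiv2_pv (g : EuclideanSpace ℝ (Fin 3) → EuclideanSpace ℝ (Fin 3)) (y : EuclideanSpace ℝ (Fin 3)) :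
    (Δ g) y = ∑ i, fderiv ℝ (fderiv ℝ g) y (stdOrthonormalBasis ℝ (EuclideanSpace ℝ (Fin 3)) i)
      (stdOrthonormalBasis ℝ (EuclideanSpace ℝ (Fin 3)) i) := by
  rw [laplacian_eq_iteratedFDeriv_orthonormalBasis g (stdOrthonormalBasis ℝ (EuclideanSpace ℝ (Fin 3)))]
  exact Finset.sum_congr rfl fun i _ => by rw [iteratedFDeriv_two_apply]; rfl

/-- `∂ₛ` commutes with `Δ_y` along a family whose second space derivative at `y` has
`σ`-derivative `D²f′(y)`. [folklore] -/
private theorem hasDerivAt_laplacian_family {f : ℝ → EuclideanSpace ℝ (Fin 3) → EuclideanSpace ℝ (Fin 3)} {f' : EuclideanSpace ℝ (Fin 3) → EuclideanSpace ℝ (Fin 3)} {σ : ℝ} (y : EuclideanSpace ℝ (Fin 3))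
    (h2 : HasDerivAt (fun τ => fderiv ℝ (fderiv ℝ (f τ)) y) (fderiv ℝ (fderiv ℝ f') y) σ) :
    HasDerivAt (fun τ => (Δ (f τ)) y) ((Δ f') y) σ := by
  set b := stdOrthonormalBasis ℝ (EuclideanSpace ℝ (Fin 3)) with hb
  have hterm : ∀ i, HasDerivAt (fun τ => fderiv ℝ (fderiv ℝ (f τ)) y (b i) (b i))
      (fderiv ℝ (fderiv ℝ f') y (b i) (b i)) σ := by
    intro i
    have h := (h2.clm_apply (hasDerivAt_const σ (b i))).clm_apply (hasDerivAt_const σ (b i))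
    simpa using h
  have hsum := HasDerivAt.fun_sum (u := Finset.univ) fun i _ => hterm i
  have hfun : (fun τ => (Δ (f τ)) y) = fun τ => ∑ i, fderiv ℝ (fderiv ℝ (f τ)) y (b i) (b i) :=
    funext fun τ => laplacian_apply_eq_sum_fderiv2_pv (f τ) y
  rw [hfun, laplacian_apply_eq_sum_fderiv2_pv f' y]
  exact hsum

/-- **Exchange of `∂ₛ` and `∇` for a family of potentials known only slice-wise.** Let `P(τ)` be
differentiable slices with `∇P(τ)(y) = G(τ,y)`, `G` jointly continuous with a pointwise
`τ`-derivative `G′` that is jointly continuous; let `∂_τ P(τ)(y) = P′(τ)(y)` pointwise and let the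
slice `P′(σ)` be differentiable. Then `∇P′(σ)(y) = G′(σ,y)`: along the segment `y + te`,
`P(τ)(y+te) = P(τ)(y) + ∫₀ᵗ ⟪G(τ,y+se),e⟫ds`; differentiate in `τ` under the integral sign, then in
`t` (fundamental theorem of calculus). [folklore] -/
private theorem gradient_eq_of_hasDerivAt_family {P P' : ℝ → EuclideanSpace ℝ (Fin 3) → ℝ} {G G' : ℝ → EuclideanSpace ℝ (Fin 3) → EuclideanSpace ℝ (Fin 3)}
    {σ : ℝ} (hP : ∀ τ, Differentiable ℝ (P τ)) (hG : ∀ τ y, gradient (P τ) y = G τ y)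
    (hGc : Continuous (uncurry G)) (hG' : ∀ τ y, HasDerivAt (fun τ' => G τ' y) (G' τ y) τ)
    (hG'c : Continuous (uncurry G')) (hPd : ∀ τ y, HasDerivAt (fun τ' => P τ' y) (P' τ y) τ)
    (hP' : Differentiable ℝ (P' σ)) (y : EuclideanSpace ℝ (Fin 3)) : gradient (P' σ) y = G' σ y := by
  -- (1) directional derivatives of the slices: `DP(τ)(x) e = ⟪G(τ,x), e⟫`
  have hdir : ∀ τ x (e : EuclideanSpace ℝ (Fin 3)), fderiv ℝ (P τ) x e = ⟪G τ x, e⟫ := by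
    intro τ x e
    rw [← hG τ x, gradient, InnerProductSpace.toDual_symm_apply]
  -- continuity of the integrands along segments
  have hGl : ∀ τ (e : EuclideanSpace ℝ (Fin 3)), Continuous fun s : ℝ => ⟪G τ (y + s • e), e⟫ := fun τ e =>
    (hGc.comp (continuous_const.prodMk (continuous_const.add (continuous_id.smul continuous_const)))).inner
      continuous_const
  have hG'l : ∀ τ (e : EuclideanSpace ℝ (Fin 3)), Continuous fun s : ℝ => ⟪G' τ (y + s • e), e⟫ := fun τ e =>
    (hG'c.comp (continuous_const.prodMk (continuous_const.add (continuous_id.smul continuous_const)))).inner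
      continuous_const
  have hγ : ∀ (e : EuclideanSpace ℝ (Fin 3)) (s : ℝ), HasDerivAt (fun s : ℝ => y + s • e) e s := by
    intro e s
    simpa using ((hasDerivAt_id s).smul_const e).const_add y
  -- (2) along the segment: `s ↦ P(τ)(y + s e)` has derivative `⟪G(τ,y+se), e⟫`
  have hline : ∀ τ (e : EuclideanSpace ℝ (Fin 3)) (s : ℝ),
      HasDerivAt (fun s : ℝ => P τ (y + s • e)) ⟪G τ (y + s • e), e⟫ s := by
    intro τ e s
    have h := ((hP τ) (y + s • e)).hasFDerivAt.comp_hasDerivAt s (hγ e s)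
    rw [hdir] at h
    exact h
  -- (3) FTC: `P(τ)(y + t e) = P(τ)(y) + ∫₀ᵗ ⟪G(τ,y+se), e⟫ ds`
  have hftc : ∀ τ (e : EuclideanSpace ℝ (Fin 3)) (t : ℝ),
      P τ (y + t • e) = P τ y + ∫ s in (0:ℝ)..t, ⟪G τ (y + s • e), e⟫ := by
    intro τ e t
    rw [intervalIntegral.integral_eq_sub_of_hasDerivAt (fun s _ => hline τ e s)
      ((hGl τ e).intervalIntegrable _ _)]
    simp
  -- (4) derivative in `τ` of the integral at `σ` (dominated differentiation, continuous data)
  have hint : ∀ (e : EuclideanSpace ℝ (Fin 3)) (t : ℝ), HasDerivAt (fun τ => ∫ s in (0:ℝ)..t, ⟪G τ (y + s • e), e⟫)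
      (∫ s in (0:ℝ)..t, ⟪G' σ (y + s • e), e⟫) σ := by
    intro e t
    have hK : IsCompact (Metric.closedBall σ 1 ×ˢ Set.uIcc (0:ℝ) t) :=
      (isCompact_closedBall σ 1).prod isCompact_uIcc
    have hg'c : Continuous fun p : ℝ × ℝ => ⟪G' p.1 (y + p.2 • e), e⟫ :=
      (hG'c.comp (continuous_fst.prodMk (continuous_const.add (continuous_snd.smul
        continuous_const)))).inner continuous_const
    obtain ⟨M, hM⟩ := hK.exists_bound_of_continuousOn hg'c.continuousOn
    have h := intervalIntegral.hasDerivAt_integral_of_dominated_loc_of_deriv_le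
      (F := fun τ s => ⟪G τ (y + s • e), e⟫) (F' := fun τ s => ⟪G' τ (y + s • e), e⟫)
      (x₀ := σ) (a := 0) (b := t) (μ := volume) (bound := fun _ => M)
      (s := Metric.closedBall σ 1) (Metric.closedBall_mem_nhds σ one_pos)
      (Filter.Eventually.of_forall fun τ => (hGl τ e).aestronglyMeasurable)
      ((hGl σ e).intervalIntegrable _ _) (hG'l σ e).aestronglyMeasurable ?_
      intervalIntegrable_const ?_
    · exact h.2
    · refine Filter.Eventually.of_forall fun s hs τ hτ => ?_
      exact hM (τ, s) ⟨hτ, Set.uIoc_subset_uIcc hs⟩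
    · refine Filter.Eventually.of_forall fun s _ τ _ => ?_
      have h := (hG' τ (y + s • e)).inner ℝ (hasDerivAt_const τ e)
      simpa using h
  -- (5) uniqueness of the `τ`-derivative: `P′(σ)(y+te) = P′(σ)(y) + ∫₀ᵗ ⟪G′(σ,y+se), e⟫ ds`
  have hP'line : ∀ (e : EuclideanSpace ℝ (Fin 3)) (t : ℝ),
      P' σ (y + t • e) = P' σ y + ∫ s in (0:ℝ)..t, ⟪G' σ (y + s • e), e⟫ := by
    intro e t
    have h2 : HasDerivAt (fun τ => P τ (y + t • e))
        (P' σ y + ∫ s in (0:ℝ)..t, ⟪G' σ (y + s • e), e⟫) σ :=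
      ((hPd σ y).add (hint e t)).congr_of_eventuallyEq
        (Filter.Eventually.of_forall fun τ => hftc τ e t)
    exact (hPd σ (y + t • e)).unique h2
  -- (6) differentiate in `t` at `0`
  have key : ∀ e : EuclideanSpace ℝ (Fin 3), fderiv ℝ (P' σ) y e = ⟪G' σ y, e⟫ := by
    intro e
    have hI : HasDerivAt (fun t => ∫ s in (0:ℝ)..t, ⟪G' σ (y + s • e), e⟫)
        ⟪G' σ (y + (0:ℝ) • e), e⟫ 0 :=
      intervalIntegral.integral_hasDerivAt_right ((hG'l σ e).intervalIntegrable _ _)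
        ((hG'l σ e).stronglyMeasurableAtFilter _ _) (hG'l σ e).continuousAt
    have hA : HasDerivAt (fun t : ℝ => P' σ (y + t • e)) ⟪G' σ y, e⟫ 0 := by
      have h := (hasDerivAt_const (0:ℝ) (P' σ y)).add hI
      simp only [zero_smul, add_zero, zero_add] at h
      exact h.congr_of_eventuallyEq (Filter.Eventually.of_forall fun t => hP'line e t)
    have hB := ((hP' (y + (0:ℝ) • e)).hasFDerivAt).comp_hasDerivAt (0:ℝ) (hγ e 0)
    simp only [zero_smul, add_zero] at hB
    exact hB.unique hA
  -- (7) conclude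
  apply ext_inner_right ℝ
  intro e
  rw [gradient, InnerProductSpace.toDual_symm_apply]
  exact key e

/-- `∂ₛ` of the non-pressure part of (1.14a) at a point, from the jet-wise `σ`-derivatives:
`∂ₛ[∂ₛU + α𝓡U + ½U + ½DU[y] − ΔU + (U·∇)U] = ∂ₛV + α𝓡V + ½V + ½DV[y] − ΔV + (U·∇)V + (V·∇)U`.
[folklore] -/
private theorem hasDerivAt_rest {U V W : ℝ → EuclideanSpace ℝ (Fin 3) → EuclideanSpace ℝ (Fin 3)} {α τ : ℝ} (y : EuclideanSpace ℝ (Fin 3))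
    (h0 : HasDerivAt (fun τ' => U τ' y) (V τ y) τ) (h0' : HasDerivAt (fun τ' => V τ' y) (W τ y) τ)
    (h1 : HasDerivAt (fun τ' => fderiv ℝ (U τ') y) (fderiv ℝ (V τ) y) τ)
    (h2 : HasDerivAt (fun τ' => fderiv ℝ (fderiv ℝ (U τ')) y) (fderiv ℝ (fderiv ℝ (V τ)) y) τ) :
    HasDerivAt (fun τ' => -(V τ' y + (α • (rotGen (U τ' y) - fderiv ℝ (U τ') y (rotGen y)) +
        (1 / 2 : ℝ) • U τ' y + (1 / 2 : ℝ) • fderiv ℝ (U τ') y y - (Δ (U τ')) y +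
          convect (U τ') (U τ') y)))
      (-(W τ y + (α • (rotGen (V τ y) - fderiv ℝ (V τ) y (rotGen y)) +
        (1 / 2 : ℝ) • V τ y + (1 / 2 : ℝ) • fderiv ℝ (V τ) y y - (Δ (V τ)) y +
          (convect (U τ) (V τ) y + convect (V τ) (U τ) y)))) τ := by
  have hrot : HasDerivAt (fun τ' => rotGen (U τ' y)) (rotGen (V τ y)) τ := by
    have h := (rotGenL.hasFDerivAt).comp_hasDerivAt τ h0
    simpa only [Function.comp_def, rotGenL_apply] using h
  have hrot' : HasDerivAt (fun τ' => fderiv ℝ (U τ') y (rotGen y))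
      (fderiv ℝ (V τ) y (rotGen y)) τ := by
    simpa using h1.clm_apply (hasDerivAt_const τ (rotGen y))
  have hDy : HasDerivAt (fun τ' => fderiv ℝ (U τ') y y) (fderiv ℝ (V τ) y y) τ := by
    simpa using h1.clm_apply (hasDerivAt_const τ y)
  have hΔ := hasDerivAt_laplacian_family y h2
  have hconv : HasDerivAt (fun τ' => convect (U τ') (U τ') y)
      (convect (U τ) (V τ) y + convect (V τ) (U τ) y) τ := h1.clm_apply h0
  have hsum : HasDerivAt (fun τ' => V τ' y + (α • (rotGen (U τ' y) - fderiv ℝ (U τ') y (rotGen y)) +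
        (1 / 2 : ℝ) • U τ' y + (1 / 2 : ℝ) • fderiv ℝ (U τ') y y - (Δ (U τ')) y +
          convect (U τ') (U τ') y))
      (W τ y + (α • (rotGen (V τ y) - fderiv ℝ (V τ) y (rotGen y)) +
        (1 / 2 : ℝ) • V τ y + (1 / 2 : ℝ) • fderiv ℝ (V τ) y y - (Δ (V τ)) y +
          (convect (U τ) (V τ) y + convect (V τ) (U τ) y))) τ :=
    h0'.add ((((((hrot.sub hrot').const_smul α).add (h0.const_smul (1 / 2 : ℝ))).add
      (hDy.const_smul (1 / 2 : ℝ))).sub hΔ).add hconv)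
  exact hsum.neg

/-- Joint continuity of the non-pressure part of (1.14a) (or of its `s`-derivative): all terms are
space jets of jointly continuous families. [folklore] -/
private theorem continuous_rest {V X T : ℝ → EuclideanSpace ℝ (Fin 3) → EuclideanSpace ℝ (Fin 3)} (cV : Continuous (uncurry V))
    (cX : Continuous (uncurry X)) (cT : Continuous (uncurry T))
    (cV₁ : Continuous (uncurry fun τ y => fderiv ℝ (V τ) y))
    (cΔ : Continuous (uncurry fun τ y => (Δ (V τ)) y)) (α : ℝ) :
    Continuous (uncurry fun τ y => -(X τ y + (α • (rotGen (V τ y) - fderiv ℝ (V τ) y (rotGen y)) +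
      (1 / 2 : ℝ) • V τ y + (1 / 2 : ℝ) • fderiv ℝ (V τ) y y - (Δ (V τ)) y + T τ y))) := by
  have crot : Continuous fun p : ℝ × EuclideanSpace ℝ (Fin 3) => rotGen p.2 := by
    simpa only [Function.comp_def, rotGenL_apply] using rotGenL.continuous.comp continuous_snd
  have hrotV : Continuous fun p : ℝ × EuclideanSpace ℝ (Fin 3) => rotGen (V p.1 p.2) := by
    simpa only [Function.comp_def, rotGenL_apply, Function.uncurry] using rotGenL.continuous.comp cV
  have c1 : Continuous fun p : ℝ × EuclideanSpace ℝ (Fin 3) => fderiv ℝ (V p.1) p.2 (rotGen p.2) := cV₁.clm_apply crot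
  have c2 : Continuous fun p : ℝ × EuclideanSpace ℝ (Fin 3) => fderiv ℝ (V p.1) p.2 p.2 := cV₁.clm_apply continuous_snd
  have cV' : Continuous fun p : ℝ × EuclideanSpace ℝ (Fin 3) => V p.1 p.2 := cV
  have cX' : Continuous fun p : ℝ × EuclideanSpace ℝ (Fin 3) => X p.1 p.2 := cX
  have cT' : Continuous fun p : ℝ × EuclideanSpace ℝ (Fin 3) => T p.1 p.2 := cT
  have cΔ' : Continuous fun p : ℝ × EuclideanSpace ℝ (Fin 3) => (Δ (V p.1)) p.2 := cΔ
  have h : Continuous fun p : ℝ × EuclideanSpace ℝ (Fin 3) => -(X p.1 p.2 + (α • (rotGen (V p.1 p.2) -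
      fderiv ℝ (V p.1) p.2 (rotGen p.2)) + (1 / 2 : ℝ) • V p.1 p.2 +
        (1 / 2 : ℝ) • fderiv ℝ (V p.1) p.2 p.2 - (Δ (V p.1)) p.2 + T p.1 p.2)) :=
    (cX'.add ((((((hrotV.sub c1).const_smul α).add (cV'.const_smul (1 / 2 : ℝ))).add
      (c2.const_smul (1 / 2 : ℝ))).sub cΔ').add cT')).neg
  exact h

/-- Joint continuity of `(σ, y) ↦ Δ_y U(σ, y)` for a jointly smooth `U`. [folklore] -/
private theorem continuous_uncurry_laplacian {w : ℝ → EuclideanSpace ℝ (Fin 3) → EuclideanSpace ℝ (Fin 3)} (h : IsSmoothSpaceTimeOn Set.univ w) :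
    Continuous (uncurry fun τ y => (Δ (w τ)) y) := by
  have h₂ := continuous_uncurry_of_smoothSpaceTime_univ_pv
    ((h.isSmoothSpaceTimeOn_fderiv_of_isOpen isOpen_univ).isSmoothSpaceTimeOn_fderiv_of_isOpen
      isOpen_univ)
  have he : (uncurry fun τ y => (Δ (w τ)) y) = fun p : ℝ × EuclideanSpace ℝ (Fin 3) => ∑ i,
      (uncurry fun τ y => fderiv ℝ (fderiv ℝ (w τ)) y) p (stdOrthonormalBasis ℝ (EuclideanSpace ℝ (Fin 3)) i)
        (stdOrthonormalBasis ℝ (EuclideanSpace ℝ (Fin 3)) i) := by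
    funext p; exact laplacian_apply_eq_sum_fderiv2_pv (w p.1) p.2
  rw [he]
  exact continuous_finsetSum _ fun i _ => (h₂.clm_apply continuous_const).clm_apply continuous_const

/-- `y ↦ 2Qˢ[v,w](y)` is differentiable for `C^∞` fields of the decay class (polarisation
`4Qˢ[v,w] = Q[v+w] − Q[v−w]` and smoothness of `Q`). [folklore] -/
private theorem differentiable_two_mul_pressurePotentialSym {v w : EuclideanSpace ℝ (Fin 3) → EuclideanSpace ℝ (Fin 3)} (hv : ContDiff ℝ ∞ v)
    (hw : ContDiff ℝ ∞ w) {Cv Cw : ℝ} (hv0 : ∀ y, ‖v y‖ ≤ Cv / (1 + ‖y‖))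
    (hw0 : ∀ y, ‖w y‖ ≤ Cw / (1 + ‖y‖)) :
    Differentiable ℝ fun y => 2 * pressurePotentialSym v w y := by
  have hp : ContDiff ℝ ∞ (pressurePotential (v + w)) :=
    contDiff_pressurePotential_decay_top (hv.add hw) (C' := Cv + Cw) fun y => by
      rw [Pi.add_apply, add_div]
      exact (norm_add_le _ _).trans (add_le_add (hv0 y) (hw0 y))
  have hm : ContDiff ℝ ∞ (pressurePotential (v - w)) :=
    contDiff_pressurePotential_decay_top (hv.sub hw) (C' := Cv + Cw) fun y => by
      rw [Pi.sub_apply, add_div]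
      exact (norm_sub_le _ _).trans (add_le_add (hv0 y) (hw0 y))
  have he : (fun y => 2 * pressurePotentialSym v w y) =
      fun y => 2⁻¹ * (pressurePotential (v + w) y - pressurePotential (v - w) y) := by
    funext y
    rw [pressurePotential_add_sub (hv.of_le (by norm_cast)) (hw.of_le (by norm_cast)) hv0 hw0 y]
    ring
  rw [he]
  exact ((hp.sub hm).differentiable (by simp)).const_mul 2⁻¹

/-- **Pineau–Vicol 2026, Lemma 8.1, proof — `∂ₛ` applied to (1.14a) with `P = RᵢRⱼ(UᵢUⱼ)`, for a
jointly smooth family.** Let `U : ℝ → ℝ³ → ℝ³` be jointly `C^∞`, with `(1+|y|)|U| ≤ C`,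
`(1+|y|)|∂ₛU| ≤ D` and the 2-jets of `U(σ,·)`, `∂ₛU(σ,·)` bounded uniformly in `σ`, and suppose every
slice solves the profile equation (1.14a) with the Calderón–Zygmund pressure `Q[U(σ)]` and slice
derivative `∂ₛU`:
`α𝓡U + ½U + ½DU[y] − ΔU + (U·∇)U + ∇Q[U(σ)] + ∂ₛU = 0`. Then, with `V = ∂ₛU(σ,·)`, `W = ∂ₛ²U(σ,·)` and
`P′ = 2Qˢ[∂ₛU(σ,·), U(σ,·)]`, the `s`-differentiated equation
`α𝓡V + ½V + ½DV[y] − ΔV + (V·∇)U + (U·∇)V + ∇P′ + W = 0` holds on every slice — the hypothesis `heq`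
of `norm_sliceDeriv2_le_of_dslice_equation`. (`∂ₛ` commutes with `D_y`, `Δ_y` by Schwarz for the
jointly smooth `U`; `∂ₛQ[U(σ)] = 2Qˢ[∂ₛU, U]` by `hasDerivAt_pressurePotential_of_isSmoothSpaceTimeOn`;
`∂ₛ∇P = ∇∂ₛP` by `∇P` read off the equation and the fundamental theorem of calculus along segments.)
[cite: PineauVicol2026, Lemma 8.1, proof (p. 28); (1.14a) (p. 7)] -/
theorem dslice_equation_of_isSmoothSpaceTimeOn
    {U V W : ℝ → EuclideanSpace ℝ (Fin 3) → EuclideanSpace ℝ (Fin 3)} {α C D K K' : ℝ}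
    (hU : IsSmoothSpaceTimeOn Set.univ U)
    (hV : V = fun σ y => deriv (fun τ => U τ y) σ) (hW : W = fun σ y => deriv (fun τ => V τ y) σ)
    (hC : ∀ σ y, ‖U σ y‖ ≤ C / (1 + ‖y‖)) (hD : ∀ σ y, ‖V σ y‖ ≤ D / (1 + ‖y‖))
    (hK : ∀ σ y, ‖U σ y‖ ≤ K ∧ ‖fderiv ℝ (U σ) y‖ ≤ K ∧ ‖fderiv ℝ (fderiv ℝ (U σ)) y‖ ≤ K)
    (hK' : ∀ σ y, ‖V σ y‖ ≤ K' ∧ ‖fderiv ℝ (V σ) y‖ ≤ K' ∧ ‖fderiv ℝ (fderiv ℝ (V σ)) y‖ ≤ K')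
    (heq : ∀ σ y, α • (rotGen (U σ y) - fderiv ℝ (U σ) y (rotGen y)) + (1 / 2 : ℝ) • U σ y +
      (1 / 2 : ℝ) • fderiv ℝ (U σ) y y - (Δ (U σ)) y + convect (U σ) (U σ) y +
        gradient (pressurePotential (U σ)) y + V σ y = 0)
    (σ : ℝ) (y : EuclideanSpace ℝ (Fin 3)) :
    α • (rotGen (V σ y) - fderiv ℝ (V σ) y (rotGen y)) + (1 / 2 : ℝ) • V σ y +
      (1 / 2 : ℝ) • fderiv ℝ (V σ) y y - (Δ (V σ)) y +
        (convect (V σ) (U σ) y + convect (U σ) (V σ) y) +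
        gradient (fun y => 2 * pressurePotentialSym (V σ) (U σ) y) y + W σ y = 0 := by
  -- the derived families are jointly smooth
  have hU' : IsSmoothSpaceTimeOn Set.univ V := by
    rw [hV]; exact hU.isSmoothSpaceTimeOn_deriv isOpen_univ
  have hU'' : IsSmoothSpaceTimeOn Set.univ W := by
    rw [hW]; exact hU'.isSmoothSpaceTimeOn_deriv isOpen_univ
  have hU₁ : IsSmoothSpaceTimeOn Set.univ fun σ y => fderiv ℝ (U σ) y :=
    hU.isSmoothSpaceTimeOn_fderiv_of_isOpen isOpen_univ
  have hU'₁ : IsSmoothSpaceTimeOn Set.univ fun σ y => fderiv ℝ (V σ) y :=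
    hU'.isSmoothSpaceTimeOn_fderiv_of_isOpen isOpen_univ
  -- jet-wise `σ`-derivatives (Schwarz)
  have h0 : ∀ τ y, HasDerivAt (fun τ' => U τ' y) (V τ y) τ := by
    intro τ y
    have h := hU.hasDerivAt_timeLine isOpen_univ (Set.mem_univ τ) y
    rw [hV]; exact h
  have h0' : ∀ τ y, HasDerivAt (fun τ' => V τ' y) (W τ y) τ := by
    intro τ y
    have h := hU'.hasDerivAt_timeLine isOpen_univ (Set.mem_univ τ) y
    rw [hW]; exact h
  have h1 : ∀ τ y, HasDerivAt (fun τ' => fderiv ℝ (U τ') y) (fderiv ℝ (V τ) y) τ := by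
    intro τ y
    have h := hU.hasDerivAt_fderiv_slice_clm isOpen_univ (Set.mem_univ τ) y
    rw [hV]; exact h
  have h2 : ∀ τ y, HasDerivAt (fun τ' => fderiv ℝ (fderiv ℝ (U τ')) y)
      (fderiv ℝ (fderiv ℝ (V τ)) y) τ := by
    intro τ y
    have h := hU₁.hasDerivAt_fderiv_slice_clm isOpen_univ (Set.mem_univ τ) y
    have he : (fun y => deriv (fun τ' => fderiv ℝ (U τ') y) τ) = fderiv ℝ (V τ) :=
      funext fun y => (h1 τ y).deriv
    rw [he] at h
    exact h
  -- `∇P(τ) = R(τ)` read off the equation; `R` and its `τ`-derivative `R′` are jointly continuous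
  have hGR : ∀ τ y, gradient (pressurePotential (U τ)) y =
      -(V τ y + (α • (rotGen (U τ y) - fderiv ℝ (U τ) y (rotGen y)) +
        (1 / 2 : ℝ) • U τ y + (1 / 2 : ℝ) • fderiv ℝ (U τ) y y - (Δ (U τ)) y +
          convect (U τ) (U τ) y)) := by
    intro τ y
    rw [eq_neg_iff_add_eq_zero, ← heq τ y]
    abel
  have cU := continuous_uncurry_of_smoothSpaceTime_univ_pv hU
  have cV := continuous_uncurry_of_smoothSpaceTime_univ_pv hU'
  have cW := continuous_uncurry_of_smoothSpaceTime_univ_pv hU''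
  have cU₁ := continuous_uncurry_of_smoothSpaceTime_univ_pv hU₁
  have cV₁ := continuous_uncurry_of_smoothSpaceTime_univ_pv hU'₁
  have cUU : Continuous (uncurry fun τ y => convect (U τ) (U τ) y) := cU₁.clm_apply cU
  have cUV : Continuous (uncurry fun τ y => convect (U τ) (V τ) y + convect (V τ) (U τ) y) :=
    (cV₁.clm_apply cU).add (cU₁.clm_apply cV)
  have hRc := continuous_rest (T := fun τ y => convect (U τ) (U τ) y) cU cV cUU cU₁
    (continuous_uncurry_laplacian hU) α
  have hR'c := continuous_rest (T := fun τ y => convect (U τ) (V τ) y + convect (V τ) (U τ) y)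
    cV cW cUV cV₁ (continuous_uncurry_laplacian hU') α
  -- the pressure family: differentiable slices, `∂ₛQ[U(σ)] = 2Qˢ[V, U]`, differentiable `P′`
  have hP : ∀ τ, Differentiable ℝ (pressurePotential (U τ)) := fun τ =>
    (contDiff_pressurePotential_decay_top (hU.contDiff_slice (Set.mem_univ τ)) (hC τ)).differentiable
      (by simp)
  have hD₀ : ∀ σ y, ‖deriv (fun τ => U τ y) σ‖ ≤ D / (1 + ‖y‖) := by
    intro σ y; have h := hD σ y; rw [hV] at h; exact h
  have hK'₀ : ∀ σ y, ‖deriv (fun τ => U τ y) σ‖ ≤ K' ∧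
      ‖fderiv ℝ (fun y => deriv (fun τ => U τ y) σ) y‖ ≤ K' ∧
      ‖fderiv ℝ (fderiv ℝ (fun y => deriv (fun τ => U τ y) σ)) y‖ ≤ K' := by
    intro σ y; have h := hK' σ y; rw [hV] at h; exact h
  have hPd : ∀ τ y, HasDerivAt (fun τ' => pressurePotential (U τ') y)
      (2 * pressurePotentialSym (V τ) (U τ) y) τ := by
    intro τ y
    have h := hasDerivAt_pressurePotential_of_isSmoothSpaceTimeOn (s := τ) hU hC hD₀ hK hK'₀ y
    rw [hV]; exact h
  have hP' : Differentiable ℝ fun y => 2 * pressurePotentialSym (V σ) (U σ) y :=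
    differentiable_two_mul_pressurePotentialSym (hU'.contDiff_slice (Set.mem_univ σ))
      (hU.contDiff_slice (Set.mem_univ σ)) (hD σ) (hC σ)
  -- exchange `∂ₛ∇P = ∇∂ₛP` and conclude
  have hgrad := gradient_eq_of_hasDerivAt_family (P := fun τ => pressurePotential (U τ))
    (P' := fun τ y => 2 * pressurePotentialSym (V τ) (U τ) y) hP hGR hRc
    (fun τ y => hasDerivAt_rest (α := α) y (h0 τ y) (h0' τ y) (h1 τ y) (h2 τ y)) hR'c hPd hP' y
  rw [hgrad]
  abel

end DSlice

end PineauVicol2026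

end Literature.Analysis.FluidPDE
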